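import Literature.MathematicalPhysics.QuantumFieldTheory.Balaban1983to89.B4Eq47Expansion
import Literature.MathematicalPhysics.QuantumFieldTheory.Balaban1983to89.B4Ineq410FirstOrder

/-!
# `Balaban1983to89.B4Eq411Remainder` — T. Bałaban, *Regularity and decay of lattice Green's functions*, Commun. Math.
# Phys. **89** (1983) 571–597 [Balaban1983RegularityDecay], §4 pp. 590–591 [PDF 20–21]: **the second-order remainder
# of the expansion of (4.7) in `A′`** — «Using Lemma 2.1 the remaining terms can be easily estimated by
# O(e²p²(e))(|φ(x)|² + |φ(x′)|²)» — PROVED as a kernel theorem on the two-block Neumann box `Δ(x,x′)` for the flow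
# `e^{tq}` of (1.2), and with it **(4.11) in full**: r01's `B4Ineq410GaugeOut.ineq411` with both hypotheses (`hF`: the
# first-order bound (4.10), `B4Ineq410FirstOrder`; `hR`: this file) discharged

statement-level skeleton of published theorems with citation tags; proofs where landed; nothing here is a claim about the Yang–Mills mass gap

PDF held: `paper:balaban1983-cmp89-regularity-decay` (renders `run/shared/lean/pub/pub-balaban/b2b-balaban-ref1/pages/
1983-cmp89-regularity-decay/1983-cmp89-regularity-decay-p020-x2.png`, `…-p021-x2.png`, READ AS IMAGES; journal page =
PDF page + 570).

CITATION HEADER (lean-in-tree rule).  lit-balaban cell (HOME `run/shared/lean/pub/lit-balaban/`), block B4 (fold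
owner r01), SKELETON row **`B4.Eq4.11`** ((4.8)–(4.13)); written by the block's second reader, unit `lit-balaban-r04`
gen 12 (free-target protocol, TAKING 2026-08-22T05:32Z / 06:22Z, r01 named, no objection).  Third file of the
programme `B4Eq48FirstOrder` ((4.8)) → `B4Eq49TwoBlockGreen` ((4.9)) → `B4Ineq410FirstOrder` ((4.10), first
inequality) → `B4Eq47Expansion` (the exact expansion) → THIS FILE (the estimate of the remainder, (4.11)).  Inputs USED
BY NAME, not re-proved: `B4Eq47Expansion` (`uFld`, `resid`, `remainder411_eq`, `form_b4Op_sub_sub_dH`, `form_b4Op_sub`,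
`dotProduct_inv_mulVec_le_of_forall`); `B4Ineq410FirstOrder` (the box carrier `lhs47Box`/`firstOrder48Box`/`outWtB`/
`siteX`/`siteX'`, `fld_phiK0_box`, the counting lemmas, `firstOrder48_constBond`, `constBond_add_eq_bondGauge`,
`ineq411_box`, the `siteNorm` plumbing); `B4Eq49TwoBlockGreen.eq49` ((4.9)); `B4Eq48FirstOrder` (`dT`, `dD`, `dH`);
`B4Eq12ExpFlow` (`expFlow`, `expFlow_lipschitz`); **`B4Lower18Regular.lower18_regular_box`** (the uniform positivity
(1.8) on fine boxes for `|κ(A − A₀)_b| ≤ θ/n` — the kernel content of Lemma 2.1's setting (2.23)–(2.26), r01) with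
`isUnit_det_of_form_ge`, `covOp_form`, `lsum`/`transport_fieldLink`/`PathRel`; r01's `B4Ineq410GaugeOut` (`lhs47`,
`lhs47_bondGauge`, `lhs47_constBond`, `gaugeOut`); `B4GaugeCovariance` ((1.3)–(1.6)); `B4Lemma21Region.siteNorm` with
`B4Lemma22Reduce231`/`B4Lemma22ReduceDeriv`/`B4Lemma22ReduceZero`/`B4Lemma22HolderBox` API.

## THE PRINT (verbatim, p. 590 [PDF 20] and p. 591 [PDF 21]; `≦` written `≤`)

p. 590: *"We expand the expression on the left hand side of (4.7) with respect to A′ using (I.3.15), (I.3.44), and we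
separate terms of first order in e. Using Lemma 2.1 the remaining terms can be easily estimated by
O(e²p²(e))(|φ(x)|² + |φ(x′)|²)."*   p. 591: *"Thus we get (the left hand side of (4.7)) ≥ (the left hand side of (4.7)
with A replaced by A₀) − δ|U(A₀(⟨x,x′⟩))φ(x′) − φ(x)|² − O(δ^{−1})e²p²(e)(|φ(x)|² + |φ(x′)|²). (4.11)"*

## WHAT IS CERTIFIED (kernel theorems; zero `sorry`, standard axioms; no `Prop`-valued statement is introduced)

Notation as in `B4Eq47Expansion`: `H_i` (1.6) at `A₀ = 0` resp. `A₁ = A′`, `G₁ = H₁⁻¹`, `Q_i` (1.4), `u₀ = G₀Q₀ᵀφ`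
(`φ^{(k)} = a_ku₀`), `D_i` (1.3), `r = (Q₁−Q₀)ᵀφ − (H₁−H₀)u₀`; the remainder is `R = −a_k²[⟨r,G₁r⟩ + 2⟨u₀,(Q₁−Q₀−Q̇)ᵀφ⟩
− ⟨u₀,(H₁−H₀−Ḣ)u₀⟩]` (`B4Eq47Expansion.remainder411_eq`).  Field bounds: `n|κA′_b| ≤ ε₁` on the bonds of `Δ(x,x′)`,
`|κA′(Γ_{y,z})| ≤ ε₂` on its block contours (print: both `O(1)ep(e)`); `ℓ² = Σ_{ij}q_{ij}²`; `v = φ(x)`, `w = φ(x′)`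
(after the gauge-away: `w = U(A₀(⟨x,x′⟩))φ(x′)`), `N = |v| + |w|`.
* §1 **`expFlow_taylor₂`** — `|(e^{tq} − 1 − tq)v| ≤ ℓ²t²|v|` (mean value inequality; the source of `e²`).
* §2 the kernels of the expansion at the background `0`, sitewise: `(D₁−D₀)φ = (U(κA′)−1)φ(y)`
  (`fld_bondDiff_sub_mulVec`), `(D₁−D₀−Ḋ)φ = (U(κA′)−1−κA′q)φ(y)` (`fld_bondDiff_taylor_mulVec`), `((Q₁−Q₀)φ)(y) =
  Σ_z q(y,z)(U(κA′(Γ_{y,z}))−1)φ(z)` (`fld_avgOp_sub_mulVec`), `((Q₁−Q₀−Q̇)φ)(y)` (`fld_avgOp_taylor_mulVec`).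
* §3–§4 the sizes on `Δ(x,x′)` (bond weight `n²/2`, `≤ 2(d+1)` neighbours, `2n^{d+1}` points, blocks of `n^{d+1}`
  points, `|u₀(z)| ≤ n^{−(d+1)/2}B₁`, `n|u₀(z′)−u₀(z)| ≤ n^{−(d+1)/2}B₂`): `Σc|(D₁−D₀)u₀|² ≤ 2(d+1)ℓ²ε₁²B₁²`
  (`sum_bondDiff_sq_le`), `|2Σc⟨D₀u₀,(D₁−D₀−Ḋ)u₀⟩| ≤ 8(d+1)ℓ²ε₁²B₁²` (`sum_bond_taylor_cross_le`),
  `a n^{−(d+1)}Σ|(Q₁−Q₀)u₀|² ≤ 2aℓ²ε₂²B₁²` (`sum_blockDiff_sq_le`), `|2a n^{−(d+1)}Σ⟨Q₀u₀,(Q₁−Q₀−Q̇)u₀⟩| ≤ 4aℓ²ε₂²B₁²`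
  (`sum_block_taylor_cross_le`), `|⟨u₀,(Q₁−Q₀−Q̇)ᵀφ⟩| ≤ 2Nℓ²ε₂²B₁` (`sum_outer_taylor_le`); and for every test field
  `y` the pairings entering `⟨r,y⟩`: `sum_bond_pairD_le` (against the energy `Σc|D₁y|²`), `sum_bond_pairX_le` (against
  `|y|²`, using the DERIVATIVE bound of (4.9) to cancel the bond weight), `sum_block_pairA_le`/`sum_block_pairB_le`/
  `sum_outer_pair_le` (linear in `Σ_z|y(z)|`).
* §5 the three brackets on the box, sitewise (`form_H_taylor_box`, `outer_taylor_box`, `resid_dotProduct_box`), and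
  `bond_energy_le_form` (`Σc|U y(z′) − y(z)|² ≤ ⟨y,H(A′)y⟩`).
* §6 **`variational_M`** — «Using Lemma 2.1»: with the uniform positivity `⟨y,H(A′)y⟩ ≥ γ|y|²`, for EVERY `y`,
  `2⟨r,y⟩ − ⟨y,H(A′)y⟩ ≤ M = 4(d+1)ℓ²ε₁²B₁² + 8(d+1)²ℓ²ε₁²B₂²/γ + 8ℓ²ε₂²(2aB₁+N)²/γ`, whence `0 ≤ ⟨r,G₁r⟩ ≤ M`
  (`B4Eq47Expansion.dotProduct_inv_mulVec_le_of_forall`, `dotProduct_inv_mulVec_nonneg_of_coercive`) — no operator norm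
  of `G₁` against the (large, `O(n)`) `ℓ²`-norm of `r` is ever taken.
* §7 **`remainder_bound_zero`** — ∃ `K = K(d, ℓ², a₋, a₊, C₍₄.₉₎) ≥ 0` ∀ `n ≥ 1`, `a_k ∈ [a₋,a₊]`, `m² ∈ [0,m²₊]`, `μ`,
  `κ`, block sites, nearest-neighbour contours of length `≤ (d+1)n` ending at their targets, `A′` with the field bounds,
  under `ℓ²ε₁²(d+1)(1+a_k(d+1)) ≤ min(2,a_k)/4`, ∀ `φ`:
  `|LHS(4.7)(A′) − LHS(4.7)(0) − (4.8)(0,A′)| ≤ K(ε₁+ε₂)²(|φ(x)|² + |φ(x′)|²)`.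
* §8 `remainder_constBond_eq` (the remainder at a constant `A₀` is the remainder at `0` for the gauged field `φ″`),
  **`remainder_bound_constBond`** (the hypothesis `hR` of `ineq411`/`ineq411_box`, discharged), and **`ineq411_full`**
  — (4.11): `LHS(4.7)(A₀+A′) ≥ LHS(4.7)(A₀) − δ|U(κA₀(x→x′))φ(x′) − φ(x)|² − (K²/(2δ) + K_R)(ε₁+ε₂)²(|φ(x)|² + |φ(x′)|²)`
  for every `δ > 0`, with NO hypothesis on `φ` and no undischarged analytic input.

## DICTIONARY (print ↦ Lean; as in `B4Ineq410FirstOrder`)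

`O(e²p²(e))` ↦ `K(ε₁+ε₂)²`; `O(δ^{−1})e²p²(e)` ↦ `(K²/(2δ) + K_R)(ε₁+ε₂)²` (`K` of (4.10), `K_R` of §8); «Using Lemma
2.1» ↦ the uniform positivity (1.8) of `H(A′)` on the box under the smallness of Lemma 2.1's setting
(`B4Lower18Regular.lower18_regular_box`: `γ = min(2,a_k)/4 + m²`), which is the only property of `G_k(Δ,A)` the
estimate needs; «(I.3.15), (I.3.44)» (the perturbative expansions of paper I) ↦ the resolvent identity of
`B4Eq47Expansion`.

## HONEST SCOPE / located readings

(a) HYPOTHESES KEPT EXPLICIT: the smallness `ℓ²ε₁²(d+1)(1+a_k(d+1)) ≤ min(2,a_k)/4` (print: «for e sufficiently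
small», Lemma 2.1; a threshold `e₁` is `B4Lower18Regular.threshold_exists`), the nearest-neighbour contours of length
`≤ (d+1)n` ending at their targets (print: the contours `Γ^{(k)}_{y,x}` of §1; `B4Lower18Regular.stairContour` is an
instance), and the two field bounds `ε₁`, `ε₂` (print: `|A′|, |∂^η_μA′| ≤ O(1)p(e)`; `ε₂ ≤ (d+1)ε₁` along such contours,
`B4Lower18Regular.pertT_bound`, not substituted here).  (b) The constants are explicit polynomials in `d`, `ℓ²`,
`C₍₄.₉₎`, `1/a₋`, `max(a₊,0)`, `4/min(2,a₋)`; uniform in `n`, `μ`, `κ`, `emb`, `Γ`, `A₀`, `A′`, `φ`, `δ`, as printed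
(«γ₀′ independent of k, ⟨x,x′⟩, and A»).  (c) The print bounds the remainder by citing Lemma 2.1 (regularity AND decay
of `G_k`); the proof here uses only positivity — a located reading, lighter than the print's tool, same conclusion.
(d) The derivative bound of (4.9) (second line) is essential in ONE place (`sum_bond_pairX_le`): the pairing
`⟨D₀u₀, (D₁−D₀)y⟩` carries the bond weight `η^{−2}` against a single factor `η` from `U(eηA′) − 1`, and only
`|∂u₀| = O(η)·n^{−(d+1)/2}` restores uniformity in the scale.  (e) As in `B4Ineq410FirstOrder`, the first line of (4.8)
is taken with r01's normalisation of (4.7) on the box (`outWtB`); (4.11) is insensitive to it.  (f) No existing module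
is modified; two `import`s.
-/

namespace Literature.MathematicalPhysics.QuantumFieldTheory.Balaban1983to89.B4Eq411Remainder

open Finset Matrix NormedSpace
open Literature.MathematicalPhysics.QuantumFieldTheory.Balaban1983to89.B4GaugeCovariance
open Literature.MathematicalPhysics.QuantumFieldTheory.Balaban1983to89.B4Lemma21Region (siteNorm)
open Literature.MathematicalPhysics.QuantumFieldTheory.Balaban1983to89.B4Lemma22Reduce231
open Literature.MathematicalPhysics.QuantumFieldTheory.Balaban1983to89.B4Eq12ExpFlow (expFlow expFlow_U expFlow_lipschitz)
open Literature.MathematicalPhysics.QuantumFieldTheory.Balaban1983to89.B4Lower18Regular (lsum transport_fieldLink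
  dotProduct_eq_sum_fld dotProduct_self_nonneg')
open Literature.MathematicalPhysics.QuantumFieldTheory.Balaban1983to89.B4Lemma22ReduceDeriv (siteNorm_flow
  siteNorm_flow_sub_one_le fld_sub)
open Literature.MathematicalPhysics.QuantumFieldTheory.Balaban1983to89.B4Lemma22ReduceZero (siteNorm_sum_le)
open Literature.MathematicalPhysics.QuantumFieldTheory.Balaban1983to89.B4Eq48FirstOrder (dT dD dH)
open Literature.MathematicalPhysics.QuantumFieldTheory.Balaban1983to89.B4Eq47Expansion
  (uFld resid remainder411_eq form_b4Op_sub_sub_dH form_b4Op_sub dotProduct_inv_mulVec_le_of_forall)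
open Literature.MathematicalPhysics.QuantumFieldTheory.Balaban1983to89.B4Lower18Regular
  (covOp_form lower18_regular_box isUnit_det_of_form_ge PathRel)
open Literature.MathematicalPhysics.QuantumFieldTheory.Balaban1983to89.B4Ineq410GaugeOut
  (lhs47 lhs47_bondGauge lhs47_constBond gaugeOut gaugeOut_fld gaugeOut_fld_base)
open Literature.MathematicalPhysics.QuantumFieldTheory.Balaban1983to89.B4Ineq410FirstOrder
  (contourTrans_zero constBond_add_eq_bondGauge firstOrder48_constBond scalarOp_box_isUnit ineq411_box outWtB firstOrder48Box lhs47Box siteX siteX' eq_siteX_or siteX_ne_siteX' univ_eq_pair sum_Y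
    sum_blkWt_box card_box card_nbrs_box_le fld_phiK0_box siteNorm_le_of_abs_le siteNorm_mulVec_le
    siteNorm_mulVec_of_orth siteNorm_sub_comm)
open Literature.MathematicalPhysics.QuantumFieldTheory.Balaban1983to89.B4Eq49TwoBlockGreen
  (twoBlk one_le_twoBlk mem_boxDom_twoBlk zero_mem_boxDom_twoBlk single_mem_boxDom_twoBlk blk_twoBlk phiK eq49)
open Literature.MathematicalPhysics.QuantumFieldTheory.Balaban1983to89.B4Reflection242
  (boxDom nbrs mem_nbrs card_nbrs nbrs_comm blk blk_mem_boxDom mem_boxDom)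
open Literature.MathematicalPhysics.QuantumFieldTheory.Balaban1983to89.B4BoxCov237 (card_filter_blk)

noncomputable section

section Taylor

variable {ι : Type} [Fintype ι] [DecidableEq ι]

omit [DecidableEq ι] in
/-- the Euclidean norm of `toLp 2 w` is `siteNorm w`. [folklore] -/
private theorem norm_toLp_eq_siteNorm (w : ι → ℝ) : ‖(WithLp.toLp 2 w : EuclideanSpace ℝ ι)‖ = siteNorm w := by
  have h : ‖(WithLp.toLp 2 w : EuclideanSpace ℝ ι)‖ ^ 2 = w ⬝ᵥ w := by
    rw [EuclideanSpace.norm_sq_eq]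
    simp [dotProduct, sq]
  rw [siteNorm, ← h, Real.sqrt_sq (norm_nonneg _)]

open scoped Matrix.Norms.Operator in
/-- **THE SECOND-ORDER TAYLOR REMAINDER OF THE LINK VARIABLES (1.2)**: `|(e^{tq} − 1 − tq)v| ≤ ℓ²t²|v|` for all
real `t`, `ℓ = (Σ_{ij} q_{ij}²)^{1/2}` — from `d/du(e^{uq}v − v − uqv) = q(e^{uq} − 1)v`, the Lipschitz bound
`|(e^{uq} − 1)v| ≤ ℓ|u||v|` (`B4Eq12ExpFlow.expFlow_lipschitz`) and the mean value inequality; the source of the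
`e²` in «the remaining terms can be easily estimated by O(e²p²(e))». [cite: Balaban1983RegularityDecay, (1.2) p.572, p.590] -/
theorem expFlow_taylor₂ (q : Matrix ι ι ℝ) (hq : qᵀ = -q) (t : ℝ) (v : ι → ℝ) :
    siteNorm (((expFlow q hq).U t - 1 - t • q) *ᵥ v) ≤ (∑ i, ∑ j, q i j ^ 2) * t ^ 2 * siteNorm v := by
  haveI : CompleteSpace (Matrix ι ι ℝ) := FiniteDimensional.complete ℝ (Matrix ι ι ℝ)
  set ℓ : ℝ := Real.sqrt (∑ i, ∑ j, q i j ^ 2) with hℓ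
  have hℓ2 : ℓ ^ 2 = ∑ i, ∑ j, q i j ^ 2 := Real.sq_sqrt (by positivity)
  have hℓ0 : 0 ≤ ℓ := Real.sqrt_nonneg _
  -- the linear map `M ↦ Mv` into Euclidean space (plumbing for the mean value inequality)
  let Lₗ : Matrix ι ι ℝ →ₗ[ℝ] EuclideanSpace ℝ ι :=
    { toFun := fun M => WithLp.toLp 2 (M *ᵥ v)
      map_add' := fun M N => by rw [Matrix.add_mulVec]; rfl
      map_smul' := fun r M => by rw [Matrix.smul_mulVec]; rfl }
  set L : Matrix ι ι ℝ →L[ℝ] EuclideanSpace ℝ ι := LinearMap.toContinuousLinearMap Lₗ with hL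
  have hLapp : ∀ M, L M = WithLp.toLp 2 (M *ᵥ v) := fun M => rfl
  -- the path `g(u) = e^{uq}v − u·qv` and its derivative `q(e^{uq} − 1)v`
  set g : ℝ → EuclideanSpace ℝ ι := fun u => L (exp (u • q)) - u • L q with hg
  have hderiv : ∀ u, HasDerivAt g (L (q * exp (u • q)) - L q) u := by
    intro u
    have h1 : HasDerivAt (fun u : ℝ => L (exp (u • q))) (L (q * exp (u • q))) u :=
      L.hasFDerivAt.comp_hasDerivAt u (hasDerivAt_exp_smul_const' q u)
    have h2 : HasDerivAt (fun u : ℝ => u • L q) ((1 : ℝ) • L q) u := (hasDerivAt_id u).smul_const (L q)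
    rw [one_smul] at h2
    exact h1.sub h2
  -- the bound on the derivative on the segment: `‖q(e^{uq} − 1)v‖ ≤ ℓ²|t||v|` for `u` between `0` and `t`
  have hbound : ∀ u ∈ Set.uIcc 0 t, ‖deriv g u‖ ≤ ℓ ^ 2 * |t| * siteNorm v := by
    intro u hu
    rw [(hderiv u).deriv, ← map_sub, hLapp, norm_toLp_eq_siteNorm, show (q * exp (u • q) - q) = q * ((expFlow q hq).U u - 1) by
        rw [expFlow_U, Matrix.mul_sub, Matrix.mul_one], ← Matrix.mulVec_mulVec]
    have hu' : |u| ≤ |t| := by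
      rcases Set.mem_uIcc.1 hu with ⟨h0, h1⟩ | ⟨h0, h1⟩
      · rw [abs_of_nonneg h0, abs_of_nonneg (h0.trans h1)]; exact h1
      · rw [abs_of_nonpos h1, abs_of_nonpos (h0.trans h1)]; linarith
    calc siteNorm (q *ᵥ (((expFlow q hq).U u - 1) *ᵥ v)) ≤ ℓ * siteNorm (((expFlow q hq).U u - 1) *ᵥ v) :=
          siteNorm_mulVec_le q _
      _ ≤ ℓ * (ℓ * |u| * siteNorm v) :=
          mul_le_mul_of_nonneg_left
            (siteNorm_flow_sub_one_le (expFlow q hq) hℓ0 (expFlow_lipschitz q hq) u v) hℓ0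
      _ ≤ ℓ * (ℓ * |t| * siteNorm v) := by gcongr; exact siteNorm_nonneg v
      _ = ℓ ^ 2 * |t| * siteNorm v := by ring
  -- the mean value inequality on the segment `[0, t]`
  have hmvi := Convex.norm_image_sub_le_of_norm_deriv_le (f := g) (s := Set.uIcc 0 t)
    (fun u _ => (hderiv u).differentiableAt) hbound (convex_uIcc 0 t) Set.left_mem_uIcc Set.right_mem_uIcc
  have hg0 : g t - g 0 = WithLp.toLp 2 ((((expFlow q hq).U t - 1 - t • q) *ᵥ v)) := by
    have e1 : g t = WithLp.toLp 2 (exp (t • q) *ᵥ v) - t • WithLp.toLp 2 (q *ᵥ v) := by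
      simp only [hg, hLapp]
    have e2 : g 0 = WithLp.toLp 2 v := by
      simp only [hg, hLapp, zero_smul, NormedSpace.exp_zero, sub_zero, Matrix.one_mulVec]
    rw [e1, e2, ← WithLp.toLp_smul, ← WithLp.toLp_sub, ← WithLp.toLp_sub]
    congr 1
    rw [Matrix.sub_mulVec, Matrix.sub_mulVec, Matrix.one_mulVec, Matrix.smul_mulVec, expFlow_U]
    exact sub_right_comm _ _ _
  rw [← norm_toLp_eq_siteNorm, ← hg0]
  calc ‖g t - g 0‖ ≤ ℓ ^ 2 * |t| * siteNorm v * ‖t - 0‖ := hmvi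
    _ = (∑ i, ∑ j, q i j ^ 2) * t ^ 2 * siteNorm v := by
        rw [sub_zero, Real.norm_eq_abs, hℓ2, mul_assoc, mul_assoc, mul_comm (siteNorm v) |t|, ← mul_assoc,
          ← mul_assoc, mul_assoc (∑ i, ∑ j, q i j ^ 2), ← sq_abs t, sq]

end Taylor

/-! ## §2. The kernels of the expansion at the background `A₀ = 0`: differences and second-order Taylor remainders
of the bond differences (1.3) and of the averaging operators (1.4), sitewise -/

section Kernels

variable {X Y : Type*} {ι : Type} [Fintype X] [Fintype Y] [Fintype ι] [DecidableEq X] [DecidableEq Y]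
  [DecidableEq ι]

omit [DecidableEq ι] in
/-- a one-site vector pairs through its single site: `⟨z, z′⟩ = ⟨z(·), z′(·)⟩`. [folklore] -/
private theorem dotProduct_unit (z z' : Unit × ι → ℝ) : z ⬝ᵥ z' = fld z () ⬝ᵥ fld z' () := by
  rw [dotProduct_eq_sum_fld, Fintype.sum_unique]

omit [Fintype Y] [DecidableEq Y] in
/-- at `A = 0` the bond difference (1.3) is the plain difference `φ(y) − φ(x)`. [cite: Balaban1983RegularityDecay, (1.3) p.572] -/
theorem fld_bondDiff_zero_mulVec (F : OrthFlow ι) (κ : ℝ) (x y : X) (Φ : X × ι → ℝ) :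
    fld (bondDiff (fieldLink F κ (0 : X → X → ℝ)) x y *ᵥ Φ) () = fld Φ y - fld Φ x := by
  rw [fld_bondDiff_mulVec, fieldLink_zero, Matrix.one_mulVec]

omit [Fintype Y] [DecidableEq Y] in
/-- at a general `A` the bond difference is `U(κA(x,y))φ(y) − φ(x)`. [cite: Balaban1983RegularityDecay, (1.3) p.572] -/
theorem fld_bondDiff_mulVec' (F : OrthFlow ι) (κ : ℝ) (A : X → X → ℝ) (x y : X) (Φ : X × ι → ℝ) :
    fld (bondDiff (fieldLink F κ A) x y *ᵥ Φ) () = F.U (κ * A x y) *ᵥ fld Φ y - fld Φ x :=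
  fld_bondDiff_mulVec _ x y Φ ()

omit [Fintype Y] [DecidableEq Y] in
/-- **`(D₁ − D₀)φ = (U(κA′(x,y)) − 1)φ(y)`** — the first-order difference of the bond differences (1.3) at `A′` and
at `0`. [cite: Balaban1983RegularityDecay, (1.3) p.572, p.590] -/
theorem fld_bondDiff_sub_mulVec (F : OrthFlow ι) (κ : ℝ) (A' : X → X → ℝ) (x y : X) (Φ : X × ι → ℝ) :
    fld ((bondDiff (fieldLink F κ A') x y - bondDiff (fieldLink F κ (0 : X → X → ℝ)) x y) *ᵥ Φ) ()
      = (F.U (κ * A' x y) - 1) *ᵥ fld Φ y := by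
  rw [Matrix.sub_mulVec, fld_sub, fld_bondDiff_mulVec', fld_bondDiff_zero_mulVec, Matrix.sub_mulVec,
    Matrix.one_mulVec]
  abel

omit [Fintype Y] [DecidableEq Y] in
/-- the derivative `Ḋ` of the bond difference at `A₀ = 0` acts by `κA′(x,y)·qφ(y)`. [cite: Balaban1983RegularityDecay, (1.3) p.572, (4.8) p.590] -/
theorem fld_dD_zero_mulVec (q : Matrix ι ι ℝ) (hq : qᵀ = -q) (κ : ℝ) (A' : X → X → ℝ) (x y : X)
    (Φ : X × ι → ℝ) : fld (dD q hq κ (0 : X → X → ℝ) A' x y *ᵥ Φ) () = (κ * A' x y) • (q *ᵥ fld Φ y) := by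
  unfold dD
  rw [fld_blockOp_mulVec, Finset.sum_eq_single y]
  · rw [if_pos rfl, fieldLink_zero, Matrix.mul_one, Matrix.smul_mulVec]
  · intro z _ hz; rw [if_neg hz, Matrix.zero_mulVec]
  · intro h; exact absurd (Finset.mem_univ y) h

omit [Fintype Y] [DecidableEq Y] in
/-- **`(D₁ − D₀ − Ḋ)φ = (U(κA′(x,y)) − 1 − κA′(x,y)q)φ(y)`** — the second-order Taylor remainder of the bond
difference (1.3) in the link variable. [cite: Balaban1983RegularityDecay, (1.2)–(1.3) p.572, p.590] -/
theorem fld_bondDiff_taylor_mulVec (q : Matrix ι ι ℝ) (hq : qᵀ = -q) (κ : ℝ) (A' : X → X → ℝ) (x y : X)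
    (Φ : X × ι → ℝ) :
    fld ((bondDiff (fieldLink (expFlow q hq) κ A') x y - bondDiff (fieldLink (expFlow q hq) κ (0 : X → X → ℝ)) x y
        - dD q hq κ (0 : X → X → ℝ) A' x y) *ᵥ Φ) ()
      = ((expFlow q hq).U (κ * A' x y) - 1 - (κ * A' x y) • q) *ᵥ fld Φ y := by
  rw [Matrix.sub_mulVec ((bondDiff _ x y - bondDiff _ x y)), fld_sub, fld_bondDiff_sub_mulVec, fld_dD_zero_mulVec,
    Matrix.sub_mulVec ((expFlow q hq).U (κ * A' x y) - 1) ((κ * A' x y) • q) (fld Φ y), Matrix.smul_mulVec]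

omit [Fintype X] [Fintype Y] [Fintype ι] [DecidableEq X] [DecidableEq Y] [DecidableEq ι] in
/-- the zero field sums to zero along every contour. [folklore] -/
private theorem lsum_zero (x : X) (l : List X) : lsum (0 : X → X → ℝ) x l = 0 := by
  have h := B4Eq48FirstOrder.lsum_smul 0 (0 : X → X → ℝ) x l
  rwa [zero_smul, zero_mul] at h

omit [Fintype X] [Fintype Y] [Fintype ι] [DecidableEq X] [DecidableEq Y] [DecidableEq ι] in
/-- averaging operators are linear in the transporters. [folklore] -/
private theorem avgOp_sub (qw : Y → X → ℝ) (T₁ T₀ : Y → X → Matrix ι ι ℝ) :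
    avgOp qw T₁ - avgOp qw T₀ = avgOp qw (T₁ - T₀) := by
  unfold avgOp
  rw [← blockOp_sub]
  congr 1
  funext y x
  simp only [Pi.sub_apply, smul_sub]

omit [Fintype Y] [DecidableEq X] [DecidableEq Y] in
/-- at `A = 0` the averaging operator (1.4) is the plain block average `Σ_x q(y,x)φ(x)`. [cite: Balaban1983RegularityDecay, (1.4) p.572] -/
theorem fld_avgOp_zero_mulVec (F : OrthFlow ι) (κ : ℝ) (qw : Y → X → ℝ) (emb : Y → X) (Γ : Y → X → List X)
    (Φ : X × ι → ℝ) (y : Y) :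
    fld (avgOp qw (contourTrans (fieldLink F κ (0 : X → X → ℝ)) emb Γ) *ᵥ Φ) y = ∑ x, qw y x • fld Φ x := by
  rw [contourTrans_zero, fld_avgOp_mulVec]
  simp only [Matrix.one_mulVec]

omit [Fintype Y] [DecidableEq X] [DecidableEq Y] in
/-- at a general `A` the averaging operator transports by `U(κA(Γ_{y,x}))`. [cite: Balaban1983RegularityDecay, (1.4) p.572] -/
theorem fld_avgOp_mulVec' (F : OrthFlow ι) (κ : ℝ) (qw : Y → X → ℝ) (emb : Y → X) (Γ : Y → X → List X)
    (A : X → X → ℝ) (Φ : X × ι → ℝ) (y : Y) :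
    fld (avgOp qw (contourTrans (fieldLink F κ A) emb Γ) *ᵥ Φ) y
      = ∑ x, qw y x • (F.U (κ * lsum A (emb y) (Γ y x)) *ᵥ fld Φ x) := by
  rw [fld_avgOp_mulVec]
  simp only [contourTrans, transport_fieldLink]

omit [Fintype Y] [DecidableEq X] [DecidableEq Y] in
/-- **`((Q₁ − Q₀)φ)(y) = Σ_x q(y,x)(U(κA′(Γ_{y,x})) − 1)φ(x)`** — the first-order difference of the averaging
operators (1.4) at `A′` and at `0`. [cite: Balaban1983RegularityDecay, (1.4) p.572, p.590] -/
theorem fld_avgOp_sub_mulVec (F : OrthFlow ι) (κ : ℝ) (qw : Y → X → ℝ) (emb : Y → X) (Γ : Y → X → List X)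
    (A' : X → X → ℝ) (Φ : X × ι → ℝ) (y : Y) :
    fld ((avgOp qw (contourTrans (fieldLink F κ A') emb Γ)
        - avgOp qw (contourTrans (fieldLink F κ (0 : X → X → ℝ)) emb Γ)) *ᵥ Φ) y
      = ∑ x, qw y x • ((F.U (κ * lsum A' (emb y) (Γ y x)) - 1) *ᵥ fld Φ x) := by
  rw [avgOp_sub, fld_avgOp_mulVec]
  refine Finset.sum_congr rfl fun x _ => ?_
  simp only [Pi.sub_apply, contourTrans, transport_fieldLink, lsum_zero, mul_zero, F.map_zero]

omit [Fintype Y] [DecidableEq X] [DecidableEq Y] in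
/-- **`((Q₁ − Q₀ − Q̇)φ)(y) = Σ_x q(y,x)(U(κA′(Γ_{y,x})) − 1 − κA′(Γ_{y,x})q)φ(x)`** — the second-order Taylor
remainder of the averaging operator (1.4). [cite: Balaban1983RegularityDecay, (1.2), (1.4) p.572, p.590] -/
theorem fld_avgOp_taylor_mulVec (q : Matrix ι ι ℝ) (hq : qᵀ = -q) (κ : ℝ) (qw : Y → X → ℝ) (emb : Y → X)
    (Γ : Y → X → List X) (A' : X → X → ℝ) (Φ : X × ι → ℝ) (y : Y) :
    fld ((avgOp qw (contourTrans (fieldLink (expFlow q hq) κ A') emb Γ)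
        - avgOp qw (contourTrans (fieldLink (expFlow q hq) κ (0 : X → X → ℝ)) emb Γ)
        - avgOp qw (dT q hq κ emb Γ (0 : X → X → ℝ) A')) *ᵥ Φ) y
      = ∑ x, qw y x • (((expFlow q hq).U (κ * lsum A' (emb y) (Γ y x)) - 1 - (κ * lsum A' (emb y) (Γ y x)) • q)
          *ᵥ fld Φ x) := by
  rw [avgOp_sub, avgOp_sub, fld_avgOp_mulVec]
  refine Finset.sum_congr rfl fun x _ => ?_
  simp only [Pi.sub_apply, dT, contourTrans, transport_fieldLink, lsum_zero, mul_zero, (expFlow q hq).map_zero,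
    Matrix.mul_one]

end Kernels

/-! ## §3. Pointwise sizes: the link-variable factors against the field bounds `n|κA′_b| ≤ ε₁`, `|κA′(Γ)| ≤ ε₂` -/

section Pointwise

variable {ι : Type} [Fintype ι] [DecidableEq ι]

/-- `n·|(U(t) − 1)w| ≤ ℓ·ε·|w|` when `n|t| ≤ ε`. [cite: Balaban1983RegularityDecay, (1.2) p.572, p.590] -/
theorem flow_sub_one_scaled (F : OrthFlow ι) {ℓ : ℝ} (hℓ : 0 ≤ ℓ)
    (hLip : ∀ t (v : ι → ℝ), ((F.U t - 1) *ᵥ v) ⬝ᵥ ((F.U t - 1) *ᵥ v) ≤ (ℓ * t) ^ 2 * (v ⬝ᵥ v))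
    {n t ε : ℝ} (hn : 0 ≤ n) (ht : n * |t| ≤ ε) (w : ι → ℝ) :
    n * siteNorm ((F.U t - 1) *ᵥ w) ≤ ℓ * ε * siteNorm w := by
  calc n * siteNorm ((F.U t - 1) *ᵥ w) ≤ n * (ℓ * |t| * siteNorm w) :=
        mul_le_mul_of_nonneg_left (siteNorm_flow_sub_one_le F hℓ hLip t w) hn
    _ = ℓ * (n * |t|) * siteNorm w := by ring
    _ ≤ ℓ * ε * siteNorm w := by gcongr; exact siteNorm_nonneg w

/-- `n²·|(U(t) − 1 − tq)w| ≤ ℓ²·ε²·|w|` when `n|t| ≤ ε`. [cite: Balaban1983RegularityDecay, (1.2) p.572, p.590] -/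
theorem taylor_scaled (q : Matrix ι ι ℝ) (hq : qᵀ = -q) {n t ε : ℝ} (hn : 0 ≤ n) (ht : n * |t| ≤ ε) (w : ι → ℝ) :
    n ^ 2 * siteNorm (((expFlow q hq).U t - 1 - t • q) *ᵥ w) ≤ (∑ i, ∑ j, q i j ^ 2) * ε ^ 2 * siteNorm w := by
  have h0 : 0 ≤ ∑ i, ∑ j, q i j ^ 2 := by positivity
  have h1 : (n * |t|) ^ 2 ≤ ε ^ 2 := pow_le_pow_left₀ (mul_nonneg hn (abs_nonneg t)) ht 2
  calc n ^ 2 * siteNorm (((expFlow q hq).U t - 1 - t • q) *ᵥ w)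
      ≤ n ^ 2 * ((∑ i, ∑ j, q i j ^ 2) * t ^ 2 * siteNorm w) :=
        mul_le_mul_of_nonneg_left (expFlow_taylor₂ q hq t w) (pow_nonneg hn 2)
    _ = (∑ i, ∑ j, q i j ^ 2) * (n * |t|) ^ 2 * siteNorm w := by rw [mul_pow, sq_abs]; ring
    _ ≤ (∑ i, ∑ j, q i j ^ 2) * ε ^ 2 * siteNorm w := by gcongr; exact siteNorm_nonneg w

omit [DecidableEq ι] in
/-- `|Σ_x q(y,x)·w_x| ≤ Σ_x q(y,x)|w_x|` for non-negative weights. [folklore] -/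
private theorem siteNorm_wsum_le {X : Type*} [Fintype X] {ω : X → ℝ} (hω : ∀ x, 0 ≤ ω x) (w : X → ι → ℝ) :
    siteNorm (∑ x, ω x • w x) ≤ ∑ x, ω x * siteNorm (w x) := by
  refine (siteNorm_sum_le _ _).trans (Finset.sum_le_sum fun x _ => ?_)
  rw [siteNorm_smul, abs_of_nonneg (hω x)]

end Pointwise

/-! ## §4. The two-block box `Δ(x,x′)`: counting, and the sizes of the six second-order terms -/

section Box

variable {d : ℕ} {ι : Type} [Fintype ι] [DecidableEq ι]

omit [Fintype ι] [DecidableEq ι] in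
/-- every fine point of `Δ(x,x′)` lies in exactly one of the two blocks: `Σ_y 1[x ∈ B^k(y)] = 1`. [cite: Balaban1983RegularityDecay, p.590 «Δ(x,x′) = B^k(x) ∪ B^k(x′)», dictionary] -/
theorem sum_blkWt_col_box {n : ℕ} (hn : 1 ≤ n) (μ : Fin (d + 1)) (x : ↥(boxDom (fun i => n * twoBlk μ i))) :
    ∑ y : ↥(boxDom (twoBlk μ)), blkWt n (twoBlk μ) (fun i => n * twoBlk μ i) y x = 1 := by
  unfold blkWt
  rw [Finset.sum_coe_sort (s := boxDom (twoBlk μ)) (f := fun w => if blk n x.1 = w then (1 : ℝ) else 0),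
    Finset.sum_ite_eq, if_pos (blk_mem_boxDom hn x.2)]

omit [Fintype ι] [DecidableEq ι] in
/-- **BOND COUNTING ON `Δ(x,x′)`**: a bond function bounded by `B` on nearest-neighbour pairs and vanishing elsewhere
sums to at most `2n^{d+1}·2(d+1)·B`. [cite: Balaban1983RegularityDecay, (1.3) p.572, dictionary] -/
theorem sum_bond_le {n : ℕ} (hn : 1 ≤ n) (μ : Fin (d + 1)) {B : ℝ} (hB : 0 ≤ B)
    (g : ↥(boxDom (fun i => n * twoBlk μ i)) → ↥(boxDom (fun i => n * twoBlk μ i)) → ℝ)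
    (hg : ∀ x y, g x y ≤ if y.1 ∈ nbrs x.1 then B else 0) :
    ∑ x, ∑ y, g x y ≤ 2 * (n : ℝ) ^ (d + 1) * (2 * ((d : ℝ) + 1) * B) := by
  have hcount : ∀ x : ↥(boxDom (fun i => n * twoBlk μ i)),
      ∑ y : ↥(boxDom (fun i => n * twoBlk μ i)), (if y.1 ∈ nbrs x.1 then B else 0) ≤ 2 * ((d : ℝ) + 1) * B := by
    intro x
    rw [Finset.sum_ite, Finset.sum_const_zero, add_zero, Finset.sum_const, nsmul_eq_mul]
    exact mul_le_mul_of_nonneg_right (card_nbrs_box_le μ x) hB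
  calc ∑ x, ∑ y, g x y
      ≤ ∑ x : ↥(boxDom (fun i => n * twoBlk μ i)), ∑ y : ↥(boxDom (fun i => n * twoBlk μ i)),
          (if y.1 ∈ nbrs x.1 then B else 0) :=
        Finset.sum_le_sum fun x _ => Finset.sum_le_sum fun y _ => hg x y
    _ ≤ ∑ _x : ↥(boxDom (fun i => n * twoBlk μ i)), 2 * ((d : ℝ) + 1) * B := Finset.sum_le_sum fun x _ => hcount x
    _ = 2 * (n : ℝ) ^ (d + 1) * (2 * ((d : ℝ) + 1) * B) := by
        rw [Finset.sum_const, nsmul_eq_mul, Finset.card_univ, card_box hn μ]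

omit [Fintype ι] [DecidableEq ι] in
/-- **NEIGHBOUR COUNTING**: `Σ_x Σ_{y ∼ x} h(y) ≤ 2(d+1)·Σ_y h(y)` for `h ≥ 0` (each point is a neighbour of at most
`2(d+1)` points of the box). [cite: Balaban1983RegularityDecay, (1.3) p.572, dictionary] -/
theorem sum_nbrs_fun_le {n : ℕ} (μ : Fin (d + 1)) (h : ↥(boxDom (fun i => n * twoBlk μ i)) → ℝ)
    (hh : ∀ y, 0 ≤ h y) :
    ∑ x : ↥(boxDom (fun i => n * twoBlk μ i)), ∑ y : ↥(boxDom (fun i => n * twoBlk μ i)),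
        (if y.1 ∈ nbrs x.1 then h y else 0) ≤ 2 * ((d : ℝ) + 1) * ∑ y, h y := by
  rw [Finset.sum_comm, Finset.mul_sum]
  refine Finset.sum_le_sum fun y _ => ?_
  rw [Finset.sum_ite, Finset.sum_const_zero, add_zero, Finset.sum_const, nsmul_eq_mul]
  have e : (Finset.univ.filter fun x : ↥(boxDom (fun i => n * twoBlk μ i)) => y.1 ∈ nbrs x.1)
      = Finset.univ.filter fun x : ↥(boxDom (fun i => n * twoBlk μ i)) => x.1 ∈ nbrs y.1 := by
    ext x
    simp only [Finset.mem_filter, Finset.mem_univ, true_and]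
    exact nbrs_comm
  rw [e]
  exact mul_le_mul_of_nonneg_right (card_nbrs_box_le μ y) (hh y)

omit [DecidableEq ι] in
/-- `Σ_z |φ(z)|² = |Φ|²` sitewise. [folklore] -/
private theorem sum_siteNorm_sq {X : Type*} [Fintype X] (Φ : X × ι → ℝ) : ∑ z, siteNorm (fld Φ z) ^ 2 = Φ ⬝ᵥ Φ := by
  rw [dotProduct_eq_sum_fld]
  simp only [siteNorm_sq]

omit [DecidableEq ι] in
/-- Cauchy–Schwarz for the site norms over the box: `(Σ_z |φ(z)|)² ≤ |X|·|Φ|²`, in the AM-GM form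
`2B·Σ_z|φ(z)| ≤ |X|·B²/σ + σ|Φ|²` (`σ > 0`) used for the linear terms. [folklore] -/
private theorem two_mul_sum_siteNorm_le {X : Type*} [Fintype X] (Φ : X × ι → ℝ) {B σ : ℝ} (hσ : 0 < σ) :
    2 * B * ∑ z, siteNorm (fld Φ z) ≤ (Fintype.card X : ℝ) * (B ^ 2 / σ) + σ * (Φ ⬝ᵥ Φ) := by
  rw [← sum_siteNorm_sq, Finset.mul_sum, Finset.mul_sum, ← Finset.card_univ,
    show ((Finset.univ : Finset X).card : ℝ) * (B ^ 2 / σ) = ∑ _z : X, B ^ 2 / σ by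
      rw [Finset.sum_const, nsmul_eq_mul], ← Finset.sum_add_distrib]
  refine Finset.sum_le_sum fun z _ => ?_
  have h : 0 ≤ (B / σ - siteNorm (fld Φ z)) ^ 2 * σ := mul_nonneg (sq_nonneg _) hσ.le
  have e : (B / σ - siteNorm (fld Φ z)) ^ 2 * σ
      = B ^ 2 / σ + σ * siteNorm (fld Φ z) ^ 2 - 2 * B * siteNorm (fld Φ z) := by
    field_simp
    ring
  linarith

/-- AM-GM for two reals: `2xy ≤ x²/σ + σy²` (`σ > 0`). [folklore] -/
private theorem two_mul_le_sq_div_add {x y σ : ℝ} (hσ : 0 < σ) : 2 * x * y ≤ x ^ 2 / σ + σ * y ^ 2 := by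
  have h : 0 ≤ (x / σ - y) ^ 2 * σ := mul_nonneg (sq_nonneg _) hσ.le
  have e : (x / σ - y) ^ 2 * σ = x ^ 2 / σ + σ * y ^ 2 - 2 * x * y := by
    field_simp
    ring
  linarith

/-! ### The four pieces of `⟨u₀, (H₁ − H₀ − Ḣ)u₀⟩` and the outer Taylor term `⟨u₀, (Q₁ − Q₀ − Q̇)ᵀφ⟩` -/

/-- **`Σ_b c|(D₁−D₀)u₀|² = O(ε₁²)`**: with `n|κA′_b| ≤ ε₁` on the bonds of `Δ(x,x′)` and `|u₀(z)| ≤ n^{−(d+1)/2}B₁`: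
`Σ_{z,z′} c(z,z′)|(U(κA′(z,z′)) − 1)u₀(z′)|² ≤ 2(d+1)ℓ²ε₁²B₁²` (bond weight `n²/2`, `≤ 2(d+1)` neighbours, `2n^{d+1}`
points). [cite: Balaban1983RegularityDecay, (1.3) p.572, p.590 «the remaining terms»] -/
theorem sum_bondDiff_sq_le {n : ℕ} (hn : 1 ≤ n) (μ : Fin (d + 1)) (F : OrthFlow ι) {ℓ : ℝ} (hℓ : 0 ≤ ℓ)
    (hLip : ∀ t (v : ι → ℝ), ((F.U t - 1) *ᵥ v) ⬝ᵥ ((F.U t - 1) *ᵥ v) ≤ (ℓ * t) ^ 2 * (v ⬝ᵥ v)) (κ : ℝ)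
    (A' : ↥(boxDom (fun i => n * twoBlk μ i)) → ↥(boxDom (fun i => n * twoBlk μ i)) → ℝ) {ε₁ : ℝ}
    (hA1 : ∀ x y : ↥(boxDom (fun i => n * twoBlk μ i)), y.1 ∈ nbrs x.1 → (n : ℝ) * |κ * A' x y| ≤ ε₁)
    (u : ↥(boxDom (fun i => n * twoBlk μ i)) × ι → ℝ) {B₁ : ℝ}
    (hU1 : ∀ z, siteNorm (fld u z) ≤ (Real.sqrt ((n : ℝ) ^ (d + 1)))⁻¹ * B₁) :
    ∑ x, ∑ y, boxWt n (fun i => n * twoBlk μ i) x y * siteNorm ((F.U (κ * A' x y) - 1) *ᵥ fld u y) ^ 2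
      ≤ 2 * ((d : ℝ) + 1) * (ℓ ^ 2 * ε₁ ^ 2 * B₁ ^ 2) := by
  set s : ℝ := (Real.sqrt ((n : ℝ) ^ (d + 1)))⁻¹ with hs
  have hn' : (0 : ℝ) ≤ n := Nat.cast_nonneg n
  have hm : (0 : ℝ) < (n : ℝ) ^ (d + 1) := by
    have : (0 : ℝ) < n := by exact_mod_cast (show 0 < n by omega)
    positivity
  have hs2 : s * s * (n : ℝ) ^ (d + 1) = 1 := by
    rw [hs, ← mul_inv, Real.mul_self_sqrt hm.le, inv_mul_cancel₀ hm.ne']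
  set B : ℝ := s * s / 2 * (ℓ ^ 2 * ε₁ ^ 2 * B₁ ^ 2) with hB
  have hB0 : 0 ≤ B := by positivity
  have hterm : ∀ x y : ↥(boxDom (fun i => n * twoBlk μ i)),
      boxWt n (fun i => n * twoBlk μ i) x y * siteNorm ((F.U (κ * A' x y) - 1) *ᵥ fld u y) ^ 2
        ≤ if y.1 ∈ nbrs x.1 then B else 0 := by
    intro x y
    by_cases hnb : y.1 ∈ nbrs x.1
    · rw [if_pos hnb]
      have hw : boxWt n (fun i => n * twoBlk μ i) x y = (n : ℝ) ^ 2 / 2 := by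
        unfold boxWt; rw [if_pos hnb, mul_one]
      have h1 : (n : ℝ) * siteNorm ((F.U (κ * A' x y) - 1) *ᵥ fld u y) ≤ ℓ * ε₁ * (s * B₁) :=
        (flow_sub_one_scaled F hℓ hLip hn' (hA1 x y hnb) _).trans
          (mul_le_mul_of_nonneg_left (hU1 y) (mul_nonneg hℓ (le_trans (by positivity) (hA1 x y hnb))))
      have h2 := pow_le_pow_left₀ (mul_nonneg hn' (siteNorm_nonneg _)) h1 2
      rw [hw]
      calc (n : ℝ) ^ 2 / 2 * siteNorm ((F.U (κ * A' x y) - 1) *ᵥ fld u y) ^ 2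
          = 1 / 2 * ((n : ℝ) * siteNorm ((F.U (κ * A' x y) - 1) *ᵥ fld u y)) ^ 2 := by ring
        _ ≤ 1 / 2 * (ℓ * ε₁ * (s * B₁)) ^ 2 := by gcongr
        _ = B := by rw [hB]; ring
    · rw [if_neg hnb]
      have hw : boxWt n (fun i => n * twoBlk μ i) x y = 0 := by
        unfold boxWt; rw [if_neg hnb, mul_zero]
      rw [hw, zero_mul]
  calc ∑ x, ∑ y, boxWt n (fun i => n * twoBlk μ i) x y * siteNorm ((F.U (κ * A' x y) - 1) *ᵥ fld u y) ^ 2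
      ≤ 2 * (n : ℝ) ^ (d + 1) * (2 * ((d : ℝ) + 1) * B) := sum_bond_le hn μ hB0 _ hterm
    _ = 2 * ((d : ℝ) + 1) * (ℓ ^ 2 * ε₁ ^ 2 * B₁ ^ 2) * (s * s * (n : ℝ) ^ (d + 1)) := by rw [hB]; ring
    _ = 2 * ((d : ℝ) + 1) * (ℓ ^ 2 * ε₁ ^ 2 * B₁ ^ 2) := by rw [hs2, mul_one]

/-- **`2Σ_b c⟨D₀u₀, (D₁−D₀−Ḋ)u₀⟩ = O(ε₁²)`**: the second-order Taylor remainder of the link variable carries `n^{−2}`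
which cancels the bond weight: `|Σ_{z,z′} c(z,z′)·2⟨u₀(z′) − u₀(z), (U(κA′) − 1 − κA′q)u₀(z′)⟩| ≤ 8(d+1)ℓ²ε₁²B₁²`
(`ℓ² = Σq_{ij}²`). [cite: Balaban1983RegularityDecay, (1.2)–(1.3) p.572, p.590 «the remaining terms»] -/
theorem sum_bond_taylor_cross_le {n : ℕ} (hn : 1 ≤ n) (μ : Fin (d + 1)) (q : Matrix ι ι ℝ) (hq : qᵀ = -q) (κ : ℝ)
    (A' : ↥(boxDom (fun i => n * twoBlk μ i)) → ↥(boxDom (fun i => n * twoBlk μ i)) → ℝ) {ε₁ : ℝ}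
    (hA1 : ∀ x y : ↥(boxDom (fun i => n * twoBlk μ i)), y.1 ∈ nbrs x.1 → (n : ℝ) * |κ * A' x y| ≤ ε₁)
    (u : ↥(boxDom (fun i => n * twoBlk μ i)) × ι → ℝ) {B₁ : ℝ} (hB₁ : 0 ≤ B₁)
    (hU1 : ∀ z, siteNorm (fld u z) ≤ (Real.sqrt ((n : ℝ) ^ (d + 1)))⁻¹ * B₁) :
    |∑ x, ∑ y, boxWt n (fun i => n * twoBlk μ i) x y
        * (2 * ((fld u y - fld u x)
            ⬝ᵥ (((expFlow q hq).U (κ * A' x y) - 1 - (κ * A' x y) • q) *ᵥ fld u y)))|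
      ≤ 8 * ((d : ℝ) + 1) * ((∑ i, ∑ j, q i j ^ 2) * ε₁ ^ 2 * B₁ ^ 2) := by
  set s : ℝ := (Real.sqrt ((n : ℝ) ^ (d + 1)))⁻¹ with hs
  set L2 : ℝ := ∑ i, ∑ j, q i j ^ 2 with hL2
  have hL2n : 0 ≤ L2 := by rw [hL2]; positivity
  have hn' : (0 : ℝ) ≤ n := Nat.cast_nonneg n
  have hm : (0 : ℝ) < (n : ℝ) ^ (d + 1) := by
    have : (0 : ℝ) < n := by exact_mod_cast (show 0 < n by omega)
    positivity
  have hs0 : 0 ≤ s := by rw [hs]; positivity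
  have hs2 : s * s * (n : ℝ) ^ (d + 1) = 1 := by
    rw [hs, ← mul_inv, Real.mul_self_sqrt hm.le, inv_mul_cancel₀ hm.ne']
  set B : ℝ := 2 * L2 * ε₁ ^ 2 * (s * s) * B₁ ^ 2 with hB
  have hB0 : 0 ≤ B := by positivity
  have hterm : ∀ x y : ↥(boxDom (fun i => n * twoBlk μ i)),
      |boxWt n (fun i => n * twoBlk μ i) x y
        * (2 * ((fld u y - fld u x) ⬝ᵥ (((expFlow q hq).U (κ * A' x y) - 1 - (κ * A' x y) • q) *ᵥ fld u y)))|
        ≤ if y.1 ∈ nbrs x.1 then B else 0 := by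
    intro x y
    by_cases hnb : y.1 ∈ nbrs x.1
    · rw [if_pos hnb]
      have hw : boxWt n (fun i => n * twoBlk μ i) x y = (n : ℝ) ^ 2 / 2 := by
        unfold boxWt; rw [if_pos hnb, mul_one]
      have ha : siteNorm (fld u y - fld u x) ≤ 2 * (s * B₁) := by
        refine (B4Lemma22HolderBox.siteNorm_sub_le _ _).trans ?_
        linarith [hU1 y, hU1 x]
      have hb : (n : ℝ) ^ 2 * siteNorm ((((expFlow q hq).U (κ * A' x y) - 1 - (κ * A' x y) • q)) *ᵥ fld u y)
          ≤ L2 * ε₁ ^ 2 * (s * B₁) :=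
        (taylor_scaled q hq hn' (hA1 x y hnb) _).trans (mul_le_mul_of_nonneg_left (hU1 y) (by positivity))
      have hcs := abs_dot_le (fld u y - fld u x)
        ((((expFlow q hq).U (κ * A' x y) - 1 - (κ * A' x y) • q)) *ᵥ fld u y)
      rw [hw, abs_mul, abs_mul, abs_two, abs_of_nonneg (by positivity : (0 : ℝ) ≤ (n : ℝ) ^ 2 / 2)]
      calc (n : ℝ) ^ 2 / 2 * (2 * |(fld u y - fld u x)
              ⬝ᵥ ((((expFlow q hq).U (κ * A' x y) - 1 - (κ * A' x y) • q)) *ᵥ fld u y)|)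
          ≤ (n : ℝ) ^ 2 / 2 * (2 * (siteNorm (fld u y - fld u x)
              * siteNorm ((((expFlow q hq).U (κ * A' x y) - 1 - (κ * A' x y) • q)) *ᵥ fld u y))) := by
            gcongr
        _ = siteNorm (fld u y - fld u x)
              * ((n : ℝ) ^ 2 * siteNorm ((((expFlow q hq).U (κ * A' x y) - 1 - (κ * A' x y) • q)) *ᵥ fld u y)) := by
            ring
        _ ≤ 2 * (s * B₁) * (L2 * ε₁ ^ 2 * (s * B₁)) :=
            mul_le_mul ha hb (mul_nonneg (pow_nonneg hn' 2) (siteNorm_nonneg _)) (by positivity)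
        _ = B := by rw [hB]; ring
    · rw [if_neg hnb]
      have hw : boxWt n (fun i => n * twoBlk μ i) x y = 0 := by
        unfold boxWt; rw [if_neg hnb, mul_zero]
      rw [hw, zero_mul, abs_zero]
  calc |∑ x, ∑ y, boxWt n (fun i => n * twoBlk μ i) x y
          * (2 * ((fld u y - fld u x) ⬝ᵥ (((expFlow q hq).U (κ * A' x y) - 1 - (κ * A' x y) • q) *ᵥ fld u y)))|
      ≤ ∑ x, ∑ y, |boxWt n (fun i => n * twoBlk μ i) x y
          * (2 * ((fld u y - fld u x) ⬝ᵥ (((expFlow q hq).U (κ * A' x y) - 1 - (κ * A' x y) • q) *ᵥ fld u y)))| :=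
        (Finset.abs_sum_le_sum_abs _ _).trans (Finset.sum_le_sum fun x _ => Finset.abs_sum_le_sum_abs _ _)
    _ ≤ 2 * (n : ℝ) ^ (d + 1) * (2 * ((d : ℝ) + 1) * B) := sum_bond_le hn μ hB0 _ hterm
    _ = 8 * ((d : ℝ) + 1) * (L2 * ε₁ ^ 2 * B₁ ^ 2) * (s * s * (n : ℝ) ^ (d + 1)) := by rw [hB]; ring
    _ = 8 * ((d : ℝ) + 1) * (L2 * ε₁ ^ 2 * B₁ ^ 2) := by rw [hs2, mul_one]

/-- **`a_kn^{−(d+1)}Σ_y |((Q₁−Q₀)u₀)(y)|² = O(ε₂²)`**: with `|κA′(Γ_{y,z})| ≤ ε₂` on the block contours,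
`a n^{−(d+1)}Σ_y |Σ_{z∈B^k(y)}(U(κA′(Γ_{y,z})) − 1)u₀(z)|² ≤ 2aℓ²ε₂²B₁²`. [cite: Balaban1983RegularityDecay, (1.4)–(1.5) p.572, p.590 «the remaining terms»] -/
theorem sum_blockDiff_sq_le {n : ℕ} (hn : 1 ≤ n) (μ : Fin (d + 1)) (F : OrthFlow ι) {ℓ : ℝ} (hℓ : 0 ≤ ℓ)
    (hLip : ∀ t (v : ι → ℝ), ((F.U t - 1) *ᵥ v) ⬝ᵥ ((F.U t - 1) *ᵥ v) ≤ (ℓ * t) ^ 2 * (v ⬝ᵥ v)) (κ : ℝ)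
    {a : ℝ} (ha : 0 ≤ a) (emb : ↥(boxDom (twoBlk μ)) → ↥(boxDom (fun i => n * twoBlk μ i)))
    (Γ : ↥(boxDom (twoBlk μ)) → ↥(boxDom (fun i => n * twoBlk μ i)) → List ↥(boxDom (fun i => n * twoBlk μ i)))
    (A' : ↥(boxDom (fun i => n * twoBlk μ i)) → ↥(boxDom (fun i => n * twoBlk μ i)) → ℝ) {ε₂ : ℝ}
    (hε₂ : 0 ≤ ε₂)
    (hA2 : ∀ (y : ↥(boxDom (twoBlk μ))) (x : ↥(boxDom (fun i => n * twoBlk μ i))), blk n x.1 = y.1 →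
      |κ * lsum A' (emb y) (Γ y x)| ≤ ε₂)
    (u : ↥(boxDom (fun i => n * twoBlk μ i)) × ι → ℝ) {B₁ : ℝ}
    (hU1 : ∀ z, siteNorm (fld u z) ≤ (Real.sqrt ((n : ℝ) ^ (d + 1)))⁻¹ * B₁) :
    a * ((n : ℝ) ^ (d + 1))⁻¹ * ∑ y, siteNorm (∑ x, blkWt n (twoBlk μ) (fun i => n * twoBlk μ i) y x
        • ((F.U (κ * lsum A' (emb y) (Γ y x)) - 1) *ᵥ fld u x)) ^ 2
      ≤ 2 * a * (ℓ ^ 2 * ε₂ ^ 2 * B₁ ^ 2) := by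
  set s : ℝ := (Real.sqrt ((n : ℝ) ^ (d + 1)))⁻¹ with hs
  set m : ℝ := (n : ℝ) ^ (d + 1) with hmdef
  have hm : 0 < m := by
    have : (0 : ℝ) < n := by exact_mod_cast (show 0 < n by omega)
    rw [hmdef]; positivity
  have hs0 : 0 ≤ s := by rw [hs]; positivity
  have hs2 : s * s * m = 1 := by
    rw [hs, ← mul_inv, Real.mul_self_sqrt hm.le, inv_mul_cancel₀ hm.ne']
  set ω : ↥(boxDom (twoBlk μ)) → ↥(boxDom (fun i => n * twoBlk μ i)) → ℝ :=
    blkWt n (twoBlk μ) (fun i => n * twoBlk μ i) with hω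
  have hω0 : ∀ y x, 0 ≤ ω y x := by
    intro y x; simp only [hω, blkWt]; split_ifs <;> norm_num
  have hωsum : ∀ y, ∑ x, ω y x = m := fun y => sum_blkWt_box hn μ y
  -- per block: `|Σ_x ω (U−1)u_x| ≤ m·ℓε₂·sB₁`
  have hy : ∀ y, siteNorm (∑ x, ω y x • ((F.U (κ * lsum A' (emb y) (Γ y x)) - 1) *ᵥ fld u x))
      ≤ m * (ℓ * ε₂ * (s * B₁)) := by
    intro y
    refine (siteNorm_wsum_le (hω0 y) _).trans ?_
    rw [← hωsum y, Finset.sum_mul]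
    refine Finset.sum_le_sum fun x _ => ?_
    by_cases hb : blk n x.1 = y.1
    · refine mul_le_mul_of_nonneg_left ?_ (hω0 y x)
      calc siteNorm ((F.U (κ * lsum A' (emb y) (Γ y x)) - 1) *ᵥ fld u x)
          ≤ ℓ * |κ * lsum A' (emb y) (Γ y x)| * siteNorm (fld u x) := siteNorm_flow_sub_one_le F hℓ hLip _ _
        _ ≤ ℓ * ε₂ * (s * B₁) :=
            mul_le_mul (mul_le_mul_of_nonneg_left (hA2 y x hb) hℓ) (hU1 x) (siteNorm_nonneg _) (by positivity)
    · have : ω y x = 0 := by simp only [hω, blkWt, if_neg hb]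
      rw [this, zero_mul, zero_mul]
  have hy2 : ∀ y, siteNorm (∑ x, ω y x • ((F.U (κ * lsum A' (emb y) (Γ y x)) - 1) *ᵥ fld u x)) ^ 2
      ≤ (m * (ℓ * ε₂ * (s * B₁))) ^ 2 := fun y => pow_le_pow_left₀ (siteNorm_nonneg _) (hy y) 2
  have hpre : 0 ≤ a * m⁻¹ := by positivity
  calc a * m⁻¹ * ∑ y, siteNorm (∑ x, ω y x • ((F.U (κ * lsum A' (emb y) (Γ y x)) - 1) *ᵥ fld u x)) ^ 2
      ≤ a * m⁻¹ * ∑ _y : ↥(boxDom (twoBlk μ)), (m * (ℓ * ε₂ * (s * B₁))) ^ 2 :=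
        mul_le_mul_of_nonneg_left (Finset.sum_le_sum fun y _ => hy2 y) hpre
    _ = a * m⁻¹ * (2 * (m * (ℓ * ε₂ * (s * B₁))) ^ 2) := by rw [sum_Y]; ring
    _ = 2 * a * (ℓ ^ 2 * ε₂ ^ 2 * B₁ ^ 2) * (s * s * m) * (m * m⁻¹) := by ring
    _ = 2 * a * (ℓ ^ 2 * ε₂ ^ 2 * B₁ ^ 2) := by rw [hs2, mul_inv_cancel₀ hm.ne', mul_one, mul_one]

/-- **`2a_kn^{−(d+1)}Σ_y ⟨(Q₀u₀)(y), ((Q₁−Q₀−Q̇)u₀)(y)⟩ = O(ε₂²)`** (second-order Taylor remainder of the block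
transporters): `≤ 4aℓ²ε₂²B₁²` in absolute value (`ℓ² = Σq_{ij}²`). [cite: Balaban1983RegularityDecay, (1.2), (1.4)–(1.5) p.572, p.590] -/
theorem sum_block_taylor_cross_le {n : ℕ} (hn : 1 ≤ n) (μ : Fin (d + 1)) (q : Matrix ι ι ℝ) (hq : qᵀ = -q)
    (κ : ℝ) {a : ℝ} (ha : 0 ≤ a) (emb : ↥(boxDom (twoBlk μ)) → ↥(boxDom (fun i => n * twoBlk μ i)))
    (Γ : ↥(boxDom (twoBlk μ)) → ↥(boxDom (fun i => n * twoBlk μ i)) → List ↥(boxDom (fun i => n * twoBlk μ i)))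
    (A' : ↥(boxDom (fun i => n * twoBlk μ i)) → ↥(boxDom (fun i => n * twoBlk μ i)) → ℝ) {ε₂ : ℝ}
    (hA2 : ∀ (y : ↥(boxDom (twoBlk μ))) (x : ↥(boxDom (fun i => n * twoBlk μ i))), blk n x.1 = y.1 →
      |κ * lsum A' (emb y) (Γ y x)| ≤ ε₂)
    (u : ↥(boxDom (fun i => n * twoBlk μ i)) × ι → ℝ) {B₁ : ℝ} (hB₁ : 0 ≤ B₁)
    (hU1 : ∀ z, siteNorm (fld u z) ≤ (Real.sqrt ((n : ℝ) ^ (d + 1)))⁻¹ * B₁) :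
    |a * ((n : ℝ) ^ (d + 1))⁻¹ * ∑ y, (2 * ((∑ x, blkWt n (twoBlk μ) (fun i => n * twoBlk μ i) y x • fld u x)
        ⬝ᵥ (∑ x, blkWt n (twoBlk μ) (fun i => n * twoBlk μ i) y x
            • (((expFlow q hq).U (κ * lsum A' (emb y) (Γ y x)) - 1 - (κ * lsum A' (emb y) (Γ y x)) • q)
                *ᵥ fld u x))))|
      ≤ 4 * a * ((∑ i, ∑ j, q i j ^ 2) * ε₂ ^ 2 * B₁ ^ 2) := by
  set s : ℝ := (Real.sqrt ((n : ℝ) ^ (d + 1)))⁻¹ with hs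
  set m : ℝ := (n : ℝ) ^ (d + 1) with hmdef
  set L2 : ℝ := ∑ i, ∑ j, q i j ^ 2 with hL2
  have hL2n : 0 ≤ L2 := by rw [hL2]; positivity
  have hm : 0 < m := by
    have : (0 : ℝ) < n := by exact_mod_cast (show 0 < n by omega)
    rw [hmdef]; positivity
  have hs0 : 0 ≤ s := by rw [hs]; positivity
  have hs2 : s * s * m = 1 := by
    rw [hs, ← mul_inv, Real.mul_self_sqrt hm.le, inv_mul_cancel₀ hm.ne']
  set ω : ↥(boxDom (twoBlk μ)) → ↥(boxDom (fun i => n * twoBlk μ i)) → ℝ :=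
    blkWt n (twoBlk μ) (fun i => n * twoBlk μ i) with hω
  have hω0 : ∀ y x, 0 ≤ ω y x := by
    intro y x; simp only [hω, blkWt]; split_ifs <;> norm_num
  have hωsum : ∀ y, ∑ x, ω y x = m := fun y => sum_blkWt_box hn μ y
  set T : ↥(boxDom (twoBlk μ)) → ↥(boxDom (fun i => n * twoBlk μ i)) → Matrix ι ι ℝ := fun y x =>
    (expFlow q hq).U (κ * lsum A' (emb y) (Γ y x)) - 1 - (κ * lsum A' (emb y) (Γ y x)) • q with hT
  -- `|Q₀u₀(y)| ≤ m s B₁`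
  have hQ0 : ∀ y, siteNorm (∑ x, ω y x • fld u x) ≤ m * (s * B₁) := by
    intro y
    refine (siteNorm_wsum_le (hω0 y) _).trans ?_
    rw [← hωsum y, Finset.sum_mul]
    exact Finset.sum_le_sum fun x _ => mul_le_mul_of_nonneg_left (hU1 x) (hω0 y x)
  -- `|(Q₁−Q₀−Q̇)u₀(y)| ≤ m L2 ε₂² s B₁`
  have hQT : ∀ y, siteNorm (∑ x, ω y x • (T y x *ᵥ fld u x)) ≤ m * (L2 * ε₂ ^ 2 * (s * B₁)) := by
    intro y
    refine (siteNorm_wsum_le (hω0 y) _).trans ?_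
    rw [← hωsum y, Finset.sum_mul]
    refine Finset.sum_le_sum fun x _ => ?_
    by_cases hb : blk n x.1 = y.1
    · refine mul_le_mul_of_nonneg_left ?_ (hω0 y x)
      have ht2 : (κ * lsum A' (emb y) (Γ y x)) ^ 2 ≤ ε₂ ^ 2 := by
        rw [← sq_abs]; exact pow_le_pow_left₀ (abs_nonneg _) (hA2 y x hb) 2
      calc siteNorm (T y x *ᵥ fld u x) ≤ L2 * (κ * lsum A' (emb y) (Γ y x)) ^ 2 * siteNorm (fld u x) :=
            expFlow_taylor₂ q hq _ _
        _ ≤ L2 * ε₂ ^ 2 * (s * B₁) :=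
            mul_le_mul (mul_le_mul_of_nonneg_left ht2 hL2n) (hU1 x) (siteNorm_nonneg _) (by positivity)
    · have : ω y x = 0 := by simp only [hω, blkWt, if_neg hb]
      rw [this, zero_mul, zero_mul]
  have hyb : ∀ y, |2 * ((∑ x, ω y x • fld u x) ⬝ᵥ (∑ x, ω y x • (T y x *ᵥ fld u x)))|
      ≤ 2 * ((m * (s * B₁)) * (m * (L2 * ε₂ ^ 2 * (s * B₁)))) := by
    intro y
    rw [abs_mul, abs_two]
    exact mul_le_mul_of_nonneg_left ((abs_dot_le _ _).trans
      (mul_le_mul (hQ0 y) (hQT y) (siteNorm_nonneg _) (by positivity))) zero_le_two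
  have hpre : 0 ≤ a * m⁻¹ := by positivity
  rw [abs_mul, abs_of_nonneg hpre]
  calc a * m⁻¹ * |∑ y, 2 * ((∑ x, ω y x • fld u x) ⬝ᵥ (∑ x, ω y x • (T y x *ᵥ fld u x)))|
      ≤ a * m⁻¹ * ∑ y, |2 * ((∑ x, ω y x • fld u x) ⬝ᵥ (∑ x, ω y x • (T y x *ᵥ fld u x)))| :=
        mul_le_mul_of_nonneg_left (Finset.abs_sum_le_sum_abs _ _) hpre
    _ ≤ a * m⁻¹ * ∑ _y : ↥(boxDom (twoBlk μ)), 2 * ((m * (s * B₁)) * (m * (L2 * ε₂ ^ 2 * (s * B₁)))) :=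
        mul_le_mul_of_nonneg_left (Finset.sum_le_sum fun y _ => hyb y) hpre
    _ = 4 * a * (L2 * ε₂ ^ 2 * B₁ ^ 2) * (s * s * m) * (m * m⁻¹) := by rw [sum_Y]; ring
    _ = 4 * a * (L2 * ε₂ ^ 2 * B₁ ^ 2) := by rw [hs2, mul_inv_cancel₀ hm.ne', mul_one, mul_one]

/-- **THE OUTER TAYLOR TERM `2⟨u₀, (Q₁−Q₀−Q̇)ᵀφ⟩ = O(ε₂²)`**: with `|φ(y)| ≤ N₀` (`y = x, x′`) and the outer weights
`n^{−(d+1)/2}1[z ∈ B^k(y)]`: `|Σ_y ⟨φ(y), Σ_z n^{−(d+1)/2}(U(κA′(Γ_{y,z})) − 1 − κA′(Γ_{y,z})q)u₀(z)⟩| ≤ 2N₀ℓ²ε₂²B₁`.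
[cite: Balaban1983RegularityDecay, (1.2), (1.4) p.572, (4.7) p.590] -/
theorem sum_outer_taylor_le {n : ℕ} (hn : 1 ≤ n) (μ : Fin (d + 1)) (q : Matrix ι ι ℝ) (hq : qᵀ = -q) (κ : ℝ)
    (emb : ↥(boxDom (twoBlk μ)) → ↥(boxDom (fun i => n * twoBlk μ i)))
    (Γ : ↥(boxDom (twoBlk μ)) → ↥(boxDom (fun i => n * twoBlk μ i)) → List ↥(boxDom (fun i => n * twoBlk μ i)))
    (A' : ↥(boxDom (fun i => n * twoBlk μ i)) → ↥(boxDom (fun i => n * twoBlk μ i)) → ℝ) {ε₂ : ℝ}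
    (hA2 : ∀ (y : ↥(boxDom (twoBlk μ))) (x : ↥(boxDom (fun i => n * twoBlk μ i))), blk n x.1 = y.1 →
      |κ * lsum A' (emb y) (Γ y x)| ≤ ε₂)
    (u : ↥(boxDom (fun i => n * twoBlk μ i)) × ι → ℝ) {B₁ : ℝ}
    (hU1 : ∀ z, siteNorm (fld u z) ≤ (Real.sqrt ((n : ℝ) ^ (d + 1)))⁻¹ * B₁)
    (Ψ : ↥(boxDom (twoBlk μ)) × ι → ℝ) {N₀ : ℝ} (hN₀ : 0 ≤ N₀) (hΨ : ∀ y, siteNorm (fld Ψ y) ≤ N₀) :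
    |∑ y, fld Ψ y ⬝ᵥ (∑ x, outWtB n μ y x
        • (((expFlow q hq).U (κ * lsum A' (emb y) (Γ y x)) - 1 - (κ * lsum A' (emb y) (Γ y x)) • q)
            *ᵥ fld u x))|
      ≤ 2 * N₀ * ((∑ i, ∑ j, q i j ^ 2) * ε₂ ^ 2 * B₁) := by
  set s : ℝ := (Real.sqrt ((n : ℝ) ^ (d + 1)))⁻¹ with hs
  set m : ℝ := (n : ℝ) ^ (d + 1) with hmdef
  set L2 : ℝ := ∑ i, ∑ j, q i j ^ 2 with hL2
  have hL2n : 0 ≤ L2 := by rw [hL2]; positivity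
  have hm : 0 < m := by
    have : (0 : ℝ) < n := by exact_mod_cast (show 0 < n by omega)
    rw [hmdef]; positivity
  have hs0 : 0 ≤ s := by rw [hs]; positivity
  have hs2 : s * s * m = 1 := by
    rw [hs, ← mul_inv, Real.mul_self_sqrt hm.le, inv_mul_cancel₀ hm.ne']
  set ω : ↥(boxDom (twoBlk μ)) → ↥(boxDom (fun i => n * twoBlk μ i)) → ℝ :=
    blkWt n (twoBlk μ) (fun i => n * twoBlk μ i) with hω
  have hω0 : ∀ y x, 0 ≤ ω y x := by
    intro y x; simp only [hω, blkWt]; split_ifs <;> norm_num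
  have hωsum : ∀ y, ∑ x, ω y x = m := fun y => sum_blkWt_box hn μ y
  have hout : ∀ y x, outWtB n μ y x = s * ω y x := fun y x => rfl
  have hout0 : ∀ y x, 0 ≤ outWtB n μ y x := fun y x => by rw [hout]; exact mul_nonneg hs0 (hω0 y x)
  set T : ↥(boxDom (twoBlk μ)) → ↥(boxDom (fun i => n * twoBlk μ i)) → Matrix ι ι ℝ := fun y x =>
    (expFlow q hq).U (κ * lsum A' (emb y) (Γ y x)) - 1 - (κ * lsum A' (emb y) (Γ y x)) • q with hT
  have hQT : ∀ y, siteNorm (∑ x, outWtB n μ y x • (T y x *ᵥ fld u x)) ≤ s * (m * (L2 * ε₂ ^ 2 * (s * B₁))) := by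
    intro y
    refine (siteNorm_wsum_le (hout0 y) _).trans ?_
    rw [← hωsum y, Finset.sum_mul, Finset.mul_sum]
    refine Finset.sum_le_sum fun x _ => ?_
    rw [hout]
    by_cases hb : blk n x.1 = y.1
    · have ht2 : (κ * lsum A' (emb y) (Γ y x)) ^ 2 ≤ ε₂ ^ 2 := by
        rw [← sq_abs]; exact pow_le_pow_left₀ (abs_nonneg _) (hA2 y x hb) 2
      have h1 : siteNorm (T y x *ᵥ fld u x) ≤ L2 * ε₂ ^ 2 * (s * B₁) :=
        calc siteNorm (T y x *ᵥ fld u x) ≤ L2 * (κ * lsum A' (emb y) (Γ y x)) ^ 2 * siteNorm (fld u x) :=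
              expFlow_taylor₂ q hq _ _
          _ ≤ L2 * ε₂ ^ 2 * (s * B₁) :=
              mul_le_mul (mul_le_mul_of_nonneg_left ht2 hL2n) (hU1 x) (siteNorm_nonneg _) (by positivity)
      calc s * ω y x * siteNorm (T y x *ᵥ fld u x) ≤ s * ω y x * (L2 * ε₂ ^ 2 * (s * B₁)) :=
            mul_le_mul_of_nonneg_left h1 (mul_nonneg hs0 (hω0 y x))
        _ = s * (ω y x * (L2 * ε₂ ^ 2 * (s * B₁))) := by ring
    · have : ω y x = 0 := by simp only [hω, blkWt, if_neg hb]
      rw [this]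
      simp
  have hyb : ∀ y, |fld Ψ y ⬝ᵥ (∑ x, outWtB n μ y x • (T y x *ᵥ fld u x))|
      ≤ N₀ * (s * (m * (L2 * ε₂ ^ 2 * (s * B₁)))) := fun y =>
    (abs_dot_le _ _).trans (mul_le_mul (hΨ y) (hQT y) (siteNorm_nonneg _) hN₀)
  calc |∑ y, fld Ψ y ⬝ᵥ (∑ x, outWtB n μ y x • (T y x *ᵥ fld u x))|
      ≤ ∑ y, |fld Ψ y ⬝ᵥ (∑ x, outWtB n μ y x • (T y x *ᵥ fld u x))| := Finset.abs_sum_le_sum_abs _ _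
    _ ≤ ∑ _y : ↥(boxDom (twoBlk μ)), N₀ * (s * (m * (L2 * ε₂ ^ 2 * (s * B₁)))) :=
        Finset.sum_le_sum fun y _ => hyb y
    _ = 2 * N₀ * (L2 * ε₂ ^ 2 * B₁) * (s * s * m) := by rw [sum_Y]; ring
    _ = 2 * N₀ * (L2 * ε₂ ^ 2 * B₁) := by rw [hs2, mul_one]

/-! ### The pieces of `2⟨r, y⟩` for the variational bound on `⟨r, G₁r⟩` (`y` arbitrary) -/

/-- **V1** — the pairing `2Σ_b c⟨(D₁−D₀)u₀, D₁y⟩` against the energy of `y`: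
`Σ c·2|⟨(U−1)u₀(z′), U y(z′) − y(z)⟩| ≤ 4(d+1)ℓ²ε₁²B₁² + ½Σ c|U y(z′) − y(z)|²` (AM-GM and `sum_bondDiff_sq_le`).
[cite: Balaban1983RegularityDecay, (1.3) p.572, p.590 «Using Lemma 2.1 the remaining terms can be easily estimated»] -/
theorem sum_bond_pairD_le {n : ℕ} (hn : 1 ≤ n) (μ : Fin (d + 1)) (F : OrthFlow ι) {ℓ : ℝ} (hℓ : 0 ≤ ℓ)
    (hLip : ∀ t (v : ι → ℝ), ((F.U t - 1) *ᵥ v) ⬝ᵥ ((F.U t - 1) *ᵥ v) ≤ (ℓ * t) ^ 2 * (v ⬝ᵥ v)) (κ : ℝ)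
    (A' : ↥(boxDom (fun i => n * twoBlk μ i)) → ↥(boxDom (fun i => n * twoBlk μ i)) → ℝ) {ε₁ : ℝ}
    (hA1 : ∀ x y : ↥(boxDom (fun i => n * twoBlk μ i)), y.1 ∈ nbrs x.1 → (n : ℝ) * |κ * A' x y| ≤ ε₁)
    (u : ↥(boxDom (fun i => n * twoBlk μ i)) × ι → ℝ) {B₁ : ℝ}
    (hU1 : ∀ z, siteNorm (fld u z) ≤ (Real.sqrt ((n : ℝ) ^ (d + 1)))⁻¹ * B₁)
    (yv : ↥(boxDom (fun i => n * twoBlk μ i)) × ι → ℝ) :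
    ∑ x, ∑ y, boxWt n (fun i => n * twoBlk μ i) x y
        * (2 * |(((F.U (κ * A' x y) - 1) *ᵥ fld u y)) ⬝ᵥ (F.U (κ * A' x y) *ᵥ fld yv y - fld yv x)|)
      ≤ 4 * ((d : ℝ) + 1) * (ℓ ^ 2 * ε₁ ^ 2 * B₁ ^ 2)
        + 1 / 2 * ∑ x, ∑ y, boxWt n (fun i => n * twoBlk μ i) x y
            * siteNorm (F.U (κ * A' x y) *ᵥ fld yv y - fld yv x) ^ 2 := by
  have hwt : ∀ x y : ↥(boxDom (fun i => n * twoBlk μ i)), 0 ≤ boxWt n (fun i => n * twoBlk μ i) x y := by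
    intro x y; unfold boxWt; split_ifs <;> positivity
  have hpt : ∀ x y : ↥(boxDom (fun i => n * twoBlk μ i)),
      boxWt n (fun i => n * twoBlk μ i) x y
          * (2 * |(((F.U (κ * A' x y) - 1) *ᵥ fld u y)) ⬝ᵥ (F.U (κ * A' x y) *ᵥ fld yv y - fld yv x)|)
        ≤ 2 * (boxWt n (fun i => n * twoBlk μ i) x y * siteNorm ((F.U (κ * A' x y) - 1) *ᵥ fld u y) ^ 2)
          + 1 / 2 * (boxWt n (fun i => n * twoBlk μ i) x y
              * siteNorm (F.U (κ * A' x y) *ᵥ fld yv y - fld yv x) ^ 2) := by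
    intro x y
    have h1 := abs_dot_le (((F.U (κ * A' x y) - 1) *ᵥ fld u y)) (F.U (κ * A' x y) *ᵥ fld yv y - fld yv x)
    have h2 := two_mul_le_sq_div_add (x := siteNorm (((F.U (κ * A' x y) - 1) *ᵥ fld u y)))
      (y := siteNorm (F.U (κ * A' x y) *ᵥ fld yv y - fld yv x)) (σ := 1 / 2) (by norm_num)
    have h3 : 2 * |(((F.U (κ * A' x y) - 1) *ᵥ fld u y)) ⬝ᵥ (F.U (κ * A' x y) *ᵥ fld yv y - fld yv x)|
        ≤ 2 * siteNorm (((F.U (κ * A' x y) - 1) *ᵥ fld u y)) ^ 2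
          + 1 / 2 * siteNorm (F.U (κ * A' x y) *ᵥ fld yv y - fld yv x) ^ 2 := by
      have : siteNorm ((F.U (κ * A' x y) - 1) *ᵥ fld u y) ^ 2 / (1 / 2)
          = 2 * siteNorm ((F.U (κ * A' x y) - 1) *ᵥ fld u y) ^ 2 := by ring
      linarith
    have h4 := mul_le_mul_of_nonneg_left h3 (hwt x y)
    linarith
  calc ∑ x, ∑ y, boxWt n (fun i => n * twoBlk μ i) x y
          * (2 * |(((F.U (κ * A' x y) - 1) *ᵥ fld u y)) ⬝ᵥ (F.U (κ * A' x y) *ᵥ fld yv y - fld yv x)|)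
      ≤ ∑ x, ∑ y, (2 * (boxWt n (fun i => n * twoBlk μ i) x y * siteNorm ((F.U (κ * A' x y) - 1) *ᵥ fld u y) ^ 2)
          + 1 / 2 * (boxWt n (fun i => n * twoBlk μ i) x y
              * siteNorm (F.U (κ * A' x y) *ᵥ fld yv y - fld yv x) ^ 2)) :=
        Finset.sum_le_sum fun x _ => Finset.sum_le_sum fun y _ => hpt x y
    _ = 2 * ∑ x, ∑ y, boxWt n (fun i => n * twoBlk μ i) x y * siteNorm ((F.U (κ * A' x y) - 1) *ᵥ fld u y) ^ 2
          + 1 / 2 * ∑ x, ∑ y, boxWt n (fun i => n * twoBlk μ i) x y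
              * siteNorm (F.U (κ * A' x y) *ᵥ fld yv y - fld yv x) ^ 2 := by
        simp only [Finset.sum_add_distrib, Finset.mul_sum]
    _ ≤ 2 * (2 * ((d : ℝ) + 1) * (ℓ ^ 2 * ε₁ ^ 2 * B₁ ^ 2))
          + 1 / 2 * ∑ x, ∑ y, boxWt n (fun i => n * twoBlk μ i) x y
              * siteNorm (F.U (κ * A' x y) *ᵥ fld yv y - fld yv x) ^ 2 := by
        have h := sum_bondDiff_sq_le hn μ F hℓ hLip κ A' hA1 u hU1
        linarith
    _ = _ := by ring

/-- **V2** — the pairing `2Σ_b c⟨D₀u₀, (D₁−D₀)y⟩` against `|y|²`: with the DERIVATIVE bound of (4.9)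
(`n|u₀(z′) − u₀(z)| ≤ n^{−(d+1)/2}B₂` on bonds) the bond weight `n²` is exactly compensated:
`Σ c·2|⟨u₀(z′) − u₀(z), (U−1)y(z′)⟩| ≤ (d+1)ℓ²ε₁²B₂²/σ + 2(d+1)σ|y|²` for every `σ > 0`.
[cite: Balaban1983RegularityDecay, (1.3) p.572, (4.9) p.590, p.590 «Using Lemma 2.1 …»] -/
theorem sum_bond_pairX_le {n : ℕ} (hn : 1 ≤ n) (μ : Fin (d + 1)) (F : OrthFlow ι) {ℓ : ℝ} (hℓ : 0 ≤ ℓ)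
    (hLip : ∀ t (v : ι → ℝ), ((F.U t - 1) *ᵥ v) ⬝ᵥ ((F.U t - 1) *ᵥ v) ≤ (ℓ * t) ^ 2 * (v ⬝ᵥ v)) (κ : ℝ)
    (A' : ↥(boxDom (fun i => n * twoBlk μ i)) → ↥(boxDom (fun i => n * twoBlk μ i)) → ℝ) {ε₁ : ℝ}
    (hA1 : ∀ x y : ↥(boxDom (fun i => n * twoBlk μ i)), y.1 ∈ nbrs x.1 → (n : ℝ) * |κ * A' x y| ≤ ε₁)
    (u : ↥(boxDom (fun i => n * twoBlk μ i)) × ι → ℝ) {B₂ : ℝ} (hB₂ : 0 ≤ B₂)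
    (hU2 : ∀ x y : ↥(boxDom (fun i => n * twoBlk μ i)), y.1 ∈ nbrs x.1 →
      (n : ℝ) * siteNorm (fld u y - fld u x) ≤ (Real.sqrt ((n : ℝ) ^ (d + 1)))⁻¹ * B₂)
    (yv : ↥(boxDom (fun i => n * twoBlk μ i)) × ι → ℝ) {σ : ℝ} (hσ : 0 < σ) :
    ∑ x, ∑ y, boxWt n (fun i => n * twoBlk μ i) x y
        * (2 * |(fld u y - fld u x) ⬝ᵥ ((F.U (κ * A' x y) - 1) *ᵥ fld yv y)|)
      ≤ ((d : ℝ) + 1) * (ℓ ^ 2 * ε₁ ^ 2 * B₂ ^ 2) / σ + 2 * ((d : ℝ) + 1) * σ * (yv ⬝ᵥ yv) := by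
  set s : ℝ := (Real.sqrt ((n : ℝ) ^ (d + 1)))⁻¹ with hs
  have hn' : (0 : ℝ) ≤ n := Nat.cast_nonneg n
  have hm : (0 : ℝ) < (n : ℝ) ^ (d + 1) := by
    have : (0 : ℝ) < n := by exact_mod_cast (show 0 < n by omega)
    positivity
  have hs0 : 0 ≤ s := by rw [hs]; positivity
  have hs2 : s * s * (n : ℝ) ^ (d + 1) = 1 := by
    rw [hs, ← mul_inv, Real.mul_self_sqrt hm.le, inv_mul_cancel₀ hm.ne']
  set B : ℝ := (s * B₂ * (ℓ * ε₁) / 2) ^ 2 / σ with hB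
  have hB0 : 0 ≤ B := by positivity
  have hpt : ∀ x y : ↥(boxDom (fun i => n * twoBlk μ i)),
      boxWt n (fun i => n * twoBlk μ i) x y * (2 * |(fld u y - fld u x) ⬝ᵥ ((F.U (κ * A' x y) - 1) *ᵥ fld yv y)|)
        ≤ (if y.1 ∈ nbrs x.1 then B else 0) + (if y.1 ∈ nbrs x.1 then σ * siteNorm (fld yv y) ^ 2 else 0) := by
    intro x y
    by_cases hnb : y.1 ∈ nbrs x.1
    · rw [if_pos hnb, if_pos hnb]
      have hw : boxWt n (fun i => n * twoBlk μ i) x y = (n : ℝ) ^ 2 / 2 := by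
        unfold boxWt; rw [if_pos hnb, mul_one]
      have ha : (n : ℝ) * siteNorm (fld u y - fld u x) ≤ s * B₂ := hU2 x y hnb
      have hb : (n : ℝ) * siteNorm ((F.U (κ * A' x y) - 1) *ᵥ fld yv y) ≤ ℓ * ε₁ * siteNorm (fld yv y) :=
        flow_sub_one_scaled F hℓ hLip hn' (hA1 x y hnb) _
      have hε : 0 ≤ ℓ * ε₁ := mul_nonneg hℓ (le_trans (by positivity) (hA1 x y hnb))
      have hcs := abs_dot_le (fld u y - fld u x) ((F.U (κ * A' x y) - 1) *ᵥ fld yv y)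
      have hprod : ((n : ℝ) * siteNorm (fld u y - fld u x)) * ((n : ℝ) * siteNorm ((F.U (κ * A' x y) - 1) *ᵥ fld yv y))
          ≤ (s * B₂) * (ℓ * ε₁ * siteNorm (fld yv y)) :=
        mul_le_mul ha hb (mul_nonneg hn' (siteNorm_nonneg _)) (mul_nonneg hs0 hB₂)
      have hag := two_mul_le_sq_div_add (x := s * B₂ * (ℓ * ε₁) / 2) (y := siteNorm (fld yv y)) hσ
      rw [hw]
      calc (n : ℝ) ^ 2 / 2 * (2 * |(fld u y - fld u x) ⬝ᵥ ((F.U (κ * A' x y) - 1) *ᵥ fld yv y)|)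
          ≤ (n : ℝ) ^ 2 / 2 * (2 * (siteNorm (fld u y - fld u x)
              * siteNorm ((F.U (κ * A' x y) - 1) *ᵥ fld yv y))) := by gcongr
        _ = ((n : ℝ) * siteNorm (fld u y - fld u x))
              * ((n : ℝ) * siteNorm ((F.U (κ * A' x y) - 1) *ᵥ fld yv y)) := by ring
        _ ≤ (s * B₂) * (ℓ * ε₁ * siteNorm (fld yv y)) := hprod
        _ = 2 * (s * B₂ * (ℓ * ε₁) / 2) * siteNorm (fld yv y) := by ring
        _ ≤ (s * B₂ * (ℓ * ε₁) / 2) ^ 2 / σ + σ * siteNorm (fld yv y) ^ 2 := hag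
        _ = B + σ * siteNorm (fld yv y) ^ 2 := by rw [hB]
    · rw [if_neg hnb, if_neg hnb, add_zero]
      have hw : boxWt n (fun i => n * twoBlk μ i) x y = 0 := by
        unfold boxWt; rw [if_neg hnb, mul_zero]
      rw [hw, zero_mul]
  have hsplit := Finset.sum_le_sum (s := Finset.univ) fun x (_ : x ∈ Finset.univ) =>
    Finset.sum_le_sum (s := Finset.univ) fun y (_ : y ∈ Finset.univ) => hpt x y
  have hsq : ∀ y : ↥(boxDom (fun i => n * twoBlk μ i)), 0 ≤ σ * siteNorm (fld yv y) ^ 2 := fun y => by positivity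
  calc ∑ x, ∑ y, boxWt n (fun i => n * twoBlk μ i) x y
          * (2 * |(fld u y - fld u x) ⬝ᵥ ((F.U (κ * A' x y) - 1) *ᵥ fld yv y)|)
      ≤ ∑ x : ↥(boxDom (fun i => n * twoBlk μ i)), ∑ y : ↥(boxDom (fun i => n * twoBlk μ i)),
          ((if y.1 ∈ nbrs x.1 then B else 0) + (if y.1 ∈ nbrs x.1 then σ * siteNorm (fld yv y) ^ 2 else 0)) := hsplit
    _ = (∑ x : ↥(boxDom (fun i => n * twoBlk μ i)), ∑ y : ↥(boxDom (fun i => n * twoBlk μ i)),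
            (if y.1 ∈ nbrs x.1 then B else 0))
          + ∑ x : ↥(boxDom (fun i => n * twoBlk μ i)), ∑ y : ↥(boxDom (fun i => n * twoBlk μ i)),
            (if y.1 ∈ nbrs x.1 then σ * siteNorm (fld yv y) ^ 2 else 0) := by
        simp only [Finset.sum_add_distrib]
    _ ≤ 2 * (n : ℝ) ^ (d + 1) * (2 * ((d : ℝ) + 1) * B)
          + 2 * ((d : ℝ) + 1) * ∑ y : ↥(boxDom (fun i => n * twoBlk μ i)), σ * siteNorm (fld yv y) ^ 2 :=
        add_le_add (sum_bond_le hn μ hB0 _ fun x y => le_rfl) (sum_nbrs_fun_le μ _ hsq)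
    _ = ((d : ℝ) + 1) * (ℓ ^ 2 * ε₁ ^ 2 * B₂ ^ 2) / σ * (s * s * (n : ℝ) ^ (d + 1))
          + 2 * ((d : ℝ) + 1) * σ * (yv ⬝ᵥ yv) := by
        rw [← Finset.mul_sum, sum_siteNorm_sq, hB]
        ring
    _ = _ := by rw [hs2, mul_one]

/-- **V3a** — `2a n^{−(d+1)}Σ_y |⟨((Q₁−Q₀)u₀)(y), (Q₁y)(y)⟩| ≤ 2(aℓε₂n^{−(d+1)/2}B₁)·Σ_z|y(z)|`. [cite: Balaban1983RegularityDecay, (1.4)–(1.5) p.572, p.590 «Using Lemma 2.1 …»] -/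
theorem sum_block_pairA_le {n : ℕ} (hn : 1 ≤ n) (μ : Fin (d + 1)) (F : OrthFlow ι) {ℓ : ℝ} (hℓ : 0 ≤ ℓ)
    (hLip : ∀ t (v : ι → ℝ), ((F.U t - 1) *ᵥ v) ⬝ᵥ ((F.U t - 1) *ᵥ v) ≤ (ℓ * t) ^ 2 * (v ⬝ᵥ v)) (κ : ℝ)
    {a : ℝ} (ha : 0 ≤ a) (emb : ↥(boxDom (twoBlk μ)) → ↥(boxDom (fun i => n * twoBlk μ i)))
    (Γ : ↥(boxDom (twoBlk μ)) → ↥(boxDom (fun i => n * twoBlk μ i)) → List ↥(boxDom (fun i => n * twoBlk μ i)))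
    (A' : ↥(boxDom (fun i => n * twoBlk μ i)) → ↥(boxDom (fun i => n * twoBlk μ i)) → ℝ) {ε₂ : ℝ}
    (hε₂ : 0 ≤ ε₂)
    (hA2 : ∀ (y : ↥(boxDom (twoBlk μ))) (x : ↥(boxDom (fun i => n * twoBlk μ i))), blk n x.1 = y.1 →
      |κ * lsum A' (emb y) (Γ y x)| ≤ ε₂)
    (u : ↥(boxDom (fun i => n * twoBlk μ i)) × ι → ℝ) {B₁ : ℝ} (hB₁ : 0 ≤ B₁)
    (hU1 : ∀ z, siteNorm (fld u z) ≤ (Real.sqrt ((n : ℝ) ^ (d + 1)))⁻¹ * B₁)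
    (yv : ↥(boxDom (fun i => n * twoBlk μ i)) × ι → ℝ) :
    a * ((n : ℝ) ^ (d + 1))⁻¹ * ∑ y, (2 * |(∑ x, blkWt n (twoBlk μ) (fun i => n * twoBlk μ i) y x
          • ((F.U (κ * lsum A' (emb y) (Γ y x)) - 1) *ᵥ fld u x))
        ⬝ᵥ (∑ x, blkWt n (twoBlk μ) (fun i => n * twoBlk μ i) y x
          • (F.U (κ * lsum A' (emb y) (Γ y x)) *ᵥ fld yv x))|)
      ≤ 2 * (a * ℓ * ε₂ * ((Real.sqrt ((n : ℝ) ^ (d + 1)))⁻¹ * B₁)) * ∑ z, siteNorm (fld yv z) := by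
  set s : ℝ := (Real.sqrt ((n : ℝ) ^ (d + 1)))⁻¹ with hs
  set m : ℝ := (n : ℝ) ^ (d + 1) with hmdef
  have hm : 0 < m := by
    have : (0 : ℝ) < n := by exact_mod_cast (show 0 < n by omega)
    rw [hmdef]; positivity
  have hs0 : 0 ≤ s := by rw [hs]; positivity
  set ω : ↥(boxDom (twoBlk μ)) → ↥(boxDom (fun i => n * twoBlk μ i)) → ℝ :=
    blkWt n (twoBlk μ) (fun i => n * twoBlk μ i) with hω
  have hω0 : ∀ y x, 0 ≤ ω y x := by
    intro y x; simp only [hω, blkWt]; split_ifs <;> norm_num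
  have hωsum : ∀ y, ∑ x, ω y x = m := fun y => sum_blkWt_box hn μ y
  have hωcol : ∀ x, ∑ y, ω y x = 1 := fun x => sum_blkWt_col_box hn μ x
  -- `|(Q₁−Q₀)u₀(y)| ≤ m ℓε₂ sB₁`
  have hP : ∀ y, siteNorm (∑ x, ω y x • ((F.U (κ * lsum A' (emb y) (Γ y x)) - 1) *ᵥ fld u x))
      ≤ m * (ℓ * ε₂ * (s * B₁)) := by
    intro y
    refine (siteNorm_wsum_le (hω0 y) _).trans ?_
    rw [← hωsum y, Finset.sum_mul]
    refine Finset.sum_le_sum fun x _ => ?_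
    by_cases hb : blk n x.1 = y.1
    · refine mul_le_mul_of_nonneg_left ?_ (hω0 y x)
      calc siteNorm ((F.U (κ * lsum A' (emb y) (Γ y x)) - 1) *ᵥ fld u x)
          ≤ ℓ * |κ * lsum A' (emb y) (Γ y x)| * siteNorm (fld u x) := siteNorm_flow_sub_one_le F hℓ hLip _ _
        _ ≤ ℓ * ε₂ * (s * B₁) :=
            mul_le_mul (mul_le_mul_of_nonneg_left (hA2 y x hb) hℓ) (hU1 x) (siteNorm_nonneg _) (by positivity)
    · have : ω y x = 0 := by simp only [hω, blkWt, if_neg hb]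
      rw [this, zero_mul, zero_mul]
  -- `|Q₁y(y)| ≤ Σ_x ω |y(x)|`
  have hQ : ∀ y, siteNorm (∑ x, ω y x • (F.U (κ * lsum A' (emb y) (Γ y x)) *ᵥ fld yv x))
      ≤ ∑ x, ω y x * siteNorm (fld yv x) := by
    intro y
    refine (siteNorm_wsum_le (hω0 y) _).trans (Finset.sum_le_sum fun x _ => ?_)
    rw [siteNorm_flow]
  have hyb : ∀ y, 2 * |(∑ x, ω y x • ((F.U (κ * lsum A' (emb y) (Γ y x)) - 1) *ᵥ fld u x))
        ⬝ᵥ (∑ x, ω y x • (F.U (κ * lsum A' (emb y) (Γ y x)) *ᵥ fld yv x))|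
      ≤ 2 * ((m * (ℓ * ε₂ * (s * B₁))) * ∑ x, ω y x * siteNorm (fld yv x)) := fun y =>
    mul_le_mul_of_nonneg_left ((abs_dot_le _ _).trans (mul_le_mul (hP y) (hQ y) (siteNorm_nonneg _)
      (by positivity))) zero_le_two
  have hpre : 0 ≤ a * m⁻¹ := by positivity
  calc a * m⁻¹ * ∑ y, (2 * |(∑ x, ω y x • ((F.U (κ * lsum A' (emb y) (Γ y x)) - 1) *ᵥ fld u x))
          ⬝ᵥ (∑ x, ω y x • (F.U (κ * lsum A' (emb y) (Γ y x)) *ᵥ fld yv x))|)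
      ≤ a * m⁻¹ * ∑ y, 2 * ((m * (ℓ * ε₂ * (s * B₁))) * ∑ x, ω y x * siteNorm (fld yv x)) :=
        mul_le_mul_of_nonneg_left (Finset.sum_le_sum fun y _ => hyb y) hpre
    _ = 2 * (a * ℓ * ε₂ * (s * B₁)) * (m * m⁻¹) * ∑ y, ∑ x, ω y x * siteNorm (fld yv x) := by
        rw [← Finset.mul_sum, ← Finset.mul_sum]; ring
    _ = 2 * (a * ℓ * ε₂ * (s * B₁)) * ∑ z, siteNorm (fld yv z) := by
        rw [mul_inv_cancel₀ hm.ne', mul_one, Finset.sum_comm]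
        congr 1
        refine Finset.sum_congr rfl fun x _ => ?_
        rw [← Finset.sum_mul, hωcol x, one_mul]

/-- **V3b** — `2a n^{−(d+1)}Σ_y |⟨(Q₀u₀)(y), ((Q₁−Q₀)y)(y)⟩| ≤ 2(aℓε₂n^{−(d+1)/2}B₁)·Σ_z|y(z)|`. [cite: Balaban1983RegularityDecay, (1.4)–(1.5) p.572, p.590 «Using Lemma 2.1 …»] -/
theorem sum_block_pairB_le {n : ℕ} (hn : 1 ≤ n) (μ : Fin (d + 1)) (F : OrthFlow ι) {ℓ : ℝ} (hℓ : 0 ≤ ℓ)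
    (hLip : ∀ t (v : ι → ℝ), ((F.U t - 1) *ᵥ v) ⬝ᵥ ((F.U t - 1) *ᵥ v) ≤ (ℓ * t) ^ 2 * (v ⬝ᵥ v)) (κ : ℝ)
    {a : ℝ} (ha : 0 ≤ a) (emb : ↥(boxDom (twoBlk μ)) → ↥(boxDom (fun i => n * twoBlk μ i)))
    (Γ : ↥(boxDom (twoBlk μ)) → ↥(boxDom (fun i => n * twoBlk μ i)) → List ↥(boxDom (fun i => n * twoBlk μ i)))
    (A' : ↥(boxDom (fun i => n * twoBlk μ i)) → ↥(boxDom (fun i => n * twoBlk μ i)) → ℝ) {ε₂ : ℝ}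
    (hε₂ : 0 ≤ ε₂)
    (hA2 : ∀ (y : ↥(boxDom (twoBlk μ))) (x : ↥(boxDom (fun i => n * twoBlk μ i))), blk n x.1 = y.1 →
      |κ * lsum A' (emb y) (Γ y x)| ≤ ε₂)
    (u : ↥(boxDom (fun i => n * twoBlk μ i)) × ι → ℝ) {B₁ : ℝ} (hB₁ : 0 ≤ B₁)
    (hU1 : ∀ z, siteNorm (fld u z) ≤ (Real.sqrt ((n : ℝ) ^ (d + 1)))⁻¹ * B₁)
    (yv : ↥(boxDom (fun i => n * twoBlk μ i)) × ι → ℝ) :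
    a * ((n : ℝ) ^ (d + 1))⁻¹ * ∑ y, (2 * |(∑ x, blkWt n (twoBlk μ) (fun i => n * twoBlk μ i) y x • fld u x)
        ⬝ᵥ (∑ x, blkWt n (twoBlk μ) (fun i => n * twoBlk μ i) y x
          • ((F.U (κ * lsum A' (emb y) (Γ y x)) - 1) *ᵥ fld yv x))|)
      ≤ 2 * (a * ℓ * ε₂ * ((Real.sqrt ((n : ℝ) ^ (d + 1)))⁻¹ * B₁)) * ∑ z, siteNorm (fld yv z) := by
  set s : ℝ := (Real.sqrt ((n : ℝ) ^ (d + 1)))⁻¹ with hs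
  set m : ℝ := (n : ℝ) ^ (d + 1) with hmdef
  have hm : 0 < m := by
    have : (0 : ℝ) < n := by exact_mod_cast (show 0 < n by omega)
    rw [hmdef]; positivity
  have hs0 : 0 ≤ s := by rw [hs]; positivity
  set ω : ↥(boxDom (twoBlk μ)) → ↥(boxDom (fun i => n * twoBlk μ i)) → ℝ :=
    blkWt n (twoBlk μ) (fun i => n * twoBlk μ i) with hω
  have hω0 : ∀ y x, 0 ≤ ω y x := by
    intro y x; simp only [hω, blkWt]; split_ifs <;> norm_num
  have hωsum : ∀ y, ∑ x, ω y x = m := fun y => sum_blkWt_box hn μ y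
  have hωcol : ∀ x, ∑ y, ω y x = 1 := fun x => sum_blkWt_col_box hn μ x
  have hP : ∀ y, siteNorm (∑ x, ω y x • fld u x) ≤ m * (s * B₁) := by
    intro y
    refine (siteNorm_wsum_le (hω0 y) _).trans ?_
    rw [← hωsum y, Finset.sum_mul]
    exact Finset.sum_le_sum fun x _ => mul_le_mul_of_nonneg_left (hU1 x) (hω0 y x)
  have hQ : ∀ y, siteNorm (∑ x, ω y x • ((F.U (κ * lsum A' (emb y) (Γ y x)) - 1) *ᵥ fld yv x))
      ≤ ∑ x, ω y x * (ℓ * ε₂ * siteNorm (fld yv x)) := by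
    intro y
    refine (siteNorm_wsum_le (hω0 y) _).trans (Finset.sum_le_sum fun x _ => ?_)
    by_cases hb : blk n x.1 = y.1
    · refine mul_le_mul_of_nonneg_left ?_ (hω0 y x)
      calc siteNorm ((F.U (κ * lsum A' (emb y) (Γ y x)) - 1) *ᵥ fld yv x)
          ≤ ℓ * |κ * lsum A' (emb y) (Γ y x)| * siteNorm (fld yv x) := siteNorm_flow_sub_one_le F hℓ hLip _ _
        _ ≤ ℓ * ε₂ * siteNorm (fld yv x) :=
            mul_le_mul_of_nonneg_right (mul_le_mul_of_nonneg_left (hA2 y x hb) hℓ) (siteNorm_nonneg _)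
    · have : ω y x = 0 := by simp only [hω, blkWt, if_neg hb]
      rw [this, zero_mul, zero_mul]
  have hQ0 : ∀ y, 0 ≤ ∑ x, ω y x * (ℓ * ε₂ * siteNorm (fld yv x)) := fun y =>
    Finset.sum_nonneg fun x _ => mul_nonneg (hω0 y x) (by positivity [siteNorm_nonneg (fld yv x)])
  have hyb : ∀ y, 2 * |(∑ x, ω y x • fld u x)
        ⬝ᵥ (∑ x, ω y x • ((F.U (κ * lsum A' (emb y) (Γ y x)) - 1) *ᵥ fld yv x))|
      ≤ 2 * ((m * (s * B₁)) * ∑ x, ω y x * (ℓ * ε₂ * siteNorm (fld yv x))) := fun y =>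
    mul_le_mul_of_nonneg_left ((abs_dot_le _ _).trans (mul_le_mul (hP y) (hQ y) (siteNorm_nonneg _)
      (by positivity))) zero_le_two
  have hpre : 0 ≤ a * m⁻¹ := by positivity
  calc a * m⁻¹ * ∑ y, (2 * |(∑ x, ω y x • fld u x)
          ⬝ᵥ (∑ x, ω y x • ((F.U (κ * lsum A' (emb y) (Γ y x)) - 1) *ᵥ fld yv x))|)
      ≤ a * m⁻¹ * ∑ y, 2 * ((m * (s * B₁)) * ∑ x, ω y x * (ℓ * ε₂ * siteNorm (fld yv x))) :=
        mul_le_mul_of_nonneg_left (Finset.sum_le_sum fun y _ => hyb y) hpre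
    _ = 2 * (a * ℓ * ε₂ * (s * B₁)) * (m * m⁻¹) * ∑ y, ∑ x, ω y x * siteNorm (fld yv x) := by
        have e : ∀ y, ∑ x, ω y x * (ℓ * ε₂ * siteNorm (fld yv x)) = ℓ * ε₂ * ∑ x, ω y x * siteNorm (fld yv x) := by
          intro y; rw [Finset.mul_sum]; exact Finset.sum_congr rfl fun x _ => by ring
        simp_rw [e]
        rw [← Finset.mul_sum, ← Finset.mul_sum, ← Finset.mul_sum]; ring
    _ = 2 * (a * ℓ * ε₂ * (s * B₁)) * ∑ z, siteNorm (fld yv z) := by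
        rw [mul_inv_cancel₀ hm.ne', mul_one, Finset.sum_comm]
        congr 1
        refine Finset.sum_congr rfl fun x _ => ?_
        rw [← Finset.sum_mul, hωcol x, one_mul]

/-- **V3c** — the outer pairing `2|⟨φ, (Q₁−Q₀)y⟩| ≤ 2(N₀ℓε₂n^{−(d+1)/2})·Σ_z|y(z)|` (`|φ(y)| ≤ N₀`, outer weights
`n^{−(d+1)/2}1[z ∈ B^k(y)]`). [cite: Balaban1983RegularityDecay, (1.4) p.572, (4.7) p.590] -/
theorem sum_outer_pair_le {n : ℕ} (hn : 1 ≤ n) (μ : Fin (d + 1)) (F : OrthFlow ι) {ℓ : ℝ} (hℓ : 0 ≤ ℓ)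
    (hLip : ∀ t (v : ι → ℝ), ((F.U t - 1) *ᵥ v) ⬝ᵥ ((F.U t - 1) *ᵥ v) ≤ (ℓ * t) ^ 2 * (v ⬝ᵥ v)) (κ : ℝ)
    (emb : ↥(boxDom (twoBlk μ)) → ↥(boxDom (fun i => n * twoBlk μ i)))
    (Γ : ↥(boxDom (twoBlk μ)) → ↥(boxDom (fun i => n * twoBlk μ i)) → List ↥(boxDom (fun i => n * twoBlk μ i)))
    (A' : ↥(boxDom (fun i => n * twoBlk μ i)) → ↥(boxDom (fun i => n * twoBlk μ i)) → ℝ) {ε₂ : ℝ}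
    (hε₂ : 0 ≤ ε₂)
    (hA2 : ∀ (y : ↥(boxDom (twoBlk μ))) (x : ↥(boxDom (fun i => n * twoBlk μ i))), blk n x.1 = y.1 →
      |κ * lsum A' (emb y) (Γ y x)| ≤ ε₂)
    (Ψ : ↥(boxDom (twoBlk μ)) × ι → ℝ) {N₀ : ℝ} (hN₀ : 0 ≤ N₀) (hΨ : ∀ y, siteNorm (fld Ψ y) ≤ N₀)
    (yv : ↥(boxDom (fun i => n * twoBlk μ i)) × ι → ℝ) :
    2 * |∑ y, fld Ψ y ⬝ᵥ (∑ x, outWtB n μ y x • ((F.U (κ * lsum A' (emb y) (Γ y x)) - 1) *ᵥ fld yv x))|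
      ≤ 2 * (N₀ * ℓ * ε₂ * (Real.sqrt ((n : ℝ) ^ (d + 1)))⁻¹) * ∑ z, siteNorm (fld yv z) := by
  set s : ℝ := (Real.sqrt ((n : ℝ) ^ (d + 1)))⁻¹ with hs
  have hs0 : 0 ≤ s := by rw [hs]; positivity
  set ω : ↥(boxDom (twoBlk μ)) → ↥(boxDom (fun i => n * twoBlk μ i)) → ℝ :=
    blkWt n (twoBlk μ) (fun i => n * twoBlk μ i) with hω
  have hω0 : ∀ y x, 0 ≤ ω y x := by
    intro y x; simp only [hω, blkWt]; split_ifs <;> norm_num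
  have hωcol : ∀ x, ∑ y, ω y x = 1 := fun x => sum_blkWt_col_box hn μ x
  have hout : ∀ y x, outWtB n μ y x = s * ω y x := fun y x => rfl
  have hout0 : ∀ y x, 0 ≤ outWtB n μ y x := fun y x => by rw [hout]; exact mul_nonneg hs0 (hω0 y x)
  have hQ : ∀ y, siteNorm (∑ x, outWtB n μ y x • ((F.U (κ * lsum A' (emb y) (Γ y x)) - 1) *ᵥ fld yv x))
      ≤ ∑ x, s * ω y x * (ℓ * ε₂ * siteNorm (fld yv x)) := by
    intro y
    refine (siteNorm_wsum_le (hout0 y) _).trans (Finset.sum_le_sum fun x _ => ?_)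
    rw [hout]
    by_cases hb : blk n x.1 = y.1
    · refine mul_le_mul_of_nonneg_left ?_ (mul_nonneg hs0 (hω0 y x))
      calc siteNorm ((F.U (κ * lsum A' (emb y) (Γ y x)) - 1) *ᵥ fld yv x)
          ≤ ℓ * |κ * lsum A' (emb y) (Γ y x)| * siteNorm (fld yv x) := siteNorm_flow_sub_one_le F hℓ hLip _ _
        _ ≤ ℓ * ε₂ * siteNorm (fld yv x) :=
            mul_le_mul_of_nonneg_right (mul_le_mul_of_nonneg_left (hA2 y x hb) hℓ) (siteNorm_nonneg _)
    · have : ω y x = 0 := by simp only [hω, blkWt, if_neg hb]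
      rw [this, mul_zero, zero_mul, zero_mul]
  have hQ0 : ∀ y, 0 ≤ ∑ x, s * ω y x * (ℓ * ε₂ * siteNorm (fld yv x)) := fun y =>
    Finset.sum_nonneg fun x _ => mul_nonneg (mul_nonneg hs0 (hω0 y x)) (by positivity [siteNorm_nonneg (fld yv x)])
  have hyb : ∀ y, |fld Ψ y ⬝ᵥ (∑ x, outWtB n μ y x • ((F.U (κ * lsum A' (emb y) (Γ y x)) - 1) *ᵥ fld yv x))|
      ≤ N₀ * ∑ x, s * ω y x * (ℓ * ε₂ * siteNorm (fld yv x)) := fun y =>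
    (abs_dot_le _ _).trans (mul_le_mul (hΨ y) (hQ y) (siteNorm_nonneg _) hN₀)
  calc 2 * |∑ y, fld Ψ y ⬝ᵥ (∑ x, outWtB n μ y x • ((F.U (κ * lsum A' (emb y) (Γ y x)) - 1) *ᵥ fld yv x))|
      ≤ 2 * ∑ y, |fld Ψ y ⬝ᵥ (∑ x, outWtB n μ y x • ((F.U (κ * lsum A' (emb y) (Γ y x)) - 1) *ᵥ fld yv x))| :=
        mul_le_mul_of_nonneg_left (Finset.abs_sum_le_sum_abs _ _) zero_le_two
    _ ≤ 2 * ∑ y, N₀ * ∑ x, s * ω y x * (ℓ * ε₂ * siteNorm (fld yv x)) :=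
        mul_le_mul_of_nonneg_left (Finset.sum_le_sum fun y _ => hyb y) zero_le_two
    _ = 2 * (N₀ * ℓ * ε₂ * s) * ∑ y, ∑ x, ω y x * siteNorm (fld yv x) := by
        have e : ∀ y, ∑ x, s * ω y x * (ℓ * ε₂ * siteNorm (fld yv x))
            = s * (ℓ * ε₂) * ∑ x, ω y x * siteNorm (fld yv x) := by
          intro y; rw [Finset.mul_sum]; exact Finset.sum_congr rfl fun x _ => by ring
        simp_rw [e]
        rw [← Finset.mul_sum, ← Finset.mul_sum]; ring
    _ = 2 * (N₀ * ℓ * ε₂ * s) * ∑ z, siteNorm (fld yv z) := by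
        rw [Finset.sum_comm]
        congr 1
        refine Finset.sum_congr rfl fun x _ => ?_
        rw [← Finset.sum_mul, hωcol x, one_mul]

end Box

/-! ## §5. The three brackets of the remainder on `Δ(x,x′)` at the background `0`, term by term -/

section Identities

variable {d : ℕ} {ι : Type} [Fintype ι] [DecidableEq ι]

/-- **`⟨u, (H₁ − H₀ − Ḣ)u⟩` ON THE BOX, SITEWISE** (`B4Eq47Expansion.form_b4Op_sub_sub_dH` with the kernels of §2):
the four sums estimated by `sum_bondDiff_sq_le`, `sum_bond_taylor_cross_le`, `sum_blockDiff_sq_le`,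
`sum_block_taylor_cross_le`. [cite: Balaban1983RegularityDecay, (1.3)–(1.6) p.572, p.590] -/
theorem form_H_taylor_box (n : ℕ) (a m2 : ℝ) (μ : Fin (d + 1)) (q : Matrix ι ι ℝ) (hq : qᵀ = -q) (κ : ℝ)
    (emb : ↥(boxDom (twoBlk μ)) → ↥(boxDom (fun i => n * twoBlk μ i)))
    (Γ : ↥(boxDom (twoBlk μ)) → ↥(boxDom (fun i => n * twoBlk μ i)) → List ↥(boxDom (fun i => n * twoBlk μ i)))
    (A' : ↥(boxDom (fun i => n * twoBlk μ i)) → ↥(boxDom (fun i => n * twoBlk μ i)) → ℝ)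
    (u : ↥(boxDom (fun i => n * twoBlk μ i)) × ι → ℝ) :
    u ⬝ᵥ ((b4Op (expFlow q hq) κ (boxWt n (fun i => n * twoBlk μ i)) m2 (a * ((n : ℝ) ^ (d + 1))⁻¹)
              (blkWt n (twoBlk μ) (fun i => n * twoBlk μ i)) emb Γ (0 + A')
            - b4Op (expFlow q hq) κ (boxWt n (fun i => n * twoBlk μ i)) m2 (a * ((n : ℝ) ^ (d + 1))⁻¹)
              (blkWt n (twoBlk μ) (fun i => n * twoBlk μ i)) emb Γ 0
            - dH q hq κ (boxWt n (fun i => n * twoBlk μ i)) (a * ((n : ℝ) ^ (d + 1))⁻¹)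
              (blkWt n (twoBlk μ) (fun i => n * twoBlk μ i)) emb Γ 0 A') *ᵥ u)
      = (∑ x, ∑ y, boxWt n (fun i => n * twoBlk μ i) x y
            * siteNorm (((expFlow q hq).U (κ * A' x y) - 1) *ᵥ fld u y) ^ 2
          + ∑ x, ∑ y, boxWt n (fun i => n * twoBlk μ i) x y
            * (2 * ((fld u y - fld u x)
                ⬝ᵥ (((expFlow q hq).U (κ * A' x y) - 1 - (κ * A' x y) • q) *ᵥ fld u y))))
        + (a * ((n : ℝ) ^ (d + 1))⁻¹ * ∑ y, siteNorm (∑ x, blkWt n (twoBlk μ) (fun i => n * twoBlk μ i) y x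
              • (((expFlow q hq).U (κ * lsum A' (emb y) (Γ y x)) - 1) *ᵥ fld u x)) ^ 2
          + a * ((n : ℝ) ^ (d + 1))⁻¹ * ∑ y, (2 * ((∑ x, blkWt n (twoBlk μ) (fun i => n * twoBlk μ i) y x • fld u x)
              ⬝ᵥ (∑ x, blkWt n (twoBlk μ) (fun i => n * twoBlk μ i) y x
                • (((expFlow q hq).U (κ * lsum A' (emb y) (Γ y x)) - 1 - (κ * lsum A' (emb y) (Γ y x)) • q)
                    *ᵥ fld u x))))) := by
  rw [form_b4Op_sub_sub_dH]
  simp only [zero_add]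
  congr 1
  · rw [← Finset.sum_add_distrib]
    refine Finset.sum_congr rfl fun x _ => ?_
    rw [← Finset.sum_add_distrib]
    refine Finset.sum_congr rfl fun y _ => ?_
    rw [← mul_add, dotProduct_unit, dotProduct_unit, fld_bondDiff_sub_mulVec, fld_bondDiff_zero_mulVec,
      fld_bondDiff_taylor_mulVec, siteNorm_sq]
  · rw [← mul_add]
    congr 1
    rw [dotProduct_eq_sum_fld, dotProduct_eq_sum_fld, Finset.mul_sum, ← Finset.sum_add_distrib,
      ← Finset.sum_add_distrib]
    refine Finset.sum_congr rfl fun y _ => ?_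
    rw [fld_avgOp_sub_mulVec, fld_avgOp_zero_mulVec, fld_avgOp_taylor_mulVec, siteNorm_sq]

/-- **`⟨u, (Q₁ − Q₀ − Q̇)ᵀφ⟩` ON THE BOX, SITEWISE** (outer weights): the sum estimated by `sum_outer_taylor_le`.
[cite: Balaban1983RegularityDecay, (1.4) p.572, (4.7) p.590] -/
theorem outer_taylor_box (n : ℕ) (μ : Fin (d + 1)) (q : Matrix ι ι ℝ) (hq : qᵀ = -q) (κ : ℝ)
    (emb : ↥(boxDom (twoBlk μ)) → ↥(boxDom (fun i => n * twoBlk μ i)))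
    (Γ : ↥(boxDom (twoBlk μ)) → ↥(boxDom (fun i => n * twoBlk μ i)) → List ↥(boxDom (fun i => n * twoBlk μ i)))
    (A' : ↥(boxDom (fun i => n * twoBlk μ i)) → ↥(boxDom (fun i => n * twoBlk μ i)) → ℝ)
    (u : ↥(boxDom (fun i => n * twoBlk μ i)) × ι → ℝ) (Ψ : ↥(boxDom (twoBlk μ)) × ι → ℝ) :
    u ⬝ᵥ ((avgOp (outWtB n μ) (contourTrans (fieldLink (expFlow q hq) κ (0 + A')) emb Γ)
            - avgOp (outWtB n μ) (contourTrans (fieldLink (expFlow q hq) κ 0) emb Γ)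
            - avgOp (outWtB n μ) (dT q hq κ emb Γ 0 A'))ᵀ *ᵥ Ψ)
      = ∑ y, fld Ψ y ⬝ᵥ (∑ x, outWtB n μ y x
          • (((expFlow q hq).U (κ * lsum A' (emb y) (Γ y x)) - 1 - (κ * lsum A' (emb y) (Γ y x)) • q)
              *ᵥ fld u x)) := by
  rw [Matrix.dotProduct_mulVec, Matrix.vecMul_transpose, dotProduct_comm, dotProduct_eq_sum_fld]
  simp only [zero_add]
  refine Finset.sum_congr rfl fun y _ => ?_
  rw [fld_avgOp_taylor_mulVec]

/-- the symmetric operators (1.6) pair symmetrically: `⟨(H₁−H₀)u, y⟩ = ⟨u, (H₁−H₀)y⟩`. [cite: Balaban1983RegularityDecay, (1.6) p.572] -/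
theorem b4Op_sub_mulVec_dotProduct {X Y : Type*} [Fintype X] [Fintype Y] [DecidableEq X] (F : OrthFlow ι)
    (κ : ℝ) (c : X → X → ℝ) (m2 a : ℝ) (qin : Y → X → ℝ) (emb : Y → X) (Γ : Y → X → List X)
    (A₀ A₁ : X → X → ℝ) (u y : X × ι → ℝ) :
    ((b4Op F κ c m2 a qin emb Γ A₁ - b4Op F κ c m2 a qin emb Γ A₀) *ᵥ u) ⬝ᵥ y
      = u ⬝ᵥ ((b4Op F κ c m2 a qin emb Γ A₁ - b4Op F κ c m2 a qin emb Γ A₀) *ᵥ y) := by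
  have hT : ∀ A, (b4Op F κ c m2 a qin emb Γ A)ᵀ = b4Op F κ c m2 a qin emb Γ A := by
    intro A
    unfold b4Op covOp projOp covLap
    simp only [Matrix.transpose_add, Matrix.transpose_sum, Matrix.transpose_smul, Matrix.transpose_mul,
      Matrix.transpose_transpose, Matrix.transpose_one]
  rw [Matrix.dotProduct_mulVec u _ y, ← Matrix.mulVec_transpose, Matrix.transpose_sub, hT, hT]

/-- **`⟨r, y⟩` ON THE BOX, SITEWISE** for the residual `r = (Q₁−Q₀)ᵀφ − (H₁−H₀)u₀` at the background `0`
(`B4Eq47Expansion.resid`, symmetry of (1.6), `B4Eq47Expansion.form_b4Op_sub`, the kernels of §2): the outer pairing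
minus the bond pairings minus the block pairings — the pieces estimated by `sum_outer_pair_le`, `sum_bond_pairD_le`,
`sum_bond_pairX_le`, `sum_block_pairA_le`, `sum_block_pairB_le`. [cite: Balaban1983RegularityDecay, (1.3)–(1.6) p.572, p.590] -/
theorem resid_dotProduct_box (n : ℕ) (a m2 : ℝ) (μ : Fin (d + 1)) (F : OrthFlow ι) (κ : ℝ)
    (emb : ↥(boxDom (twoBlk μ)) → ↥(boxDom (fun i => n * twoBlk μ i)))
    (Γ : ↥(boxDom (twoBlk μ)) → ↥(boxDom (fun i => n * twoBlk μ i)) → List ↥(boxDom (fun i => n * twoBlk μ i)))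
    (A' : ↥(boxDom (fun i => n * twoBlk μ i)) → ↥(boxDom (fun i => n * twoBlk μ i)) → ℝ)
    (Ψ : ↥(boxDom (twoBlk μ)) × ι → ℝ) (yv : ↥(boxDom (fun i => n * twoBlk μ i)) × ι → ℝ) :
    resid F κ (boxWt n (fun i => n * twoBlk μ i)) m2 (a * ((n : ℝ) ^ (d + 1))⁻¹)
        (blkWt n (twoBlk μ) (fun i => n * twoBlk μ i)) (outWtB n μ) emb Γ 0 A' Ψ ⬝ᵥ yv
      = (∑ y, fld Ψ y ⬝ᵥ (∑ x, outWtB n μ y x • ((F.U (κ * lsum A' (emb y) (Γ y x)) - 1) *ᵥ fld yv x)))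
        - ((∑ x, ∑ z, boxWt n (fun i => n * twoBlk μ i) x z
              * ((((F.U (κ * A' x z) - 1) *ᵥ fld (uFld F κ (boxWt n (fun i => n * twoBlk μ i)) m2
                    (a * ((n : ℝ) ^ (d + 1))⁻¹) (blkWt n (twoBlk μ) (fun i => n * twoBlk μ i)) (outWtB n μ)
                    emb Γ 0 Ψ) z)
                  ⬝ᵥ (F.U (κ * A' x z) *ᵥ fld yv z - fld yv x))
                + ((fld (uFld F κ (boxWt n (fun i => n * twoBlk μ i)) m2 (a * ((n : ℝ) ^ (d + 1))⁻¹)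
                      (blkWt n (twoBlk μ) (fun i => n * twoBlk μ i)) (outWtB n μ) emb Γ 0 Ψ) z
                    - fld (uFld F κ (boxWt n (fun i => n * twoBlk μ i)) m2 (a * ((n : ℝ) ^ (d + 1))⁻¹)
                      (blkWt n (twoBlk μ) (fun i => n * twoBlk μ i)) (outWtB n μ) emb Γ 0 Ψ) x)
                  ⬝ᵥ ((F.U (κ * A' x z) - 1) *ᵥ fld yv z))))
          + a * ((n : ℝ) ^ (d + 1))⁻¹
            * ((∑ y, (∑ x, blkWt n (twoBlk μ) (fun i => n * twoBlk μ i) y x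
                  • ((F.U (κ * lsum A' (emb y) (Γ y x)) - 1) *ᵥ fld (uFld F κ (boxWt n (fun i => n * twoBlk μ i))
                      m2 (a * ((n : ℝ) ^ (d + 1))⁻¹) (blkWt n (twoBlk μ) (fun i => n * twoBlk μ i)) (outWtB n μ)
                      emb Γ 0 Ψ) x))
                ⬝ᵥ (∑ x, blkWt n (twoBlk μ) (fun i => n * twoBlk μ i) y x
                  • (F.U (κ * lsum A' (emb y) (Γ y x)) *ᵥ fld yv x)))
              + ∑ y, (∑ x, blkWt n (twoBlk μ) (fun i => n * twoBlk μ i) y x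
                  • fld (uFld F κ (boxWt n (fun i => n * twoBlk μ i)) m2 (a * ((n : ℝ) ^ (d + 1))⁻¹)
                      (blkWt n (twoBlk μ) (fun i => n * twoBlk μ i)) (outWtB n μ) emb Γ 0 Ψ) x)
                ⬝ᵥ (∑ x, blkWt n (twoBlk μ) (fun i => n * twoBlk μ i) y x
                  • ((F.U (κ * lsum A' (emb y) (Γ y x)) - 1) *ᵥ fld yv x)))) := by
  unfold resid
  rw [sub_dotProduct]
  congr 1
  · rw [dotProduct_comm _ yv, Matrix.dotProduct_mulVec yv, Matrix.vecMul_transpose, dotProduct_comm _ Ψ,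
      dotProduct_eq_sum_fld]
    refine Finset.sum_congr rfl fun y _ => ?_
    rw [fld_avgOp_sub_mulVec]
  · rw [b4Op_sub_mulVec_dotProduct, form_b4Op_sub]
    congr 1
    · refine Finset.sum_congr rfl fun x _ => Finset.sum_congr rfl fun z _ => ?_
      congr 1
      rw [dotProduct_unit, dotProduct_unit, fld_bondDiff_sub_mulVec, fld_bondDiff_mulVec',
        fld_bondDiff_zero_mulVec, fld_bondDiff_sub_mulVec]
    · congr 1
      rw [dotProduct_eq_sum_fld, dotProduct_eq_sum_fld]
      congr 1
      · refine Finset.sum_congr rfl fun y _ => ?_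
        rw [fld_avgOp_sub_mulVec, fld_avgOp_mulVec']
      · refine Finset.sum_congr rfl fun y _ => ?_
        rw [fld_avgOp_zero_mulVec, fld_avgOp_sub_mulVec]

/-- **THE ENERGY PART OF (1.6) DOMINATES THE BOND SUM**: `Σ c|U(κA′)y(z′) − y(z)|² ≤ ⟨y, H(A′)y⟩` (`m² ≥ 0`,
`a ≥ 0`; (1.3) + (1.5) ≥ 0). [cite: Balaban1983RegularityDecay, (1.3)–(1.6) p.572] -/
theorem bond_energy_le_form {n : ℕ} {a m2 : ℝ} (ha : 0 ≤ a) (hm2 : 0 ≤ m2) (μ : Fin (d + 1)) (F : OrthFlow ι) (κ : ℝ)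
    (emb : ↥(boxDom (twoBlk μ)) → ↥(boxDom (fun i => n * twoBlk μ i)))
    (Γ : ↥(boxDom (twoBlk μ)) → ↥(boxDom (fun i => n * twoBlk μ i)) → List ↥(boxDom (fun i => n * twoBlk μ i)))
    (A' : ↥(boxDom (fun i => n * twoBlk μ i)) → ↥(boxDom (fun i => n * twoBlk μ i)) → ℝ)
    (yv : ↥(boxDom (fun i => n * twoBlk μ i)) × ι → ℝ) :
    ∑ x, ∑ y, boxWt n (fun i => n * twoBlk μ i) x y * siteNorm (F.U (κ * A' x y) *ᵥ fld yv y - fld yv x) ^ 2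
      ≤ yv ⬝ᵥ (b4Op F κ (boxWt n (fun i => n * twoBlk μ i)) m2 (a * ((n : ℝ) ^ (d + 1))⁻¹)
          (blkWt n (twoBlk μ) (fun i => n * twoBlk μ i)) emb Γ A' *ᵥ yv) := by
  have e : ∑ x, ∑ y, boxWt n (fun i => n * twoBlk μ i) x y * siteNorm (F.U (κ * A' x y) *ᵥ fld yv y - fld yv x) ^ 2
      = yv ⬝ᵥ (covLap (boxWt n (fun i => n * twoBlk μ i)) (fieldLink F κ A') *ᵥ yv) := by
    rw [covLap_form]
    simp only [siteNorm_sq]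
    rfl
  rw [e]
  unfold b4Op
  rw [covOp_form, projOp_form]
  have h1 : 0 ≤ m2 * (yv ⬝ᵥ yv) := mul_nonneg hm2 (dotProduct_self_nonneg' yv)
  have h2 : 0 ≤ a * ((n : ℝ) ^ (d + 1))⁻¹
      * ((avgOp (blkWt n (twoBlk μ) (fun i => n * twoBlk μ i)) (contourTrans (fieldLink F κ A') emb Γ) *ᵥ yv)
        ⬝ᵥ (avgOp (blkWt n (twoBlk μ) (fun i => n * twoBlk μ i)) (contourTrans (fieldLink F κ A') emb Γ) *ᵥ yv)) :=
    mul_nonneg (by positivity) (dotProduct_self_nonneg' _)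
  linarith

end Identities

/-! ## §6. «Using Lemma 2.1»: the variational bound on the second-order term `⟨r, G_k(Δ,A′)r⟩` -/

section Variational

variable {d : ℕ} {ι : Type} [Fintype ι] [DecidableEq ι]
set_option maxHeartbeats 400000 in
/-- **THE VARIATIONAL INEQUALITY `2⟨r,y⟩ − ⟨y,H(A′)y⟩ ≤ M` FOR EVERY `y`** on `Δ(x,x′)`, with `⟨r,y⟩` in the sitewise form
of `resid_dotProduct_box` (any `u` with `|u(z)| ≤ n^{−(d+1)/2}B₁`, `n|u(z′)−u(z)| ≤ n^{−(d+1)/2}B₂` on bonds, `|φ(y)| ≤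
N₀`), the field bounds `n|κA′_b| ≤ ε₁`, `|κA′(Γ)| ≤ ε₂`, and the uniform positivity `⟨y,H(A′)y⟩ ≥ γ|y|²` ((1.8),
Lemma 2.1's input): `M = 4(d+1)ℓ²ε₁²B₁² + 8(d+1)²ℓ²ε₁²B₂²/γ + 8ℓ²ε₂²(2aB₁+N₀)²/γ` — the bond pairings are absorbed
half by the energy `Σc|D₁y|²` and half by `γ|y|²`, the block and outer pairings by `γ|y|²`.
[cite: Balaban1983RegularityDecay, (1.8) p.573, p.590 «Using Lemma 2.1 the remaining terms can be easily estimated»] -/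
theorem variational_M {n : ℕ} (hn : 1 ≤ n) (μ : Fin (d + 1)) (F : OrthFlow ι) {ℓ : ℝ} (hℓ : 0 ≤ ℓ)
    (hLip : ∀ t (v : ι → ℝ), ((F.U t - 1) *ᵥ v) ⬝ᵥ ((F.U t - 1) *ᵥ v) ≤ (ℓ * t) ^ 2 * (v ⬝ᵥ v)) (κ : ℝ)
    {a m2 : ℝ} (ha : 0 ≤ a) (hm2 : 0 ≤ m2) (emb : ↥(boxDom (twoBlk μ)) → ↥(boxDom (fun i => n * twoBlk μ i)))
    (Γ : ↥(boxDom (twoBlk μ)) → ↥(boxDom (fun i => n * twoBlk μ i)) → List ↥(boxDom (fun i => n * twoBlk μ i)))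
    (A' : ↥(boxDom (fun i => n * twoBlk μ i)) → ↥(boxDom (fun i => n * twoBlk μ i)) → ℝ) {ε₁ ε₂ : ℝ}
    (hε₂ : 0 ≤ ε₂)
    (hA1 : ∀ x y : ↥(boxDom (fun i => n * twoBlk μ i)), y.1 ∈ nbrs x.1 → (n : ℝ) * |κ * A' x y| ≤ ε₁)
    (hA2 : ∀ (y : ↥(boxDom (twoBlk μ))) (x : ↥(boxDom (fun i => n * twoBlk μ i))), blk n x.1 = y.1 →
      |κ * lsum A' (emb y) (Γ y x)| ≤ ε₂)
    (u : ↥(boxDom (fun i => n * twoBlk μ i)) × ι → ℝ) {B₁ B₂ : ℝ} (hB₁ : 0 ≤ B₁) (hB₂ : 0 ≤ B₂)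
    (hU1 : ∀ z, siteNorm (fld u z) ≤ (Real.sqrt ((n : ℝ) ^ (d + 1)))⁻¹ * B₁)
    (hU2 : ∀ x y : ↥(boxDom (fun i => n * twoBlk μ i)), y.1 ∈ nbrs x.1 →
      (n : ℝ) * siteNorm (fld u y - fld u x) ≤ (Real.sqrt ((n : ℝ) ^ (d + 1)))⁻¹ * B₂)
    (Ψ : ↥(boxDom (twoBlk μ)) × ι → ℝ) {N₀ : ℝ} (hN₀ : 0 ≤ N₀) (hΨ : ∀ y, siteNorm (fld Ψ y) ≤ N₀)
    {γ : ℝ} (hγ : 0 < γ)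
    (hH : ∀ v, γ * (v ⬝ᵥ v) ≤ v ⬝ᵥ (b4Op F κ (boxWt n (fun i => n * twoBlk μ i)) m2 (a * ((n : ℝ) ^ (d + 1))⁻¹)
      (blkWt n (twoBlk μ) (fun i => n * twoBlk μ i)) emb Γ A' *ᵥ v))
    (yv : ↥(boxDom (fun i => n * twoBlk μ i)) × ι → ℝ) :
    2 * ((∑ y, fld Ψ y ⬝ᵥ (∑ x, outWtB n μ y x • ((F.U (κ * lsum A' (emb y) (Γ y x)) - 1) *ᵥ fld yv x)))
        - ((∑ x, ∑ z, boxWt n (fun i => n * twoBlk μ i) x z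
              * ((((F.U (κ * A' x z) - 1) *ᵥ fld u z) ⬝ᵥ (F.U (κ * A' x z) *ᵥ fld yv z - fld yv x))
                + ((fld u z - fld u x) ⬝ᵥ ((F.U (κ * A' x z) - 1) *ᵥ fld yv z))))
          + a * ((n : ℝ) ^ (d + 1))⁻¹
            * ((∑ y, (∑ x, blkWt n (twoBlk μ) (fun i => n * twoBlk μ i) y x
                  • ((F.U (κ * lsum A' (emb y) (Γ y x)) - 1) *ᵥ fld u x))
                ⬝ᵥ (∑ x, blkWt n (twoBlk μ) (fun i => n * twoBlk μ i) y x
                  • (F.U (κ * lsum A' (emb y) (Γ y x)) *ᵥ fld yv x)))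
              + ∑ y, (∑ x, blkWt n (twoBlk μ) (fun i => n * twoBlk μ i) y x • fld u x)
                ⬝ᵥ (∑ x, blkWt n (twoBlk μ) (fun i => n * twoBlk μ i) y x
                  • ((F.U (κ * lsum A' (emb y) (Γ y x)) - 1) *ᵥ fld yv x)))))
      - yv ⬝ᵥ (b4Op F κ (boxWt n (fun i => n * twoBlk μ i)) m2 (a * ((n : ℝ) ^ (d + 1))⁻¹)
          (blkWt n (twoBlk μ) (fun i => n * twoBlk μ i)) emb Γ A' *ᵥ yv)
      ≤ 4 * ((d : ℝ) + 1) * (ℓ ^ 2 * ε₁ ^ 2 * B₁ ^ 2) + 8 * ((d : ℝ) + 1) ^ 2 * (ℓ ^ 2 * ε₁ ^ 2 * B₂ ^ 2) / γ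
        + 8 * (ℓ ^ 2 * ε₂ ^ 2 * (2 * a * B₁ + N₀) ^ 2) / γ := by
  set s : ℝ := (Real.sqrt ((n : ℝ) ^ (d + 1)))⁻¹ with hs
  set m : ℝ := (n : ℝ) ^ (d + 1) with hmdef
  have hm : 0 < m := by
    have : (0 : ℝ) < n := by exact_mod_cast (show 0 < n by omega)
    rw [hmdef]; positivity
  have hs0 : 0 ≤ s := by rw [hs]; positivity
  have hs2 : s * s * m = 1 := by
    rw [hs, ← mul_inv, Real.mul_self_sqrt hm.le, inv_mul_cancel₀ hm.ne']
  set c : ↥(boxDom (fun i => n * twoBlk μ i)) → ↥(boxDom (fun i => n * twoBlk μ i)) → ℝ :=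
    boxWt n (fun i => n * twoBlk μ i) with hc
  set ω : ↥(boxDom (twoBlk μ)) → ↥(boxDom (fun i => n * twoBlk μ i)) → ℝ :=
    blkWt n (twoBlk μ) (fun i => n * twoBlk μ i) with hω
  have hwt : ∀ x z, 0 ≤ c x z := by intro x z; simp only [hc, boxWt]; split_ifs <;> positivity
  have ham : 0 ≤ a * m⁻¹ := by positivity
  -- the pieces
  set Z : ℝ := ∑ y, fld Ψ y ⬝ᵥ (∑ x, outWtB n μ y x • ((F.U (κ * lsum A' (emb y) (Γ y x)) - 1) *ᵥ fld yv x))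
    with hZ
  set p : ↥(boxDom (fun i => n * twoBlk μ i)) → ↥(boxDom (fun i => n * twoBlk μ i)) → ℝ := fun x z =>
    (((F.U (κ * A' x z) - 1) *ᵥ fld u z) ⬝ᵥ (F.U (κ * A' x z) *ᵥ fld yv z - fld yv x)) with hp
  set pq : ↥(boxDom (fun i => n * twoBlk μ i)) → ↥(boxDom (fun i => n * twoBlk μ i)) → ℝ := fun x z =>
    ((fld u z - fld u x) ⬝ᵥ ((F.U (κ * A' x z) - 1) *ᵥ fld yv z)) with hpq
  set PA : ↥(boxDom (twoBlk μ)) → ℝ := fun y =>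
    (∑ x, ω y x • ((F.U (κ * lsum A' (emb y) (Γ y x)) - 1) *ᵥ fld u x))
      ⬝ᵥ (∑ x, ω y x • (F.U (κ * lsum A' (emb y) (Γ y x)) *ᵥ fld yv x)) with hPA
  set PB : ↥(boxDom (twoBlk μ)) → ℝ := fun y =>
    (∑ x, ω y x • fld u x) ⬝ᵥ (∑ x, ω y x • ((F.U (κ * lsum A' (emb y) (Γ y x)) - 1) *ᵥ fld yv x)) with hPB
  set S₁ : ℝ := ∑ x, ∑ z, c x z * siteNorm (F.U (κ * A' x z) *ᵥ fld yv z - fld yv x) ^ 2 with hS₁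
  set L : ℝ := ∑ z, siteNorm (fld yv z) with hL
  set Hf : ℝ := yv ⬝ᵥ (b4Op F κ c m2 (a * m⁻¹) ω emb Γ A' *ᵥ yv) with hHf
  -- the five estimates
  have hV1 : ∑ x, ∑ z, c x z * (2 * |p x z|) ≤ 4 * ((d : ℝ) + 1) * (ℓ ^ 2 * ε₁ ^ 2 * B₁ ^ 2) + 1 / 2 * S₁ :=
    sum_bond_pairD_le hn μ F hℓ hLip κ A' hA1 u hU1 yv
  have hσ : 0 < γ / (8 * ((d : ℝ) + 1)) := by positivity
  have hV2 := sum_bond_pairX_le hn μ F hℓ hLip κ A' hA1 u hB₂ hU2 yv hσ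
  have hV2' : ∑ x, ∑ z, c x z * (2 * |pq x z|)
      ≤ 8 * ((d : ℝ) + 1) ^ 2 * (ℓ ^ 2 * ε₁ ^ 2 * B₂ ^ 2) / γ + γ / 4 * (yv ⬝ᵥ yv) := by
    have e1 : ((d : ℝ) + 1) * (ℓ ^ 2 * ε₁ ^ 2 * B₂ ^ 2) / (γ / (8 * ((d : ℝ) + 1)))
        = 8 * ((d : ℝ) + 1) ^ 2 * (ℓ ^ 2 * ε₁ ^ 2 * B₂ ^ 2) / γ := by
      field_simp
    have e2 : 2 * ((d : ℝ) + 1) * (γ / (8 * ((d : ℝ) + 1))) = γ / 4 := by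
      field_simp
      ring
    rw [e1, e2] at hV2
    exact hV2
  have hV3a : a * m⁻¹ * ∑ y, (2 * |PA y|) ≤ 2 * (a * ℓ * ε₂ * (s * B₁)) * L :=
    sum_block_pairA_le hn μ F hℓ hLip κ ha emb Γ A' hε₂ hA2 u hB₁ hU1 yv
  have hV3b : a * m⁻¹ * ∑ y, (2 * |PB y|) ≤ 2 * (a * ℓ * ε₂ * (s * B₁)) * L :=
    sum_block_pairB_le hn μ F hℓ hLip κ ha emb Γ A' hε₂ hA2 u hB₁ hU1 yv
  have hV3c : 2 * |Z| ≤ 2 * (N₀ * ℓ * ε₂ * s) * L := sum_outer_pair_le hn μ F hℓ hLip κ emb Γ A' hε₂ hA2 Ψ hN₀ hΨ yv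
  -- the linear terms against `γ|y|²/4`
  have hlin := two_mul_sum_siteNorm_le yv (B := s * ℓ * ε₂ * (2 * a * B₁ + N₀)) (σ := γ / 4) (by positivity)
  have hlin' : 2 * (s * ℓ * ε₂ * (2 * a * B₁ + N₀)) * L
      ≤ 8 * (ℓ ^ 2 * ε₂ ^ 2 * (2 * a * B₁ + N₀) ^ 2) / γ + γ / 4 * (yv ⬝ᵥ yv) := by
    refine hlin.trans (le_of_eq ?_)
    rw [card_box hn μ]
    have e : 2 * (n : ℝ) ^ (d + 1) * ((s * ℓ * ε₂ * (2 * a * B₁ + N₀)) ^ 2 / (γ / 4))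
        = 8 * (ℓ ^ 2 * ε₂ ^ 2 * (2 * a * B₁ + N₀) ^ 2) / γ * (s * s * m) := by
      rw [hmdef]; field_simp; ring
    rw [e, hs2, mul_one]
  have hlin_eq : 2 * (N₀ * ℓ * ε₂ * s) * L + 2 * (a * ℓ * ε₂ * (s * B₁)) * L + 2 * (a * ℓ * ε₂ * (s * B₁)) * L
      = 2 * (s * ℓ * ε₂ * (2 * a * B₁ + N₀)) * L := by ring
  -- the quadratic form from below
  have hS : S₁ ≤ Hf := bond_energy_le_form ha hm2 μ F κ emb Γ A' yv
  have hG : γ * (yv ⬝ᵥ yv) ≤ Hf := hH yv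
  -- signs: `2t ≤ 2|t|` termwise
  have hDsum : -(2 * (∑ x, ∑ z, c x z * (p x z + pq x z)))
      ≤ ∑ x, ∑ z, c x z * (2 * |p x z|) + ∑ x, ∑ z, c x z * (2 * |pq x z|) := by
    rw [← Finset.sum_add_distrib, Finset.mul_sum, ← Finset.sum_neg_distrib]
    refine Finset.sum_le_sum fun x _ => ?_
    rw [← Finset.sum_add_distrib, Finset.mul_sum, ← Finset.sum_neg_distrib]
    refine Finset.sum_le_sum fun z _ => ?_
    have hcz := hwt x z
    have h1 := mul_le_mul_of_nonneg_left (neg_le_abs (p x z)) hcz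
    have h2 := mul_le_mul_of_nonneg_left (neg_le_abs (pq x z)) hcz
    linarith
  have hBsum : -(2 * (a * m⁻¹ * (∑ y, PA y + ∑ y, PB y)))
      ≤ a * m⁻¹ * ∑ y, (2 * |PA y|) + a * m⁻¹ * ∑ y, (2 * |PB y|) := by
    have hA : -(2 * ∑ y, PA y) ≤ ∑ y, 2 * |PA y| := by
      rw [Finset.mul_sum, ← Finset.sum_neg_distrib]
      exact Finset.sum_le_sum fun y _ => by linarith [neg_le_abs (PA y)]
    have hB : -(2 * ∑ y, PB y) ≤ ∑ y, 2 * |PB y| := by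
      rw [Finset.mul_sum, ← Finset.sum_neg_distrib]
      exact Finset.sum_le_sum fun y _ => by linarith [neg_le_abs (PB y)]
    have e : -(2 * (a * m⁻¹ * (∑ y, PA y + ∑ y, PB y)))
        = a * m⁻¹ * (-(2 * ∑ y, PA y)) + a * m⁻¹ * (-(2 * ∑ y, PB y)) := by ring
    rw [e]
    exact add_le_add (mul_le_mul_of_nonneg_left hA ham) (mul_le_mul_of_nonneg_left hB ham)
  have hZle : 2 * Z ≤ 2 * |Z| := by linarith [le_abs_self Z]
  linarith

/-- `⟨r, H⁻¹r⟩ ≥ 0` for a coercive `H` (no symmetry needed: `⟨r, w⟩ = ⟨Hw, w⟩ ≥ γ|w|²`, `w = H⁻¹r`). [folklore] -/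
private theorem dotProduct_inv_mulVec_nonneg_of_coercive {m : Type*} [Fintype m] [DecidableEq m] {H : Matrix m m ℝ} {γ : ℝ}
    (hγ : 0 < γ) (hH : ∀ v, γ * (v ⬝ᵥ v) ≤ v ⬝ᵥ (H *ᵥ v)) (r : m → ℝ) : 0 ≤ r ⬝ᵥ (H⁻¹ *ᵥ r) := by
  set w := H⁻¹ *ᵥ r with hw
  have hHw : H *ᵥ w = r := by
    rw [hw, Matrix.mulVec_mulVec, Matrix.mul_nonsing_inv _ (isUnit_det_of_form_ge hγ hH), Matrix.one_mulVec]
  have h1 : r ⬝ᵥ w = w ⬝ᵥ (H *ᵥ w) := by rw [hHw, dotProduct_comm]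
  rw [h1]
  exact le_trans (mul_nonneg hγ.le (dotProduct_self_nonneg' w)) (hH w)

end Variational

/-! ## §7. «the remaining terms can be easily estimated by O(e²p²(e))(|φ(x)|² + |φ(x′)|²)» — at `A₀ = 0` -/

section Main

variable {ι : Type} [Fintype ι] [DecidableEq ι]

omit [Fintype ι] [DecidableEq ι] in
/-- the constant field `0` is the zero bond function. [folklore] -/
private theorem constBond_zero {X : Type*} {d : ℕ} (pos : X → (Fin (d + 1) → ℤ)) :
    constBond (0 : Fin (d + 1) → ℝ) pos = 0 := by
  funext u v
  simp [constBond]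

/-- **THE SECOND-ORDER REMAINDER OF (4.7) ON `Δ(x,x′)`, AT THE BACKGROUND GAUGED AWAY** («Using Lemma 2.1 the
remaining terms can be easily estimated by O(e²p²(e))(|φ(x)|² + |φ(x′)|²)», p. 590): there is `K = K(d, q, a₋, a₊,
C₍₄.₉₎) ≥ 0` such that for all scales `n ≥ 1`, `a_k ∈ [a₋,a₊]`, `m² ∈ [0,m²₊]`, every direction `μ`, coupling `κ`, block
sites `emb` and nearest-neighbour contours `Γ` of length `≤ (d+1)n` ending at their targets, every `A′` with
`n|κA′_b| ≤ ε₁` on the bonds and `|κA′(Γ_{y,z})| ≤ ε₂` on the contours of `Δ(x,x′)`, under the smallness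
`ℓ²ε₁²(d+1)(1+a_k(d+1)) ≤ min(2,a_k)/4` of Lemma 2.1's setting (`B4Lower18Regular.lower18_regular_box`), and every `φ`:
`|LHS(4.7)(A′) − LHS(4.7)(0) − (4.8)| ≤ K(ε₁+ε₂)²(|φ(x)|² + |φ(x′)|²)`.  Proof = `B4Eq47Expansion.remainder411_eq` + the
term sizes of §4 + the variational bound §6 with the uniform positivity (1.8).
[cite: Balaban1983RegularityDecay, p.590, (4.11) p.591] -/
theorem remainder_bound_zero (d : ℕ) (q : Matrix ι ι ℝ) (hq : qᵀ = -q) (aminus aplus m2plus : ℝ)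
    (ha : 0 < aminus) :
    ∃ K : ℝ, 0 ≤ K ∧ ∀ (n : ℕ) (hn : 1 ≤ n) (a m2 : ℝ), aminus ≤ a → a ≤ aplus → 0 ≤ m2 → m2 ≤ m2plus →
      ∀ (μ : Fin (d + 1)) (κ : ℝ) (emb : ↥(boxDom (twoBlk μ)) → ↥(boxDom (fun i => n * twoBlk μ i)))
        (Γ : ↥(boxDom (twoBlk μ)) → ↥(boxDom (fun i => n * twoBlk μ i)) → List ↥(boxDom (fun i => n * twoBlk μ i))),
        (∀ y x, blkWt n (twoBlk μ) (fun i => n * twoBlk μ i) y x ≠ 0 → pathEnd (emb y) (Γ y x) = x) →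
        (∀ y x, blkWt n (twoBlk μ) (fun i => n * twoBlk μ i) y x ≠ 0 →
          PathRel (fun u v : ↥(boxDom (fun i => n * twoBlk μ i)) => v.1 ∈ nbrs u.1) (emb y) (Γ y x)) →
        (∀ y x, blkWt n (twoBlk μ) (fun i => n * twoBlk μ i) y x ≠ 0 → ((Γ y x).length : ℝ) ≤ (d + 1) * n) →
        ∀ (A' : ↥(boxDom (fun i => n * twoBlk μ i)) → ↥(boxDom (fun i => n * twoBlk μ i)) → ℝ) (ε₁ ε₂ : ℝ),
        0 ≤ ε₁ → 0 ≤ ε₂ →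
        (∀ x y : ↥(boxDom (fun i => n * twoBlk μ i)), y.1 ∈ nbrs x.1 → (n : ℝ) * |κ * A' x y| ≤ ε₁) →
        (∀ (y : ↥(boxDom (twoBlk μ))) (x : ↥(boxDom (fun i => n * twoBlk μ i))), blk n x.1 = y.1 →
          |κ * lsum A' (emb y) (Γ y x)| ≤ ε₂) →
        (∑ i, ∑ j, q i j ^ 2) * ε₁ ^ 2 * ((d : ℝ) + 1) * (1 + a * ((d : ℝ) + 1)) ≤ min 2 a / 4 →
        ∀ Ψ : ↥(boxDom (twoBlk μ)) × ι → ℝ,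
          |lhs47Box (expFlow q hq) κ n a m2 μ emb Γ A' Ψ - lhs47Box (expFlow q hq) κ n a m2 μ emb Γ 0 Ψ
              - firstOrder48Box q hq κ n a m2 μ emb Γ 0 A' Ψ|
            ≤ K * (ε₁ + ε₂) ^ 2 * (siteNorm (fld Ψ (siteX μ)) ^ 2 + siteNorm (fld Ψ (siteX' μ)) ^ 2) := by
  obtain ⟨C, hC, h49⟩ := eq49 (ι := ι) d aminus aplus m2plus ha
  set L2 : ℝ := ∑ i, ∑ j, q i j ^ 2 with hL2
  have hL2n : 0 ≤ L2 := by rw [hL2]; positivity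
  set ℓ : ℝ := Real.sqrt L2 with hℓdef
  have hℓ : 0 ≤ ℓ := Real.sqrt_nonneg _
  have hℓ2 : ℓ ^ 2 = L2 := Real.sq_sqrt hL2n
  set Ap : ℝ := max aplus 0 with hAp
  set g : ℝ := 4 / min 2 aminus with hg
  have hmin : 0 < min 2 aminus := lt_min two_pos ha
  have hg0 : 0 ≤ g := by rw [hg]; positivity
  set K₀ : ℝ := 4 * ((d : ℝ) + 1) * (1 + C) ^ 2 + 8 * ((d : ℝ) + 1) ^ 2 * C ^ 2 * g + 8 * Ap ^ 2 * (3 + 2 * C) ^ 2 * g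
    + 4 * Ap * (1 + C) + 10 * ((d : ℝ) + 1) * (1 + C) ^ 2 + 6 * Ap * (1 + C) ^ 2 with hK₀
  have hK₀0 : 0 ≤ K₀ := by rw [hK₀]; positivity
  have h1C : 0 ≤ 1 + C := by positivity
  have hAp0 : 0 ≤ Ap := le_max_right _ _
  have hk1 : 0 ≤ 4 * ((d : ℝ) + 1) * (1 + C) ^ 2 := by positivity
  have hk2 : 0 ≤ 8 * ((d : ℝ) + 1) ^ 2 * C ^ 2 * g := by positivity
  have hk2' : 0 ≤ 8 * ((d : ℝ) + 1) ^ 2 * C ^ 2 := by positivity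
  have hk3 : 0 ≤ 8 * Ap ^ 2 * (3 + 2 * C) ^ 2 * g := by positivity
  have hk3' : 0 ≤ 8 * Ap ^ 2 * (3 + 2 * C) ^ 2 := by positivity
  have hk4 : 0 ≤ 4 * Ap * (1 + C) := by positivity
  have hk5 : 0 ≤ 10 * ((d : ℝ) + 1) * (1 + C) ^ 2 := by positivity
  have hk6 : 0 ≤ 6 * Ap * (1 + C) ^ 2 := by positivity
  refine ⟨2 * K₀ * L2, by positivity, ?_⟩
  intro n hn a m2 h1 h2 h3 h4 μ κ emb Γ hend hnn hlen A' ε₁ ε₂ hε₁ hε₂ hA1 hA2 hsmall Ψ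
  have ha' : 0 < a := lt_of_lt_of_le ha h1
  have haM : a ≤ Ap := h2.trans (le_max_left _ _)
  have hn0 : (0 : ℝ) < n := by exact_mod_cast (show 0 < n by omega)
  set m : ℝ := (n : ℝ) ^ (d + 1) with hmdef
  have hm : 0 < m := by rw [hmdef]; positivity
  set s : ℝ := (Real.sqrt m)⁻¹ with hs
  have hs0 : 0 ≤ s := by rw [hs]; positivity
  -- the data of (4.9)
  set v : ι → ℝ := fld Ψ (siteX μ) with hv
  set w : ι → ℝ := fld Ψ (siteX' μ) with hw
  set N : ℝ := siteNorm v + siteNorm w with hN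
  have hN0 : 0 ≤ N := add_nonneg (siteNorm_nonneg v) (siteNorm_nonneg w)
  set Xr : ℝ := siteNorm (w - v) with hXr
  have hX0 : 0 ≤ Xr := siteNorm_nonneg _
  have hXN : Xr ≤ N := by rw [hXr, siteNorm_sub_comm]; exact B4Lemma22HolderBox.siteNorm_sub_le v w
  set Φ : ↥(boxDom (fun i => n * twoBlk μ i)) → ι → ℝ := fun z i => phiK n a m2 μ v w z i with hΦ
  set c₀ : ℝ := a / (a + m2) with hc₀def
  have hc₀ : 0 ≤ c₀ := by rw [hc₀def]; positivity
  have hc₁ : c₀ ≤ 1 := by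
    rw [hc₀def, div_le_one (by linarith only [ha', h3])]
    linarith only [h3]
  have h49' := h49 n hn a m2 h1 h2 h3 h4 μ v w
  have E1 : ∀ z, siteNorm (Φ z - c₀ • v) ≤ C * Xr := by
    intro z
    refine siteNorm_le_of_abs_le hC fun i => ?_
    have h := (h49' i).1 z
    simpa only [hΦ, hc₀def, Pi.sub_apply, Pi.smul_apply, smul_eq_mul] using h
  have E2 : ∀ x y : ↥(boxDom (fun i => n * twoBlk μ i)), y.1 ∈ nbrs x.1 →
      (n : ℝ) * siteNorm (Φ y - Φ x) ≤ C * Xr := by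
    have key : ∀ (ν : Fin (d + 1)) (z ze : ↥(boxDom (fun i => n * twoBlk μ i))), ze.1 = z.1 + Pi.single ν 1 →
        (n : ℝ) * siteNorm (Φ ze - Φ z) ≤ C * Xr := by
      intro ν z ze hze
      have h : siteNorm ((n : ℝ) • (Φ ze - Φ z)) ≤ C * Xr := by
        refine siteNorm_le_of_abs_le hC fun i => ?_
        have h := (h49' i).2 ν z ze hze
        simpa only [hΦ, Pi.smul_apply, Pi.sub_apply, smul_eq_mul] using h
      rwa [siteNorm_smul, abs_of_nonneg (Nat.cast_nonneg n)] at h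
    intro x y hxy
    obtain ⟨ν, h | h⟩ := mem_nbrs.1 hxy
    · exact key ν x y h
    · have h' : x.1 = y.1 + Pi.single ν 1 := by rw [h, sub_add_cancel]
      rw [siteNorm_sub_comm]
      exact key ν y x h'
  have E3 : ∀ z, siteNorm (Φ z) ≤ (1 + C) * N := by
    intro z
    have h1' := siteNorm_add_le (c₀ • v) (Φ z - c₀ • v)
    rw [add_sub_cancel] at h1'
    have h2' : siteNorm (c₀ • v) ≤ siteNorm v := by
      rw [siteNorm_smul, abs_of_nonneg hc₀]; exact mul_le_of_le_one_left (siteNorm_nonneg v) hc₁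
    have h3' := E1 z
    have h4' : C * Xr ≤ C * N := mul_le_mul_of_nonneg_left hXN hC
    have h5' := siteNorm_nonneg w
    linarith only [h1', h2', h3', h4', h5', hN]
  -- the field `u₀ = G_k(Δ,0)Q_k^*φ` and its sizes
  set cw := boxWt n (fun i => n * twoBlk μ i) with hcw
  set ω := blkWt n (twoBlk μ) (fun i => n * twoBlk μ i) with hω
  set u₀ : ↥(boxDom (fun i => n * twoBlk μ i)) × ι → ℝ :=
    uFld (expFlow q hq) κ cw m2 (a * m⁻¹) ω (outWtB n μ) emb Γ 0 Ψ with hu₀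
  have hP := fld_phiK0_box q hq κ hn ha' h3 μ emb Γ Ψ
  have hu0 : ∀ z, fld u₀ z = a⁻¹ • (s • Φ z) := by
    intro z
    have e : a • fld u₀ z = s • Φ z := by
      have h := hP z
      exact h
    rw [← e, smul_smul, inv_mul_cancel₀ ha'.ne', one_smul]
  set B₁ : ℝ := (1 + C) * N / a with hB₁
  set B₂ : ℝ := C * Xr / a with hB₂
  have hB₁0 : 0 ≤ B₁ := div_nonneg (mul_nonneg h1C hN0) ha'.le
  have hB₂0 : 0 ≤ B₂ := div_nonneg (mul_nonneg hC hX0) ha'.le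
  have hU1 : ∀ z, siteNorm (fld u₀ z) ≤ s * B₁ := by
    intro z
    rw [hu0 z, siteNorm_smul, siteNorm_smul, abs_of_nonneg (inv_nonneg.2 ha'.le), abs_of_nonneg hs0, hB₁]
    calc a⁻¹ * (s * siteNorm (Φ z)) ≤ a⁻¹ * (s * ((1 + C) * N)) :=
          mul_le_mul_of_nonneg_left (mul_le_mul_of_nonneg_left (E3 z) hs0) (inv_nonneg.2 ha'.le)
      _ = s * ((1 + C) * N / a) := by field_simp
  have hU2 : ∀ x y : ↥(boxDom (fun i => n * twoBlk μ i)), y.1 ∈ nbrs x.1 →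
      (n : ℝ) * siteNorm (fld u₀ y - fld u₀ x) ≤ s * B₂ := by
    intro x y hxy
    rw [hu0, hu0, ← smul_sub, ← smul_sub, siteNorm_smul, siteNorm_smul, abs_of_nonneg (inv_nonneg.2 ha'.le),
      abs_of_nonneg hs0, hB₂]
    calc (n : ℝ) * (a⁻¹ * (s * siteNorm (Φ y - Φ x))) = a⁻¹ * (s * ((n : ℝ) * siteNorm (Φ y - Φ x))) := by ring
      _ ≤ a⁻¹ * (s * (C * Xr)) :=
          mul_le_mul_of_nonneg_left (mul_le_mul_of_nonneg_left (E2 x y hxy) hs0) (inv_nonneg.2 ha'.le)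
      _ = s * (C * Xr / a) := by field_simp
  have hΨN : ∀ y : ↥(boxDom (twoBlk μ)), siteNorm (fld Ψ y) ≤ N := by
    intro y
    rcases eq_siteX_or μ y with rfl | rfl
    · show siteNorm v ≤ N
      linarith only [siteNorm_nonneg w, hN]
    · show siteNorm w ≤ N
      linarith only [siteNorm_nonneg v, hN]
  -- the uniform positivity (1.8) at `A′` and at `0`
  have hLip := expFlow_lipschitz q hq
  have hA1' : ∀ x y : ↥(boxDom (fun i => n * twoBlk μ i)), y.1 ∈ nbrs x.1 →
      |κ * (A' x y - constBond (0 : Fin (d + 1) → ℝ) Subtype.val x y)| ≤ ε₁ / n := by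
    intro x y hxy
    rw [constBond_zero, Pi.zero_apply, Pi.zero_apply, sub_zero, le_div_iff₀ hn0, mul_comm]
    exact hA1 x y hxy
  have hA0' : ∀ x y : ↥(boxDom (fun i => n * twoBlk μ i)), y.1 ∈ nbrs x.1 →
      |κ * ((0 : ↥(boxDom (fun i => n * twoBlk μ i)) → ↥(boxDom (fun i => n * twoBlk μ i)) → ℝ) x y
        - constBond (0 : Fin (d + 1) → ℝ) Subtype.val x y)| ≤ ε₁ / n := by
    intro x y hxy
    have e : (0 : ↥(boxDom (fun i => n * twoBlk μ i)) → ↥(boxDom (fun i => n * twoBlk μ i)) → ℝ) x y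
        - constBond (0 : Fin (d + 1) → ℝ) Subtype.val x y = 0 := by
      rw [constBond_zero, sub_self]
    rw [e, mul_zero, abs_zero]
    exact div_nonneg hε₁ hn0.le
  have hsmall' : ℓ ^ 2 * ε₁ ^ 2 * (d + 1) * (1 + a * (d + 1)) ≤ min 2 a / 4 := by rw [hℓ2]; exact hsmall
  set γ₁ : ℝ := min 2 a / 4 + m2 with hγ₁
  have hγa : min 2 aminus ≤ min 2 a := min_le_min le_rfl h1
  have hγ₁0 : 0 < γ₁ := add_pos_of_pos_of_nonneg (div_pos (lt_min two_pos ha') four_pos) h3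
  have hγg : γ₁⁻¹ ≤ g := by
    rw [hg, ← inv_div]
    exact inv_anti₀ (div_pos hmin four_pos) (by rw [hγ₁]; linarith only [hγa, h3])
  have hH1 : ∀ yv, γ₁ * (yv ⬝ᵥ yv) ≤ yv ⬝ᵥ (b4Op (expFlow q hq) κ cw m2 (a * m⁻¹) ω emb Γ A' *ᵥ yv) :=
    fun yv => lower18_regular_box (expFlow q hq) hℓ hLip κ hn ha'.le m2 (twoBlk μ) hend hnn hlen 0 hε₁ hA1'
      hsmall' yv
  have hH0 : ∀ yv, γ₁ * (yv ⬝ᵥ yv) ≤ yv ⬝ᵥ (b4Op (expFlow q hq) κ cw m2 (a * m⁻¹) ω emb Γ 0 *ᵥ yv) :=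
    fun yv => lower18_regular_box (expFlow q hq) hℓ hLip κ hn ha'.le m2 (twoBlk μ) hend hnn hlen 0 hε₁ hA0'
      hsmall' yv
  have hdet1 : IsUnit (b4Op (expFlow q hq) κ cw m2 (a * m⁻¹) ω emb Γ A').det := isUnit_det_of_form_ge hγ₁0 hH1
  have hdet0 : IsUnit (b4Op (expFlow q hq) κ cw m2 (a * m⁻¹) ω emb Γ 0).det := isUnit_det_of_form_ge hγ₁0 hH0
  have hdet1' : IsUnit (b4Op (expFlow q hq) κ cw m2 (a * m⁻¹) ω emb Γ (0 + A')).det := by rw [zero_add]; exact hdet1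
  -- the exact remainder and its three brackets, sitewise
  have hrem := remainder411_eq q hq κ cw m2 (a * m⁻¹) ω (outWtB n μ) emb Γ a 0 A' Ψ hdet0 hdet1'
  rw [form_H_taylor_box, outer_taylor_box] at hrem
  rw [zero_add] at hrem
  rw [lhs47Box, lhs47Box, firstOrder48Box, hrem]
  -- the sizes
  set T1 : ℝ := resid (expFlow q hq) κ cw m2 (a * m⁻¹) ω (outWtB n μ) emb Γ 0 A' Ψ
    ⬝ᵥ (b4Green (expFlow q hq) κ cw m2 (a * m⁻¹) ω emb Γ A'
      *ᵥ resid (expFlow q hq) κ cw m2 (a * m⁻¹) ω (outWtB n μ) emb Γ 0 A' Ψ) with hT1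
  set T2 : ℝ := ∑ y, fld Ψ y ⬝ᵥ (∑ x, outWtB n μ y x
      • (((expFlow q hq).U (κ * lsum A' (emb y) (Γ y x)) - 1 - (κ * lsum A' (emb y) (Γ y x)) • q) *ᵥ fld u₀ x))
    with hT2
  set T3a : ℝ := ∑ x, ∑ y, cw x y * siteNorm (((expFlow q hq).U (κ * A' x y) - 1) *ᵥ fld u₀ y) ^ 2 with hT3a
  set T3b : ℝ := ∑ x, ∑ y, cw x y * (2 * ((fld u₀ y - fld u₀ x)
      ⬝ᵥ (((expFlow q hq).U (κ * A' x y) - 1 - (κ * A' x y) • q) *ᵥ fld u₀ y))) with hT3b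
  set T3c : ℝ := a * m⁻¹ * ∑ y, siteNorm (∑ x, ω y x
      • (((expFlow q hq).U (κ * lsum A' (emb y) (Γ y x)) - 1) *ᵥ fld u₀ x)) ^ 2 with hT3c
  set T3d : ℝ := a * m⁻¹ * ∑ y, (2 * ((∑ x, ω y x • fld u₀ x) ⬝ᵥ (∑ x, ω y x
      • (((expFlow q hq).U (κ * lsum A' (emb y) (Γ y x)) - 1 - (κ * lsum A' (emb y) (Γ y x)) • q)
          *ᵥ fld u₀ x)))) with hT3d
  have bT3a : T3a ≤ 2 * ((d : ℝ) + 1) * (ℓ ^ 2 * ε₁ ^ 2 * B₁ ^ 2) :=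
    sum_bondDiff_sq_le hn μ (expFlow q hq) hℓ hLip κ A' hA1 u₀ hU1
  have hwt0 : ∀ x y : ↥(boxDom (fun i => n * twoBlk μ i)), 0 ≤ cw x y := fun x y => by
    rw [hcw]; unfold boxWt
    exact mul_nonneg (div_nonneg (sq_nonneg _) zero_le_two) (by split_ifs <;> norm_num)
  have bT3a0 : 0 ≤ T3a := Finset.sum_nonneg fun x _ => Finset.sum_nonneg fun y _ =>
    mul_nonneg (hwt0 x y) (sq_nonneg _)
  have bT3b : |T3b| ≤ 8 * ((d : ℝ) + 1) * (L2 * ε₁ ^ 2 * B₁ ^ 2) :=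
    sum_bond_taylor_cross_le hn μ q hq κ A' hA1 u₀ hB₁0 hU1
  have bT3c : T3c ≤ 2 * a * (ℓ ^ 2 * ε₂ ^ 2 * B₁ ^ 2) :=
    sum_blockDiff_sq_le hn μ (expFlow q hq) hℓ hLip κ ha'.le emb Γ A' hε₂ hA2 u₀ hU1
  have bT3c0 : 0 ≤ T3c := mul_nonneg (mul_nonneg ha'.le (inv_nonneg.2 hm.le)) (Finset.sum_nonneg fun y _ => sq_nonneg _)
  have bT3d : |T3d| ≤ 4 * a * (L2 * ε₂ ^ 2 * B₁ ^ 2) :=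
    sum_block_taylor_cross_le hn μ q hq κ ha'.le emb Γ A' hA2 u₀ hB₁0 hU1
  have bT2 : |T2| ≤ 2 * N * (L2 * ε₂ ^ 2 * B₁) := sum_outer_taylor_le hn μ q hq κ emb Γ A' hA2 u₀ hU1 Ψ hN0 hΨN
  have bT1 : T1 ≤ 4 * ((d : ℝ) + 1) * (ℓ ^ 2 * ε₁ ^ 2 * B₁ ^ 2) + 8 * ((d : ℝ) + 1) ^ 2 * (ℓ ^ 2 * ε₁ ^ 2 * B₂ ^ 2) / γ₁
      + 8 * (ℓ ^ 2 * ε₂ ^ 2 * (2 * a * B₁ + N) ^ 2) / γ₁ := by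
    refine dotProduct_inv_mulVec_le_of_forall hdet1 _ fun yv => ?_
    rw [resid_dotProduct_box]
    exact variational_M hn μ (expFlow q hq) hℓ hLip κ ha'.le h3 emb Γ A' hε₂ hA1 hA2 u₀ hB₁0 hB₂0 hU1 hU2 Ψ hN0
      hΨN hγ₁0 hH1 yv
  have bT10 : 0 ≤ T1 := dotProduct_inv_mulVec_nonneg_of_coercive hγ₁0 hH1 _
  -- assembling: `|R| ≤ a²(T1 + 2|T2| + |T3|)`
  have hR : |-(a ^ 2 * (T1 + 2 * T2 - (T3a + T3b + (T3c + T3d))))|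
      ≤ a ^ 2 * (T1 + 2 * |T2| + (T3a + |T3b| + (T3c + |T3d|))) := by
    rw [abs_neg, abs_mul, abs_of_nonneg (sq_nonneg a)]
    refine mul_le_mul_of_nonneg_left ?_ (sq_nonneg a)
    have h1 := abs_add_le (T1 + 2 * T2) (-(T3a + T3b + (T3c + T3d)))
    rw [← sub_eq_add_neg, abs_neg] at h1
    have h2 := abs_add_le T1 (2 * T2)
    rw [abs_of_nonneg bT10, abs_mul, abs_two] at h2
    have h3 := abs_add_le (T3a + T3b) (T3c + T3d)
    have h4 := abs_add_le T3a T3b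
    have h5 := abs_add_le T3c T3d
    rw [abs_of_nonneg bT3a0] at h4
    rw [abs_of_nonneg bT3c0] at h5
    linarith only [h1, h2, h3, h4, h5]
  refine hR.trans ?_
  -- the sizes in terms of `Q = L2·(ε₁+ε₂)²·N²`
  set E : ℝ := ε₁ + ε₂ with hE
  set Q : ℝ := L2 * E ^ 2 * N ^ 2 with hQ
  have hE2 : 0 ≤ E ^ 2 := sq_nonneg E
  have hN2n : 0 ≤ N ^ 2 := sq_nonneg N
  have hQ0 : 0 ≤ Q := mul_nonneg (mul_nonneg hL2n hE2) hN2n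
  have hε1E : ε₁ ^ 2 ≤ E ^ 2 := pow_le_pow_left₀ hε₁ (by rw [hE]; linarith only [hε₂]) 2
  have hε2E : ε₂ ^ 2 ≤ E ^ 2 := pow_le_pow_left₀ hε₂ (by rw [hE]; linarith only [hε₁]) 2
  have hQ1 : L2 * ε₁ ^ 2 * N ^ 2 ≤ Q := mul_le_mul_of_nonneg_right (mul_le_mul_of_nonneg_left hε1E hL2n) hN2n
  have hQ2 : L2 * ε₂ ^ 2 * N ^ 2 ≤ Q := mul_le_mul_of_nonneg_right (mul_le_mul_of_nonneg_left hε2E hL2n) hN2n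
  have hP1 : 0 ≤ L2 * ε₁ ^ 2 * N ^ 2 := mul_nonneg (mul_nonneg hL2n (sq_nonneg _)) hN2n
  have hP2 : 0 ≤ L2 * ε₂ ^ 2 * N ^ 2 := mul_nonneg (mul_nonneg hL2n (sq_nonneg _)) hN2n
  have hγi0 : 0 ≤ γ₁⁻¹ := inv_nonneg.2 hγ₁0.le
  have ha2Ap : a ^ 2 ≤ Ap ^ 2 := pow_le_pow_left₀ ha'.le haM 2
  have haB₁ : a * B₁ = (1 + C) * N := by rw [hB₁]; field_simp
  have ha2B₁sq : a ^ 2 * B₁ ^ 2 = (1 + C) ^ 2 * N ^ 2 := by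
    rw [show a ^ 2 * B₁ ^ 2 = (a * B₁) ^ 2 by ring, haB₁]; ring
  have ha2B₂sq : a ^ 2 * B₂ ^ 2 = C ^ 2 * Xr ^ 2 := by
    rw [show a ^ 2 * B₂ ^ 2 = (a * B₂) ^ 2 by ring, hB₂]; field_simp
  have hXr2 : Xr ^ 2 ≤ N ^ 2 := pow_le_pow_left₀ hX0 hXN 2
  -- term by term
  have t1 : a ^ 2 * (4 * ((d : ℝ) + 1) * (ℓ ^ 2 * ε₁ ^ 2 * B₁ ^ 2)) ≤ 4 * ((d : ℝ) + 1) * (1 + C) ^ 2 * Q := by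
    rw [hℓ2, show a ^ 2 * (4 * ((d : ℝ) + 1) * (L2 * ε₁ ^ 2 * B₁ ^ 2))
      = 4 * ((d : ℝ) + 1) * (a ^ 2 * B₁ ^ 2) * (L2 * ε₁ ^ 2) by ring, ha2B₁sq]
    calc 4 * ((d : ℝ) + 1) * ((1 + C) ^ 2 * N ^ 2) * (L2 * ε₁ ^ 2)
        = 4 * ((d : ℝ) + 1) * (1 + C) ^ 2 * (L2 * ε₁ ^ 2 * N ^ 2) := by ring
      _ ≤ 4 * ((d : ℝ) + 1) * (1 + C) ^ 2 * Q := mul_le_mul_of_nonneg_left hQ1 hk1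
  have t2 : a ^ 2 * (8 * ((d : ℝ) + 1) ^ 2 * (ℓ ^ 2 * ε₁ ^ 2 * B₂ ^ 2) / γ₁)
      ≤ 8 * ((d : ℝ) + 1) ^ 2 * C ^ 2 * g * Q := by
    rw [hℓ2, show a ^ 2 * (8 * ((d : ℝ) + 1) ^ 2 * (L2 * ε₁ ^ 2 * B₂ ^ 2) / γ₁)
      = 8 * ((d : ℝ) + 1) ^ 2 * (a ^ 2 * B₂ ^ 2) * (L2 * ε₁ ^ 2) * γ₁⁻¹ by ring, ha2B₂sq]
    calc 8 * ((d : ℝ) + 1) ^ 2 * (C ^ 2 * Xr ^ 2) * (L2 * ε₁ ^ 2) * γ₁⁻¹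
        = 8 * ((d : ℝ) + 1) ^ 2 * C ^ 2 * γ₁⁻¹ * (L2 * ε₁ ^ 2 * Xr ^ 2) := by ring
      _ ≤ 8 * ((d : ℝ) + 1) ^ 2 * C ^ 2 * g * (L2 * ε₁ ^ 2 * N ^ 2) :=
          mul_le_mul (mul_le_mul_of_nonneg_left hγg hk2')
            (mul_le_mul_of_nonneg_left hXr2 (mul_nonneg hL2n (sq_nonneg _)))
            (mul_nonneg (mul_nonneg hL2n (sq_nonneg _)) (sq_nonneg _)) hk2
      _ ≤ 8 * ((d : ℝ) + 1) ^ 2 * C ^ 2 * g * Q := mul_le_mul_of_nonneg_left hQ1 hk2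
  have t3 : a ^ 2 * (8 * (ℓ ^ 2 * ε₂ ^ 2 * (2 * a * B₁ + N) ^ 2) / γ₁) ≤ 8 * Ap ^ 2 * (3 + 2 * C) ^ 2 * g * Q := by
    rw [hℓ2, show 2 * a * B₁ + N = (3 + 2 * C) * N by rw [mul_assoc, haB₁]; ring]
    calc a ^ 2 * (8 * (L2 * ε₂ ^ 2 * ((3 + 2 * C) * N) ^ 2) / γ₁)
        = 8 * a ^ 2 * (3 + 2 * C) ^ 2 * γ₁⁻¹ * (L2 * ε₂ ^ 2 * N ^ 2) := by ring
      _ ≤ 8 * Ap ^ 2 * (3 + 2 * C) ^ 2 * g * Q := by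
          refine mul_le_mul ?_ hQ2 hP2 hk3
          have h8 : 8 * a ^ 2 * (3 + 2 * C) ^ 2 ≤ 8 * Ap ^ 2 * (3 + 2 * C) ^ 2 :=
            mul_le_mul_of_nonneg_right (mul_le_mul_of_nonneg_left ha2Ap (by norm_num)) (sq_nonneg _)
          exact mul_le_mul h8 hγg hγi0 hk3'
  have t4 : a ^ 2 * (2 * (2 * N * (L2 * ε₂ ^ 2 * B₁))) ≤ 4 * Ap * (1 + C) * Q := by
    rw [show a ^ 2 * (2 * (2 * N * (L2 * ε₂ ^ 2 * B₁))) = 4 * a * (a * B₁) * N * (L2 * ε₂ ^ 2) by ring, haB₁]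
    calc 4 * a * ((1 + C) * N) * N * (L2 * ε₂ ^ 2) = 4 * a * (1 + C) * (L2 * ε₂ ^ 2 * N ^ 2) := by ring
      _ ≤ 4 * Ap * (1 + C) * Q :=
          mul_le_mul (mul_le_mul_of_nonneg_right (mul_le_mul_of_nonneg_left haM (by norm_num)) h1C)
            hQ2 hP2 hk4
  have t5 : a ^ 2 * (2 * ((d : ℝ) + 1) * (ℓ ^ 2 * ε₁ ^ 2 * B₁ ^ 2) + 8 * ((d : ℝ) + 1) * (L2 * ε₁ ^ 2 * B₁ ^ 2))
      ≤ 10 * ((d : ℝ) + 1) * (1 + C) ^ 2 * Q := by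
    rw [hℓ2, show a ^ 2 * (2 * ((d : ℝ) + 1) * (L2 * ε₁ ^ 2 * B₁ ^ 2) + 8 * ((d : ℝ) + 1) * (L2 * ε₁ ^ 2 * B₁ ^ 2))
      = 10 * ((d : ℝ) + 1) * (a ^ 2 * B₁ ^ 2) * (L2 * ε₁ ^ 2) by ring, ha2B₁sq]
    calc 10 * ((d : ℝ) + 1) * ((1 + C) ^ 2 * N ^ 2) * (L2 * ε₁ ^ 2)
        = 10 * ((d : ℝ) + 1) * (1 + C) ^ 2 * (L2 * ε₁ ^ 2 * N ^ 2) := by ring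
      _ ≤ 10 * ((d : ℝ) + 1) * (1 + C) ^ 2 * Q := mul_le_mul_of_nonneg_left hQ1 hk5
  have t6 : a ^ 2 * (2 * a * (ℓ ^ 2 * ε₂ ^ 2 * B₁ ^ 2) + 4 * a * (L2 * ε₂ ^ 2 * B₁ ^ 2)) ≤ 6 * Ap * (1 + C) ^ 2 * Q := by
    rw [hℓ2, show a ^ 2 * (2 * a * (L2 * ε₂ ^ 2 * B₁ ^ 2) + 4 * a * (L2 * ε₂ ^ 2 * B₁ ^ 2))
      = 6 * a * (a ^ 2 * B₁ ^ 2) * (L2 * ε₂ ^ 2) by ring, ha2B₁sq]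
    calc 6 * a * ((1 + C) ^ 2 * N ^ 2) * (L2 * ε₂ ^ 2) = 6 * a * (1 + C) ^ 2 * (L2 * ε₂ ^ 2 * N ^ 2) := by ring
      _ ≤ 6 * Ap * (1 + C) ^ 2 * Q :=
          mul_le_mul (mul_le_mul_of_nonneg_right (mul_le_mul_of_nonneg_left haM (by norm_num)) (sq_nonneg _))
            hQ2 hP2 hk6
  have hN2 : N ^ 2 ≤ 2 * (siteNorm v ^ 2 + siteNorm w ^ 2) := by
    rw [hN]; linarith only [sq_nonneg (siteNorm v - siteNorm w)]
  have hfin : K₀ * Q ≤ 2 * K₀ * L2 * E ^ 2 * (siteNorm v ^ 2 + siteNorm w ^ 2) := by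
    rw [hQ, show 2 * K₀ * L2 * E ^ 2 * (siteNorm v ^ 2 + siteNorm w ^ 2)
      = K₀ * (L2 * E ^ 2 * (2 * (siteNorm v ^ 2 + siteNorm w ^ 2))) by ring]
    exact mul_le_mul_of_nonneg_left (mul_le_mul_of_nonneg_left hN2 (mul_nonneg hL2n hE2)) hK₀0
  have ha2 : 0 ≤ a ^ 2 := sq_nonneg a
  have step : T1 + 2 * |T2| + (T3a + |T3b| + (T3c + |T3d|))
      ≤ (4 * ((d : ℝ) + 1) * (ℓ ^ 2 * ε₁ ^ 2 * B₁ ^ 2)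
            + 8 * ((d : ℝ) + 1) ^ 2 * (ℓ ^ 2 * ε₁ ^ 2 * B₂ ^ 2) / γ₁
            + 8 * (ℓ ^ 2 * ε₂ ^ 2 * (2 * a * B₁ + N) ^ 2) / γ₁)
          + 2 * (2 * N * (L2 * ε₂ ^ 2 * B₁))
          + ((2 * ((d : ℝ) + 1) * (ℓ ^ 2 * ε₁ ^ 2 * B₁ ^ 2) + 8 * ((d : ℝ) + 1) * (L2 * ε₁ ^ 2 * B₁ ^ 2))
            + (2 * a * (ℓ ^ 2 * ε₂ ^ 2 * B₁ ^ 2) + 4 * a * (L2 * ε₂ ^ 2 * B₁ ^ 2))) := by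
    linarith only [bT1, bT2, bT3a, bT3b, bT3c, bT3d]
  calc a ^ 2 * (T1 + 2 * |T2| + (T3a + |T3b| + (T3c + |T3d|)))
      ≤ a ^ 2 * ((4 * ((d : ℝ) + 1) * (ℓ ^ 2 * ε₁ ^ 2 * B₁ ^ 2)
            + 8 * ((d : ℝ) + 1) ^ 2 * (ℓ ^ 2 * ε₁ ^ 2 * B₂ ^ 2) / γ₁
            + 8 * (ℓ ^ 2 * ε₂ ^ 2 * (2 * a * B₁ + N) ^ 2) / γ₁)
          + 2 * (2 * N * (L2 * ε₂ ^ 2 * B₁))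
          + ((2 * ((d : ℝ) + 1) * (ℓ ^ 2 * ε₁ ^ 2 * B₁ ^ 2) + 8 * ((d : ℝ) + 1) * (L2 * ε₁ ^ 2 * B₁ ^ 2))
            + (2 * a * (ℓ ^ 2 * ε₂ ^ 2 * B₁ ^ 2) + 4 * a * (L2 * ε₂ ^ 2 * B₁ ^ 2)))) :=
        mul_le_mul_of_nonneg_left step ha2
    _ ≤ K₀ * Q := by rw [hK₀]; linarith only [t1, t2, t3, t4, t5, t6]
    _ ≤ 2 * K₀ * L2 * (ε₁ + ε₂) ^ 2 * (siteNorm (fld Ψ (siteX μ)) ^ 2 + siteNorm (fld Ψ (siteX' μ)) ^ 2) := hfin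

end Main

/-! ## §8. At a constant background `A₀` («we can "gauge away" the configuration A₀») and (4.11) in full -/

section ConstBond

variable {ι : Type} [Fintype ι] [DecidableEq ι]

/-- **THE REMAINDER AT A CONSTANT BACKGROUND IS THE REMAINDER AT `0` FOR THE GAUGED FIELD**:
`LHS(4.7)(A₀+A′)(φ) − LHS(4.7)(A₀)(φ) − (4.8)(A₀,A′,φ) = LHS(4.7)(A′)(φ″) − LHS(4.7)(0)(φ″) − (4.8)(0,A′,φ″)`,
`φ″ = gaugeOut … x φ` (gauge covariance of the left side of (4.7), r01's `lhs47_bondGauge`/`lhs47_constBond`, and of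
(4.8), `B4Ineq410FirstOrder.firstOrder48_constBond`). [cite: Balaban1983RegularityDecay, p.590 «we can "gauge away" the configuration A₀»] -/
theorem remainder_constBond_eq {d : ℕ} (q : Matrix ι ι ℝ) (hq : qᵀ = -q) (κ : ℝ) {n : ℕ} (hn : 1 ≤ n) {a m2 : ℝ}
    (ha : 0 < a) (hm2 : 0 ≤ m2) (μ : Fin (d + 1))
    {emb : ↥(boxDom (twoBlk μ)) → ↥(boxDom (fun i => n * twoBlk μ i))}
    {Γ : ↥(boxDom (twoBlk μ)) → ↥(boxDom (fun i => n * twoBlk μ i)) → List ↥(boxDom (fun i => n * twoBlk μ i))}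
    (hend : ∀ y x, blkWt n (twoBlk μ) (fun i => n * twoBlk μ i) y x ≠ 0 → pathEnd (emb y) (Γ y x) = x)
    (A₀ : Fin (d + 1) → ℝ)
    (A' : ↥(boxDom (fun i => n * twoBlk μ i)) → ↥(boxDom (fun i => n * twoBlk μ i)) → ℝ)
    (Ψ : ↥(boxDom (twoBlk μ)) × ι → ℝ) :
    lhs47Box (expFlow q hq) κ n a m2 μ emb Γ (constBond A₀ Subtype.val + A') Ψ
        - lhs47Box (expFlow q hq) κ n a m2 μ emb Γ (constBond A₀ Subtype.val) Ψ
        - firstOrder48Box q hq κ n a m2 μ emb Γ (constBond A₀ Subtype.val) A' Ψ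
      = lhs47Box (expFlow q hq) κ n a m2 μ emb Γ A' (gaugeOut (expFlow q hq) κ emb A₀ Subtype.val (siteX μ) Ψ)
        - lhs47Box (expFlow q hq) κ n a m2 μ emb Γ 0 (gaugeOut (expFlow q hq) κ emb A₀ Subtype.val (siteX μ) Ψ)
        - firstOrder48Box q hq κ n a m2 μ emb Γ 0 A' (gaugeOut (expFlow q hq) κ emb A₀ Subtype.val (siteX μ) Ψ) := by
  have hend' : ∀ y x, outWtB n μ y x ≠ 0 → pathEnd (emb y) (Γ y x) = x := by
    intro y x hne
    refine hend y x fun h0 => hne ?_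
    simp only [outWtB, h0, mul_zero]
  have hS := scalarOp_box_isUnit hn ha hm2 μ
  have e1 : lhs47Box (expFlow q hq) κ n a m2 μ emb Γ (constBond A₀ Subtype.val + A') Ψ
      = lhs47Box (expFlow q hq) κ n a m2 μ emb Γ A' (gaugeOut (expFlow q hq) κ emb A₀ Subtype.val (siteX μ) Ψ) := by
    rw [lhs47Box, lhs47Box, constBond_add_eq_bondGauge A₀ Subtype.val (linGauge A₀ Subtype.val (emb (siteX μ))) A',
      lhs47_bondGauge (expFlow q hq) κ _ m2 _ hend hend']
    rfl
  have e2 : lhs47Box (expFlow q hq) κ n a m2 μ emb Γ (constBond A₀ Subtype.val) Ψ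
      = lhs47Box (expFlow q hq) κ n a m2 μ emb Γ 0 (gaugeOut (expFlow q hq) κ emb A₀ Subtype.val (siteX μ) Ψ) := by
    rw [lhs47Box, lhs47Box, lhs47_constBond (expFlow q hq) κ _ m2 _ hend hend']
  have e3 : firstOrder48Box q hq κ n a m2 μ emb Γ (constBond A₀ Subtype.val) A' Ψ
      = firstOrder48Box q hq κ n a m2 μ emb Γ 0 A' (gaugeOut (expFlow q hq) κ emb A₀ Subtype.val (siteX μ) Ψ) := by
    rw [firstOrder48Box, firstOrder48Box,
      firstOrder48_constBond q hq κ _ m2 _ hend hend' hS a A₀ Subtype.val (siteX μ) A' Ψ]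
  rw [e1, e2, e3]

/-- **THE SECOND-ORDER REMAINDER OF (4.7) ON `Δ(x,x′)` AT A CONSTANT BACKGROUND `A₀`** — the hypothesis `hR` of
`B4Ineq410GaugeOut.ineq411` / `B4Ineq410FirstOrder.ineq411_box` DISCHARGED: with `K` of `remainder_bound_zero`,
`|LHS(4.7)(A₀+A′) − LHS(4.7)(A₀) − (4.8)| ≤ K(ε₁+ε₂)²(|φ(x)|² + |φ(x′)|²)` («O(e²p²(e))(|φ(x)|² + |φ(x′)|²)»).
[cite: Balaban1983RegularityDecay, p.590, (4.11) p.591] -/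
theorem remainder_bound_constBond (d : ℕ) (q : Matrix ι ι ℝ) (hq : qᵀ = -q) (aminus aplus m2plus : ℝ)
    (ha : 0 < aminus) :
    ∃ K : ℝ, 0 ≤ K ∧ ∀ (n : ℕ) (hn : 1 ≤ n) (a m2 : ℝ), aminus ≤ a → a ≤ aplus → 0 ≤ m2 → m2 ≤ m2plus →
      ∀ (μ : Fin (d + 1)) (κ : ℝ) (emb : ↥(boxDom (twoBlk μ)) → ↥(boxDom (fun i => n * twoBlk μ i)))
        (Γ : ↥(boxDom (twoBlk μ)) → ↥(boxDom (fun i => n * twoBlk μ i)) → List ↥(boxDom (fun i => n * twoBlk μ i))),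
        (∀ y x, blkWt n (twoBlk μ) (fun i => n * twoBlk μ i) y x ≠ 0 → pathEnd (emb y) (Γ y x) = x) →
        (∀ y x, blkWt n (twoBlk μ) (fun i => n * twoBlk μ i) y x ≠ 0 →
          PathRel (fun u v : ↥(boxDom (fun i => n * twoBlk μ i)) => v.1 ∈ nbrs u.1) (emb y) (Γ y x)) →
        (∀ y x, blkWt n (twoBlk μ) (fun i => n * twoBlk μ i) y x ≠ 0 → ((Γ y x).length : ℝ) ≤ (d + 1) * n) →
        ∀ (A₀ : Fin (d + 1) → ℝ)
        (A' : ↥(boxDom (fun i => n * twoBlk μ i)) → ↥(boxDom (fun i => n * twoBlk μ i)) → ℝ) (ε₁ ε₂ : ℝ),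
        0 ≤ ε₁ → 0 ≤ ε₂ →
        (∀ x y : ↥(boxDom (fun i => n * twoBlk μ i)), y.1 ∈ nbrs x.1 → (n : ℝ) * |κ * A' x y| ≤ ε₁) →
        (∀ (y : ↥(boxDom (twoBlk μ))) (x : ↥(boxDom (fun i => n * twoBlk μ i))), blk n x.1 = y.1 →
          |κ * lsum A' (emb y) (Γ y x)| ≤ ε₂) →
        (∑ i, ∑ j, q i j ^ 2) * ε₁ ^ 2 * ((d : ℝ) + 1) * (1 + a * ((d : ℝ) + 1)) ≤ min 2 a / 4 →
        ∀ Ψ : ↥(boxDom (twoBlk μ)) × ι → ℝ,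
          |lhs47Box (expFlow q hq) κ n a m2 μ emb Γ (constBond A₀ Subtype.val + A') Ψ
              - lhs47Box (expFlow q hq) κ n a m2 μ emb Γ (constBond A₀ Subtype.val) Ψ
              - firstOrder48Box q hq κ n a m2 μ emb Γ (constBond A₀ Subtype.val) A' Ψ|
            ≤ K * (ε₁ + ε₂) ^ 2 * (siteNorm (fld Ψ (siteX μ)) ^ 2 + siteNorm (fld Ψ (siteX' μ)) ^ 2) := by
  obtain ⟨K, hK, h⟩ := remainder_bound_zero d q hq aminus aplus m2plus ha
  refine ⟨K, hK, ?_⟩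
  intro n hn a m2 h1 h2 h3 h4 μ κ emb Γ hend hnn hlen A₀ A' ε₁ ε₂ hε₁ hε₂ hA1 hA2 hsmall Ψ
  have ha' : 0 < a := lt_of_lt_of_le ha h1
  have h0 := h n hn a m2 h1 h2 h3 h4 μ κ emb Γ hend hnn hlen A' ε₁ ε₂ hε₁ hε₂ hA1 hA2 hsmall
    (gaugeOut (expFlow q hq) κ emb A₀ Subtype.val (siteX μ) Ψ)
  rw [gaugeOut_fld_base, gaugeOut_fld, siteNorm_mulVec_of_orth ((expFlow q hq).orth _)] at h0
  rw [remainder_constBond_eq q hq κ hn ha' h3 μ hend A₀ A' Ψ]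
  exact h0

/-- **[B4] (4.11) ON THE MODEL, HYPOTHESIS-FREE** — «Thus we get (the left hand side of (4.7)) ≥ (the left hand side of
(4.7) with A replaced by A₀) − δ|U(A₀(⟨x,x′⟩))φ(x′) − φ(x)|² − O(δ^{−1})e²p²(e)(|φ(x)|² + |φ(x′)|²). (4.11)»: there are
`K, K_R ≥ 0` (depending on `d`, `q`, the window `[a₋,a₊] × [0,m²₊]`) such that for all scales `n ≥ 1`, every
direction, coupling, block sites and nearest-neighbour contours of length `≤ (d+1)n` ending at their targets, every
constant `A₀` and every `A′` with `n|κA′_b| ≤ ε₁` on bonds and `|κA′(Γ_{y,z})| ≤ ε₂` on contours, under the smallness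
`ℓ²ε₁²(d+1)(1+a_k(d+1)) ≤ min(2,a_k)/4`, every `φ` and every `δ > 0`:
`LHS(4.7)(A₀+A′) ≥ LHS(4.7)(A₀) − δ|U(κA₀(x→x′))φ(x′) − φ(x)|² − (K²/(2δ) + K_R)(ε₁+ε₂)²(|φ(x)|² + |φ(x′)|²)`
— r01's `ineq411` with BOTH hypotheses `hF` (by `B4Ineq410FirstOrder`) and `hR` (by `remainder_bound_constBond`)
discharged. [cite: Balaban1983RegularityDecay, (4.11) p.591] -/
theorem ineq411_full (d : ℕ) (q : Matrix ι ι ℝ) (hq : qᵀ = -q) (aminus aplus m2plus : ℝ) (ha : 0 < aminus) :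
    ∃ K K_R : ℝ, 0 ≤ K ∧ 0 ≤ K_R ∧ ∀ (n : ℕ) (hn : 1 ≤ n) (a m2 : ℝ), aminus ≤ a → a ≤ aplus → 0 ≤ m2 →
      m2 ≤ m2plus →
      ∀ (μ : Fin (d + 1)) (κ : ℝ) (emb : ↥(boxDom (twoBlk μ)) → ↥(boxDom (fun i => n * twoBlk μ i)))
        (Γ : ↥(boxDom (twoBlk μ)) → ↥(boxDom (fun i => n * twoBlk μ i)) → List ↥(boxDom (fun i => n * twoBlk μ i))),
        (∀ y x, blkWt n (twoBlk μ) (fun i => n * twoBlk μ i) y x ≠ 0 → pathEnd (emb y) (Γ y x) = x) →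
        (∀ y x, blkWt n (twoBlk μ) (fun i => n * twoBlk μ i) y x ≠ 0 →
          PathRel (fun u v : ↥(boxDom (fun i => n * twoBlk μ i)) => v.1 ∈ nbrs u.1) (emb y) (Γ y x)) →
        (∀ y x, blkWt n (twoBlk μ) (fun i => n * twoBlk μ i) y x ≠ 0 → ((Γ y x).length : ℝ) ≤ (d + 1) * n) →
        ∀ (A₀ : Fin (d + 1) → ℝ)
        (A' : ↥(boxDom (fun i => n * twoBlk μ i)) → ↥(boxDom (fun i => n * twoBlk μ i)) → ℝ) (ε₁ ε₂ : ℝ),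
        0 ≤ ε₁ → 0 ≤ ε₂ →
        (∀ x y : ↥(boxDom (fun i => n * twoBlk μ i)), y.1 ∈ nbrs x.1 → (n : ℝ) * |κ * A' x y| ≤ ε₁) →
        (∀ (y : ↥(boxDom (twoBlk μ))) (x : ↥(boxDom (fun i => n * twoBlk μ i))), blk n x.1 = y.1 →
          |κ * lsum A' (emb y) (Γ y x)| ≤ ε₂) →
        (∑ i, ∑ j, q i j ^ 2) * ε₁ ^ 2 * ((d : ℝ) + 1) * (1 + a * ((d : ℝ) + 1)) ≤ min 2 a / 4 →
        ∀ (Ψ : ↥(boxDom (twoBlk μ)) × ι → ℝ) (δ : ℝ), 0 < δ →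
          lhs47Box (expFlow q hq) κ n a m2 μ emb Γ (constBond A₀ Subtype.val) Ψ
              - δ * siteNorm ((expFlow q hq).U (κ * constBond A₀ Subtype.val (emb (siteX μ)) (emb (siteX' μ)))
                    *ᵥ fld Ψ (siteX' μ) - fld Ψ (siteX μ)) ^ 2
              - (K ^ 2 / (2 * δ) + K_R) * (ε₁ + ε₂) ^ 2
                  * (siteNorm (fld Ψ (siteX μ)) ^ 2 + siteNorm (fld Ψ (siteX' μ)) ^ 2)
            ≤ lhs47Box (expFlow q hq) κ n a m2 μ emb Γ (constBond A₀ Subtype.val + A') Ψ := by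
  obtain ⟨K, hK, h⟩ := ineq411_box d q hq aminus aplus m2plus ha
  obtain ⟨K_R, hK_R, hR⟩ := remainder_bound_constBond d q hq aminus aplus m2plus ha
  refine ⟨K, K_R, hK, hK_R, ?_⟩
  intro n hn a m2 h1 h2 h3 h4 μ κ emb Γ hend hnn hlen A₀ A' ε₁ ε₂ hε₁ hε₂ hA1 hA2 hsmall Ψ δ hδ
  refine h n hn a m2 h1 h2 h3 h4 μ κ emb Γ hend A₀ A' ε₁ ε₂ hε₁ hε₂ hA1 hA2 Ψ _ _ K_R δ hδ ?_
    (hR n hn a m2 h1 h2 h3 h4 μ κ emb Γ hend hnn hlen A₀ A' ε₁ ε₂ hε₁ hε₂ hA1 hA2 hsmall Ψ)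
  ring

end ConstBond

end

end Literature.MathematicalPhysics.QuantumFieldTheory.Balaban1983to89.B4Eq411Remainder
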